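import Summits.AnomalousDissipation.AnomalousDissipation.Theorems.SawtoothPulseCascadeK1LocalisedCascadeKHCombAmplitude
import Summits.AnomalousDissipation.AnomalousDissipation.Theorems.SawtoothPulseCascadeK1LocalisedCascadeKHCombEnergy
import Summits.AnomalousDissipation.AnomalousDissipation.Theorems.SawtoothPulseCascadeK1LocalisedCascadeKHModeCreation
import Summits.AnomalousDissipation.AnomalousDissipation.Theorems.SawtoothPulseCascadeK1LocalisedCascadeKHTransportParseval
import Summits.AnomalousDissipation.AnomalousDissipation.Theorems.SawtoothPulseCascadeK1LocalisedCascadeKHTransportCoeff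
import Summits.AnomalousDissipation.AnomalousDissipation.Theorems.SawtoothPulseCascadeK1LocalisedCascadeKHStraightPairEnergy
import Summits.AnomalousDissipation.AnomalousDissipation.Theorems.SawtoothPulseCascadeK1LocalisedCascadeKHTransportDuality
import Summits.AnomalousDissipation.AnomalousDissipation.Theorems.SawtoothPulseCascadeK1LocalisedCascadeKHSingleModeCreation
import Summits.AnomalousDissipation.AnomalousDissipation.Theorems.SawtoothPulseCascadeK1LocalisedCascadeKHLineKernel
import Summits.AnomalousDissipation.AnomalousDissipation.Theorems.SawtoothPulseCascadeK1LocalisedCascadeKHSheetPairEnergy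
import Summits.AnomalousDissipation.AnomalousDissipation.Theorems.SawtoothPulseCascadeK1LocalisedCascadeKHModePairedSourceNeg
import Summits.AnomalousDissipation.AnomalousDissipation.Theorems.SawtoothPulseCascadeK1LocalisedCascadeKHModePairedCreation
import Summits.AnomalousDissipation.AnomalousDissipation.Theorems.SawtoothPulseCascadeK1LocalisedCascadeKHModeSquareSum
import Summits.AnomalousDissipation.AnomalousDissipation.Theorems.SawtoothPulseCascadeK1LocalisedCascadeKHModePairedCreationOne

/-!
# K2 lane — CREATION LAWS BY NAME in energy form: the paired single-mode law, the ℓ² (energy-form) creation law, and K-uniform H-target entries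

prover ad-k1loc-p2 g12 (K2 lane), crux workfile on the dir of stmt-AnomalousDissipation-19491; companion of `K2CombColumnLaw.lean` (v12′, at the 200 kB cap)
and `K2TruncationRK.lean`; memo `K2BookReduction-p2.md` §0/§6 (background (d) of A28-1: «structure, not numbers»). Over p4's VERBATIM definitions (copied
below in THIS namespace; `Cruxes/…` modules are not importable) and verbatim copies of the glue of `K2CombColumnLaw.lean` §1/§4/§8/§9/§16/§17, this file proves:

* §21 `norm_sheetAmps_singleMode_paired` — the PAIRED single-mode law BY NAME: `‖sheetAmps a β θ (singleMode (β+n)) i‖ ≤ W_p(a,β,n,θ)` (tree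
  `…KHModePairedSource`/`…Neg` p712712/p713713 + `…KHModePairedCreation` p714232), and the BEST weight `norm_sheetAmps_singleMode_best`:
  `≤ 0.889/a` for `|β+n| < 16a`, `≤ 102a/(β+n)²` beyond (`a ≥ 4`, `0 ≤ θ ≤ 8`);
* §22 **THE ENERGY-FORM CREATION LAW** `norm_sq_sheetAmps_modeProfile_le`: for EVERY profile `c` on the window,
  `‖sheetAmps a β θ ⟨modeProfile β K c, []⟩ i‖² ≤ 8000·a·Σ_{|n|≤K} ‖c n‖²/(a²+(β+n)²)` (`a ≥ 4`, `|β| ≤ 1`; Cauchy–Schwarz + tree `…KHModeSquareSum` p714393: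
  the square sum of the weights is `O(a)` ONLY because far modes create with weight `O(a/ξ²)`; with the envelope law it grows like `K`); negative lines by
  the conjugation symmetry of §17;
* §23 `cEnergy_hPairState_hFresh_row_le` / `outEnergy_H_le_cEnergy` / **`transfer_to_H`**: the fresh H pair created by ANY lattice state on a row `|α+m| ≥ 4`
  has energy `≤ C_row ×` the row's energy; hence for every input type `t`, every source shell `s`, every window `K ≥ 1`, every class and every target shell
  `s′ ≥ 3`: `Transfer α β θ K t s H s′ (Real.sqrt C_H)` with ONE constant `C_H` — the `EntryBoundsW` TRUTH for the whole H-target half of the law matrix,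
  K-uniform with no window condition (structure, not numbers: `C_H` is lossy by ~10⁴ against the caps).
WHAT THIS IS NOT: no cap certified; V targets (core lines, B1) untouched; 19491/20024 open; AD not claimed.
-/

open Set MeasureTheory intervalIntegral

set_option linter.dupNamespace false

namespace Summit.AnomalousDissipation.AnomalousDissipation.Cruxes.K1LocalisedCascade.K2CreationLaws

open Literature.Analysis.FluidPDE.SawtoothCascade
open Summit.AnomalousDissipation.AnomalousDissipation.Theorems.SawtoothPulseCascade.K2PhaseBudget

noncomputable section

/-! ## Verbatim copies (p4: `K2ConeSketch.lean` v1.4 §0.1–§0.3, §1, §2, §4, §6.4) -/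

/-- The periodised Biot–Savart LINE KERNEL (p2's corrected sign). -/
def lineKernel (a β y : ℝ) : ℂ :=
  let κ : ℝ := 2 * Real.pi * |a|
  let r : ℝ := y - (⌊y⌋ : ℝ)
  let z : ℂ := Complex.exp (2 * Real.pi * β * Complex.I)
  Complex.exp (2 * Real.pi * β * (⌊y⌋ : ℝ) * Complex.I) *
    ((-(((Real.exp (-(κ * r)) : ℂ) / (1 - (starRingEnd ℂ z) * (Real.exp (-κ) : ℂ)))
          + (Real.exp (κ * (r - 1)) : ℂ) * z / (1 - z * (Real.exp (-κ) : ℂ)))) / (2 * κ : ℂ))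

/-- Transport multiplier of an H slot of total strain `θ` on the streamwise mode `a`. -/
def transportPhase (a θ y : ℝ) : ℂ :=
  Complex.exp (-(2 * Real.pi * a * θ * triWave y : ℝ) * Complex.I)

/-- The 2 × 2 Kelvin–Helmholtz block of the kink-sheet pair. -/
def blockX (a β : ℝ) : Matrix (Fin 2) (Fin 2) ℂ :=
  ((2 * Real.pi * a : ℝ) * Complex.I : ℂ) •
    !![-(1 / 4 : ℂ) - 2 * lineKernel a β 0, -2 * lineKernel a β (1 / 2);
       2 * starRingEnd ℂ (lineKernel a β (1 / 2)), (1 / 4 : ℂ) + 2 * lineKernel a β 0]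

/-- `λ(a, β) = -a²·c²(a, β)`. -/
def khLam (a β : ℝ) : ℝ := -(a ^ 2 * sawC2 a β)

/-- `C(t)`: `cosh(√λ t)` / `cos(√(-λ) t)` / `1`. -/
def propC (a β t : ℝ) : ℝ :=
  if 0 < khLam a β then Real.cosh (Real.sqrt (khLam a β) * t)
  else if khLam a β < 0 then Real.cos (Real.sqrt (-(khLam a β)) * t) else 1

/-- `Sn(t)`: `sinh(√λ t)/√λ` / `sin(√(-λ) t)/√(-λ)` / `t`. -/
def propSn (a β t : ℝ) : ℝ :=
  if 0 < khLam a β then Real.sinh (Real.sqrt (khLam a β) * t) / Real.sqrt (khLam a β)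
  else if khLam a β < 0 then Real.sin (Real.sqrt (-(khLam a β)) * t) / Real.sqrt (-(khLam a β)) else t

/-- The explicit propagator `P(t) = C(t)·1 + Sn(t)·X`. -/
def propagator (a β t : ℝ) : Matrix (Fin 2) (Fin 2) ℂ :=
  ((propC a β t : ℝ) : ℂ) • (1 : Matrix (Fin 2) (Fin 2) ℂ) + ((propSn a β t : ℝ) : ℂ) • blockX a β

/-- S-4 state of ONE line family. -/
structure LamState where
  interior : ℝ → ℂ
  sheets : List (ℝ × ℂ)

/-- The pure interior mode `ζ₀ ≡ 1`. -/
def pureMode : LamState := ⟨fun _ => 1, []⟩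

/-- A bare sheet pair on the kink lines with amplitudes `(q₊, q₋)` and no interior content. -/
def sheetPair (qp qm : ℂ) : LamState := ⟨fun _ => 0, [((1 / 4 : ℝ), qp), (-(1 / 4 : ℝ), qm)]⟩

/-- Forcing of the block at slot-time `s`. -/
def forcing (a β : ℝ) (st : LamState) (s : ℝ) : Fin 2 → ℂ :=
  let src : ℝ → ℂ := fun y0 =>
    (∫ y in (-(1 / 2 : ℝ))..(1 / 2), lineKernel a β (y0 - y) * st.interior y * transportPhase a s y)
      + (st.sheets.map (fun p => lineKernel a β (y0 - p.1) * p.2 * transportPhase a s p.1)).sum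
  ![((2 * Real.pi * a : ℝ) * Complex.I : ℂ) * (-2) * src (1 / 4),
    ((2 * Real.pi * a : ℝ) * Complex.I : ℂ) * 2 * src (-(1 / 4))]

/-- Fresh sheet amplitudes after strain `θ` (Duhamel): `q(θ) = ∫₀^θ P(θ - s) f(s) ds`. -/
def sheetAmps (a β θ : ℝ) (st : LamState) : Fin 2 → ℂ :=
  ∫ s in (0 : ℝ)..θ, (propagator a β (θ - s)).mulVec (forcing a β st s)

/-- THE SLOT MAP on one line family (S-2). -/
def slotMap (a β θ : ℝ) (st : LamState) : LamState :=
  ⟨fun y => st.interior y * transportPhase a θ y,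
   (st.sheets.map (fun p => (p.1, p.2 * transportPhase a θ p.1)))
     ++ [((1 / 4 : ℝ), sheetAmps a β θ st 0), (-(1 / 4 : ℝ), sheetAmps a β θ st 1)]⟩

/-- Transverse Fourier coefficient at `β + n`. -/
def coeff (β : ℝ) (st : LamState) (n : ℤ) : ℂ :=
  (∫ y in (-(1 / 2 : ℝ))..(1 / 2), st.interior y * Complex.exp (-(2 * Real.pi * (β + n) * y : ℝ) * Complex.I))
    + (st.sheets.map (fun p => p.2 * Complex.exp (-(2 * Real.pi * (β + n) * p.1 : ℝ) * Complex.I))).sum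

/-- Kinetic energy of the state on the family `(a, β)`. -/
def energy (a β : ℝ) (st : LamState) : ℝ :=
  ∑' n : ℤ, ‖coeff β st n‖ ^ 2 / (4 * Real.pi ^ 2 * (a ^ 2 + (β + n) ^ 2))

/-- Lattice state of one Bloch class `(α, β)`. -/
abbrev CState : Type := ℤ → ℤ → ℂ

/-- The truncation window `[-K, K]`. -/
def win (K : ℕ) : Finset ℤ := Finset.Icc (-(K : ℤ)) K

/-- Kinetic energy at level `ℓ` of the truncated state. -/
def cEnergy (α β : ℝ) (ℓ K : ℕ) (ζ : CState) : ℝ :=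
  ∑ m ∈ win K, ∑ n ∈ win K, ‖ζ m n‖ ^ 2 / (4 * Real.pi ^ 2 * (4 : ℝ) ^ ℓ * ((α + m) ^ 2 + (β + n) ^ 2))

/-- The transverse profile `y ↦ Σ_{|n| ≤ K} c(n) e^{2πi(β+n)y}` of a truncated coefficient row. -/
def modeProfile (β : ℝ) (K : ℕ) (c : ℤ → ℂ) : ℝ → ℂ :=
  fun y => ∑ n ∈ win K, c n * Complex.exp ((2 * Real.pi * (β + n) * y : ℝ) * Complex.I)

/-- H slot (strain `θ`), TRANSPORTED part: row `m` is the family `(α + m, β)`; its profile is multiplied by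
`transportPhase` and re-expanded (`K2SlotMap.coeff`), truncated to the window. -/
def hTransport (α β θ : ℝ) (K : ℕ) (ζ : CState) : CState := fun m n' =>
  if m ∈ win K ∧ n' ∈ win K then
    coeff β ⟨fun y => modeProfile β K (ζ m) y * transportPhase (α + m) θ y, []⟩ n'
  else 0

/-- V slot (strain `θ`), TRANSPORTED part: column `n` is the family `(β + n, α)` (roles of the coordinates exchanged),
its profile over `x` read from the column. -/
def vTransport (α β θ : ℝ) (K : ℕ) (ζ : CState) : CState := fun m' n =>
  if m' ∈ win K ∧ n ∈ win K then
    coeff α ⟨fun x => modeProfile α K (fun m => ζ m n) x * transportPhase (β + n) θ x, []⟩ m'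
  else 0

/-- V slot, FRESH V-pair densities per column. -/
def vFresh (α β θ : ℝ) (K : ℕ) (ζ : CState) : ℤ → Fin 2 → ℂ := fun n =>
  if n ∈ win K then sheetAmps (β + n) α θ ⟨modeProfile α K (fun m => ζ m n), []⟩ else 0

/-- Lattice state of a V-sheet pair with densities `p`. -/
def vPairState (α : ℝ) (p : ℤ → Fin 2 → ℂ) : CState := fun m n =>
  p n 0 * Complex.exp (-(Real.pi * (α + m) / 2 : ℝ) * Complex.I)
    + p n 1 * Complex.exp ((Real.pi * (α + m) / 2 : ℝ) * Complex.I)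

/-- Lower edges of the shells. -/
def shellLo : ℕ → ℝ
  | 0 => 0
  | 1 => 16 / 25
  | (s + 2) => (2 : ℝ) ^ (s + 1)

/-- Upper edge of shell `s`. -/
def shellHi (s : ℕ) : ℝ := shellLo (s + 1)

/-- `x` lies in shell `s`. -/
def InShell (s : ℕ) (x : ℝ) : Prop := shellLo s ≤ |x| ∧ |x| < shellHi s


/-! ## Verbatim copies, continued (p4 `K2ConeSketch.lean` §1–§4: children, fresh H pairs, phase pieces, piece types, shells, `Transfer`) -/

/-- CHILDREN re-framing (one cascade level down, period halves): the modes of class `(α, β)` with parities `(pm, pn)`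
form the child class `((α + pm)/2, (β + pn)/2)` with `ζ_child(m, n) = ζ(2m + pm, 2n + pn)`. -/
def child (pm pn : ℤ) (ζ : CState) : CState := fun m n => ζ (2 * m + pm) (2 * n + pn)

/-- The child class of `(α, β)` with parities `(pm, pn)`. -/
def childClass (α β : ℝ) (pm pn : ℤ) : ℝ × ℝ := ((α + pm) / 2, (β + pn) / 2)

/-- The parity set `{0, 1}`. -/
def parities : Finset ℤ := {0, 1}

/-- H slot, FRESH H-pair densities per row (`K2SlotMap.sheetAmps` of the row's family): `q m = (q₊, q₋)` on
`y = 1/4`, `y = -1/4`, streamwise wavenumber `α + m`. -/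
def hFresh (α β θ : ℝ) (K : ℕ) (ζ : CState) : ℤ → Fin 2 → ℂ := fun m =>
  if m ∈ win K then sheetAmps (α + m) β θ ⟨modeProfile β K (ζ m), []⟩ else 0

/-- Lattice state of an H-sheet pair with densities `q` (engine `SH`): `Z(m,n) = q₊(m) e^{-iπ(β+n)/2} + q₋(m) e^{iπ(β+n)/2}`. -/
def hPairState (β : ℝ) (q : ℤ → Fin 2 → ℂ) : CState := fun m n =>
  q m 0 * Complex.exp (-(Real.pi * (β + n) / 2 : ℝ) * Complex.I)
    + q m 1 * Complex.exp ((Real.pi * (β + n) / 2 : ℝ) * Complex.I)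

/-! ## 3. Phase pieces (material bookkeeping of one phase = H slot then V slot at one level) -/

/-- The three pieces a phase produces from the state entering it. -/
structure PhasePieces where
  /-- densities of the fresh straight V-pair created in the V slot (type V). -/
  freshV : ℤ → Fin 2 → ℂ
  /-- densities of the fresh H-pair created in the H slot; at phase end its state is `vTransport (hPairState freshH)` (type H). -/
  freshH : ℤ → Fin 2 → ℂ
  /-- debris: the entering state transported by both slots. -/
  debris : CState

/-- The phase pieces of class `(α, β)` at truncation `K` (strain `θ` per slot): `T = hTransport ζ`, `hq = hFresh ζ`,
the V slot acts on `T + hPairState hq`; fresh V densities from the whole of it, debris = `vTransport T`. -/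
def phasePieces (α β θ : ℝ) (K : ℕ) (ζ : CState) : PhasePieces :=
  let T : CState := hTransport α β θ K ζ
  let hq : ℤ → Fin 2 → ℂ := hFresh α β θ K ζ
  let S : CState := fun m n => T m n + hPairState β hq m n
  ⟨vFresh α β θ K S, hq, vTransport α β θ K T⟩

/-- The total state at phase end: fresh V pair + V-transported fresh H pair + debris. -/
def phaseTotal (α β θ : ℝ) (K : ℕ) (ζ : CState) : CState := fun m n =>
  let pc := phasePieces α β θ K ζ
  vPairState α pc.freshV m n + vTransport α β θ K (hPairState β pc.freshH) m n + pc.debris m n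

/-- The two piece types carrying a shell profile: fresh straight V pairs and once-transported H pairs. -/
inductive PType
  | V
  | H
  deriving DecidableEq, Fintype

/-- Densities restricted to shell `s` (offset `c` = the class coordinate along the sheet). -/
def restrictShell (s : ℕ) (c : ℝ) (d : ℤ → Fin 2 → ℂ) : ℤ → Fin 2 → ℂ :=
  fun (k : ℤ) => if shellLo s ≤ |c + (k : ℝ)| ∧ |c + (k : ℝ)| < shellHi s then d k else 0

/-- "the densities `d` are supported in shell `s`". -/
def SupportedIn (s : ℕ) (c : ℝ) (d : ℤ → Fin 2 → ℂ) : Prop := ∀ k : ℤ, ¬ InShell s (c + (k : ℝ)) → d k = 0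

/-- v1.3: "the densities `d` are supported in shell `s` AND in the truncation window `|k| ≤ K`" (the engine's input basis). -/
def SupportedInW (s : ℕ) (c : ℝ) (K : ℕ) (d : ℤ → Fin 2 → ℂ) : Prop :=
  SupportedIn s c d ∧ ∀ k : ℤ, k ∉ win K → d k = 0

/-- v1.3: truncation of a class state to the window `|m|, |n| ≤ K` (the engine's `(2K+1)²` arrays). -/
def truncW (K : ℕ) (ζ : CState) : CState :=
  fun (m n : ℤ) => if m ∈ win K ∧ n ∈ win K then ζ m n else 0

/-- The lattice state, at phase ENTRY (class `(α, β)`, level 0), of an input piece of type `t` with densities `d`: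
a straight V pair (v1.3: window-truncated, as the engine's `SV` on the `(2K+1)²` lattice), resp. an H pair V-transported once
(created in the previous H slot of the same level; `vTransport` is windowed already). -/
def inputState (α β θ : ℝ) (K : ℕ) : PType → (ℤ → Fin 2 → ℂ) → CState
  | PType.V, p => truncW K (vPairState α p)
  | PType.H, q => vTransport α β θ K (hPairState β q)

/-- The class coordinate along the sheets of type `t`: `β` for V pairs (densities in `β + n`), `α` for H pairs. -/
def alongCoord (α β : ℝ) : PType → ℝ
  | PType.V => β
  | PType.H => α

/-- Level-`ℓ` energy of the output piece `(t', s')` among the phase pieces `pc` of a class `(α', β')` sitting at level `ℓ`. -/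
def outEnergyAt (α' β' θ : ℝ) (K ℓ : ℕ) (s' : ℕ) (pc : PhasePieces) : PType → ℝ
  | PType.V => cEnergy α' β' ℓ K (vPairState α' (restrictShell s' β' pc.freshV))
  | PType.H => cEnergy α' β' ℓ K (vTransport α' β' θ K (hPairState β' (restrictShell s' α' pc.freshH)))

/-- Level-1 energy of the output piece `(t', s')` among the phase pieces `pc` of the child class `(α', β')`. -/
def outEnergy (α' β' θ : ℝ) (K : ℕ) (s' : ℕ) (pc : PhasePieces) : PType → ℝ :=
  outEnergyAt α' β' θ K 1 s' pc

/-- SHELL-TRANSFER ENTRY `M[(t', s'), (t, s)] ≤ M` for the parent class `(α, β)` at truncation `K`: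
every input piece of type `t` with densities in shell `s` produces, summed over the four children and after their
phase, an output piece `(t', s')` of level-1 energy ≤ `M²` × its own level-0 energy.  (WO-p4-K2-4 computes the sup.) -/
def Transfer (α β θ : ℝ) (K : ℕ) (t : PType) (s : ℕ) (t' : PType) (s' : ℕ) (M : ℝ) : Prop :=
  ∀ d : ℤ → Fin 2 → ℂ, SupportedInW s (alongCoord α β t) K d →
    (∑ pm ∈ parities, ∑ pn ∈ parities,
        outEnergy ((α + pm) / 2) ((β + pn) / 2) θ K s'
          (phasePieces ((α + pm) / 2) ((β + pn) / 2) θ K (child pm pn (inputState α β θ K t d))) t')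
      ≤ M ^ 2 * cEnergy α β 0 K (inputState α β θ K t d)

/-! ## §1 The kernel of the crux copy in the tree's shape -/

/-- The tree's closed form of the kernel on one period. -/
def kernelK (a β : ℝ) : ℝ → ℂ := fun r : ℝ => (-((Real.exp (-(2 * Real.pi * a * r)) : ℂ) /
            (1 - starRingEnd ℂ (Complex.exp (2 * Real.pi * β * Complex.I)) * (Real.exp (-(2 * Real.pi * a)) : ℂ))
          + (Real.exp (2 * Real.pi * a * (r - 1)) : ℂ) * Complex.exp (2 * Real.pi * β * Complex.I) /
            (1 - Complex.exp (2 * Real.pi * β * Complex.I) * (Real.exp (-(2 * Real.pi * a)) : ℂ))) /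
        (2 * (2 * Real.pi * a) : ℂ))

/-- For `a > 0`, `lineKernel a β u = e^{2πiβ⌊u⌋} kernelK a β (u − ⌊u⌋)`. -/
theorem lineKernel_eq {a : ℝ} (ha : 0 < a) (β : ℝ) (u : ℝ) :
    lineKernel a β u = Complex.exp (2 * Real.pi * β * (⌊u⌋ : ℝ) * Complex.I) * kernelK a β (u - ⌊u⌋) := by
  simp only [lineKernel, kernelK, abs_of_pos ha]
  push_cast
  ring_nf

/-- `2π · lineKernel a β 0 = Σ₀(a,β)` (tree `twoPi_lineKernel_zero`). -/
theorem twoPi_lineKernel_zero' {a : ℝ} (ha : 0 < a) (β : ℝ) :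
    (2 * Real.pi : ℂ) * lineKernel a β 0 = ((sawSigma0 a β : ℝ) : ℂ) := by
  have h := twoPi_lineKernel_zero ha β
  have hz : Complex.exp (2 * Real.pi * β * Complex.I) = Complex.exp (((2 * Real.pi * β : ℝ) : ℂ) * Complex.I) := by push_cast; ring_nf
  simp only [lineKernel, Int.floor_zero, Int.cast_zero, Complex.ofReal_zero, sub_zero, mul_zero, zero_mul, neg_zero, Real.exp_zero,
    Complex.ofReal_one, Complex.exp_zero, one_mul, zero_sub, mul_neg, mul_one, abs_of_pos ha, hz]
  convert h using 3
  push_cast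
  ring

/-- `2π · conj (lineKernel a β ½) = S_β(a)` (tree `twoPi_conj_lineKernel_half`). -/
theorem twoPi_conj_lineKernel_half' {a : ℝ} (ha : 0 < a) (β : ℝ) :
    (2 * Real.pi : ℂ) * starRingEnd ℂ (lineKernel a β (1 / 2)) = sawS a β := by
  have h := twoPi_conj_lineKernel_half ha β
  have hz : Complex.exp (2 * Real.pi * β * Complex.I) = Complex.exp (((2 * Real.pi * β : ℝ) : ℂ) * Complex.I) := by push_cast; ring_nf
  have hfl : ⌊(1 / 2 : ℝ)⌋ = 0 := by norm_num [Int.floor_eq_zero_iff]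
  have he1 : Real.exp (-(2 * Real.pi * a * (1 / 2))) = Real.exp (-(a * Real.pi)) := by congr 1; ring
  have he2 : Real.exp (2 * Real.pi * a * (1 / 2 - 1)) = Real.exp (-(a * Real.pi)) := by congr 1; ring
  simp only [lineKernel, hfl, Int.cast_zero, Complex.ofReal_zero, sub_zero, mul_zero, zero_mul, Complex.exp_zero, one_mul,
    abs_of_pos ha, hz, he1, he2]
  convert h using 3
  push_cast
  ring

/-- The block entries spelled out. -/
theorem blockX_apply (a β : ℝ) :
    blockX a β 0 0 = (((2 * Real.pi * a : ℝ) : ℂ) * Complex.I) * (-(1 / 4 : ℂ) - 2 * lineKernel a β 0) ∧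
    blockX a β 0 1 = (((2 * Real.pi * a : ℝ) : ℂ) * Complex.I) * (-2 * lineKernel a β (1 / 2)) ∧
    blockX a β 1 0 = (((2 * Real.pi * a : ℝ) : ℂ) * Complex.I) * (2 * starRingEnd ℂ (lineKernel a β (1 / 2))) ∧
    blockX a β 1 1 = (((2 * Real.pi * a : ℝ) : ℂ) * Complex.I) * ((1 / 4 : ℂ) + 2 * lineKernel a β 0) := by
  simp [blockX, Matrix.smul_apply, smul_eq_mul]

/-! ## §4 (copy) -/

/-- The kernel is even in `a`. -/
theorem lineKernel_neg (a β y : ℝ) : lineKernel (-a) β y = lineKernel a β y := by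
  simp only [lineKernel, abs_neg]

/-- The transport phase at `−a` is the conjugate. -/
theorem transportPhase_neg (a θ y : ℝ) : transportPhase (-a) θ y = starRingEnd ℂ (transportPhase a θ y) := by
  simp only [transportPhase, ← Complex.exp_conj, map_mul, map_neg, Complex.conj_ofReal, Complex.conj_I]
  congr 1
  push_cast
  ring


/-! ## §8 (v2) The SHARP single-mode law by name: `‖sheetAmps a β θ (singleMode ξ) i‖ ≤ 0.889/a` for every mode and Bloch phase -/

/-- The single interior mode `e^{2πiξy}` (no sheets) — p2 g10's `K2StableCreation.singleMode`, verbatim. -/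
def singleMode (ξ : ℝ) : LamState := ⟨fun y => Complex.exp (((2 * Real.pi * ξ * y : ℝ) : ℂ) * Complex.I), []⟩

/-- The single-mode source at the kink line `y₀` as a function of the strain time (any Bloch phase). -/
def src (a β ξ y₀ : ℝ) : ℝ → ℂ := fun s =>
  ∫ y in (-(1 / 2 : ℝ))..(1 / 2 : ℝ), lineKernel a β (y₀ - y) * Complex.exp (((2 * Real.pi * ξ * y : ℝ) : ℂ) * Complex.I) *
    Complex.exp (-((2 * Real.pi * a * s * triWave y : ℝ) : ℂ) * Complex.I)

/-- The forcing of the single mode: `f(s) = (2πia·(−2)·src(¼,s), 2πia·2·src(−¼,s))`. -/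
theorem forcing_singleMode (a β ξ s : ℝ) :
    forcing a β (singleMode ξ) s = ![((2 * Real.pi * a : ℝ) * Complex.I : ℂ) * (-2) * src a β ξ (1 / 4) s,
      ((2 * Real.pi * a : ℝ) * Complex.I : ℂ) * 2 * src a β ξ (-(1 / 4)) s] := by
  simp only [forcing, singleMode, transportPhase, src, List.map_nil, List.sum_nil, add_zero]

/-- Stability for every Bloch phase at `a ≥ 1`. -/
theorem khLam_lt_zero_beta {a : ℝ} (ha : 1 ≤ a) (β : ℝ) : khLam a β < 0 := by
  unfold khLam
  have h := sawC2_ge ha β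
  have : 0 < a ^ 2 * sawC2 a β := by positivity
  linarith

/-- `√(−λ) = a√(max 0 c²)` for every Bloch phase. -/
theorem sqrt_neg_khLam_eq_beta {a : ℝ} (ha : 1 ≤ a) (β : ℝ) : Real.sqrt (-(khLam a β)) = a * Real.sqrt (max 0 (sawC2 a β)) := by
  unfold khLam
  have hc : 0 ≤ sawC2 a β := by linarith [sawC2_ge ha β]
  rw [neg_neg, max_eq_right hc, Real.sqrt_mul' _ hc, Real.sqrt_sq (by linarith)]

/-- Stable propagator entries for every Bloch phase. -/
theorem propC_eq_beta {a : ℝ} (ha : 1 ≤ a) (β t : ℝ) : propC a β t = Real.cos (Real.sqrt (-(khLam a β)) * t) := by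
  have h := khLam_lt_zero_beta ha β
  simp only [propC, if_neg (not_lt.2 h.le), if_pos h]

/-- Stable propagator entries for every Bloch phase. -/
theorem propSn_eq_beta {a : ℝ} (ha : 1 ≤ a) (β t : ℝ) :
    propSn a β t = Real.sin (Real.sqrt (-(khLam a β)) * t) / Real.sqrt (-(khLam a β)) := by
  have h := khLam_lt_zero_beta ha β
  simp only [propSn, if_neg (not_lt.2 h.le), if_pos h]

/-- The single-mode sources are continuous in the strain time. -/
theorem continuous_src {a : ℝ} (ha : 0 < a) (β ξ : ℝ) {y₀ : ℝ} (hy₀ : y₀ = 1 / 4 ∨ y₀ = -(1 / 4)) : Continuous (src a β ξ y₀) :=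
  continuous_singleMode_src ha β ξ (K := kernelK a β) rfl (lineKernel_eq ha β) hy₀

/-- **Two-envelope bounds of the single-mode sources** (tree `norm_src_quarter_mode_le`, `norm_src_negQuarter_mode_le`). -/
theorem norm_src_le {a : ℝ} (ha : 0 < a) (β ξ : ℝ) {y₀ : ℝ} (hy₀ : y₀ = 1 / 4 ∨ y₀ = -(1 / 4)) (s : ℝ) :
    ‖src a β ξ y₀ s‖ ≤ (1 + 2 * Real.exp (-(2 * Real.pi * a) / 4) + 2 * Real.exp (-(2 * Real.pi * a) / 4) ^ 2 +
        2 * Real.exp (-(2 * Real.pi * a) / 4) ^ 3 + Real.exp (-(2 * Real.pi * a) / 4) ^ 4) /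
          (((1 - Real.exp (-(2 * Real.pi * a))) * (2 * (2 * Real.pi * a))) * ((2 * Real.pi * a) * Real.sqrt (1 + (ξ / a + 1 * s) ^ 2))) +
        (1 + 2 * Real.exp (-(2 * Real.pi * a) / 4) ^ 2 + Real.exp (-(2 * Real.pi * a) / 4) ^ 4) /
          (((1 - Real.exp (-(2 * Real.pi * a))) * (2 * (2 * Real.pi * a))) * ((2 * Real.pi * a) * Real.sqrt (1 + (ξ / a + (-1) * s) ^ 2))) := by
  rcases hy₀ with h | h <;> subst h
  · exact norm_src_quarter_mode_le ha β ξ s (K := kernelK a β) (G := lineKernel a β) rfl (lineKernel_eq ha β)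
  · exact norm_src_negQuarter_mode_le ha β ξ s (K := kernelK a β) (G := lineKernel a β) rfl (lineKernel_eq ha β)

/-- The Duhamel integrand of the single mode is continuous in the strain time. -/
theorem continuous_duhamelIntegrand_singleMode {a : ℝ} (ha : 1 ≤ a) (β ξ θ : ℝ) :
    Continuous fun s : ℝ => (propagator a β (θ - s)).mulVec (forcing a β (singleMode ξ) s) := by
  have ha0 : 0 < a := by linarith
  have hs0 := continuous_src ha0 β ξ (y₀ := 1 / 4) (Or.inl rfl)
  have hs1 := continuous_src ha0 β ξ (y₀ := -(1 / 4)) (Or.inr rfl)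
  apply continuous_pi
  intro j
  simp only [forcing_singleMode, propagator, propC_eq_beta ha, propSn_eq_beta ha, Matrix.add_mulVec, Matrix.smul_mulVec, Matrix.one_mulVec]
  simp only [Pi.add_apply, Pi.smul_apply, smul_eq_mul, Matrix.mulVec, dotProduct, Fin.sum_univ_two]
  fin_cases j
  · simp only [Fin.zero_eta, Fin.isValue, Matrix.cons_val_zero, Matrix.cons_val_one]
    fun_prop
  · simp only [Fin.mk_one, Fin.isValue, Matrix.cons_val_zero, Matrix.cons_val_one]
    fun_prop

/-- **Reduction, component `0`** (any Bloch phase, `a ≥ 1`). -/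
theorem sheetAmps_singleMode_apply_0 {a : ℝ} (ha : 1 ≤ a) (β ξ θ : ℝ) :
    sheetAmps a β θ (singleMode ξ) 0 = ∫ s in (0 : ℝ)..θ,
      ((Real.cos (Real.sqrt (-(khLam a β)) * (θ - s)) : ℂ) * ((((2 * Real.pi * a : ℝ) * Complex.I : ℂ) * (-2)) * src a β ξ (1 / 4) s) +
        ((Real.sin (Real.sqrt (-(khLam a β)) * (θ - s)) / Real.sqrt (-(khLam a β)) : ℝ) : ℂ) *
          (blockX a β 0 0 * ((((2 * Real.pi * a : ℝ) * Complex.I : ℂ) * (-2)) * src a β ξ (1 / 4) s) +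
            blockX a β 0 1 * ((((2 * Real.pi * a : ℝ) * Complex.I : ℂ) * 2) * src a β ξ (-(1 / 4)) s))) := by
  have hint := (continuous_duhamelIntegrand_singleMode ha β ξ θ).intervalIntegrable (μ := volume) 0 θ
  have hcomp := ((ContinuousLinearMap.proj (R := ℂ) (φ := fun _ : Fin 2 => ℂ) (0 : Fin 2)).intervalIntegral_comp_comm hint).symm
  simp only [ContinuousLinearMap.proj_apply] at hcomp
  unfold sheetAmps
  rw [hcomp]
  refine intervalIntegral.integral_congr fun s _ => ?_
  simp only [forcing_singleMode, propagator, propC_eq_beta ha, propSn_eq_beta ha, Matrix.add_mulVec, Matrix.smul_mulVec, Matrix.one_mulVec]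
  simp only [Pi.add_apply, Pi.smul_apply, smul_eq_mul, Matrix.mulVec, dotProduct, Fin.sum_univ_two, Fin.isValue, Matrix.cons_val_zero,
    Matrix.cons_val_one]

/-- **Reduction, component `1`** (any Bloch phase, `a ≥ 1`). -/
theorem sheetAmps_singleMode_apply_1 {a : ℝ} (ha : 1 ≤ a) (β ξ θ : ℝ) :
    sheetAmps a β θ (singleMode ξ) 1 = ∫ s in (0 : ℝ)..θ,
      ((Real.cos (Real.sqrt (-(khLam a β)) * (θ - s)) : ℂ) * ((((2 * Real.pi * a : ℝ) * Complex.I : ℂ) * 2) * src a β ξ (-(1 / 4)) s) +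
        ((Real.sin (Real.sqrt (-(khLam a β)) * (θ - s)) / Real.sqrt (-(khLam a β)) : ℝ) : ℂ) *
          (blockX a β 1 0 * ((((2 * Real.pi * a : ℝ) * Complex.I : ℂ) * (-2)) * src a β ξ (1 / 4) s) +
            blockX a β 1 1 * ((((2 * Real.pi * a : ℝ) * Complex.I : ℂ) * 2) * src a β ξ (-(1 / 4)) s))) := by
  have hint := (continuous_duhamelIntegrand_singleMode ha β ξ θ).intervalIntegrable (μ := volume) 0 θ
  have hcomp := ((ContinuousLinearMap.proj (R := ℂ) (φ := fun _ : Fin 2 => ℂ) (1 : Fin 2)).intervalIntegral_comp_comm hint).symm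
  simp only [ContinuousLinearMap.proj_apply] at hcomp
  unfold sheetAmps
  rw [hcomp]
  refine intervalIntegral.integral_congr fun s _ => ?_
  simp only [forcing_singleMode, propagator, propC_eq_beta ha, propSn_eq_beta ha, Matrix.add_mulVec, Matrix.smul_mulVec, Matrix.one_mulVec]
  simp only [Pi.add_apply, Pi.smul_apply, smul_eq_mul, Matrix.mulVec, dotProduct, Fin.sum_univ_two, Fin.isValue, Matrix.cons_val_zero,
    Matrix.cons_val_one]

/-- **THE SHARP SINGLE-MODE CREATION LAW BY NAME** (P2-E6 kernel): for `a ≥ 4`, `0 ≤ θ ≤ 8`, EVERY Bloch phase `β` and EVERY interior mode `ξ`,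
`‖sheetAmps a β θ (singleMode ξ) i‖ ≤ 0.889/a` (`i = 0, 1`) — the tree's `8.5/a` (`…KHSingleModeCreation`, p2 g10) divided by `9.5`. -/
theorem norm_sheetAmps_singleMode_le {a : ℝ} (ha : 4 ≤ a) (β ξ : ℝ) {θ : ℝ} (hθ0 : 0 ≤ θ) (hθ : θ ≤ 8) (i : Fin 2) :
    ‖sheetAmps a β θ (singleMode ξ) i‖ ≤ 0.889 / a := by
  have ha1 : 1 ≤ a := by linarith
  have ha0 : 0 < a := by linarith
  have h0 := twoPi_lineKernel_zero' ha0 β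
  have hh := twoPi_conj_lineKernel_half' ha0 β
  have hE₀ := norm_src_le ha0 β ξ (y₀ := 1 / 4) (Or.inl rfl)
  have hE₁ := norm_src_le ha0 β ξ (y₀ := -(1 / 4)) (Or.inr rfl)
  obtain ⟨e00, e01, e10, e11⟩ := blockX_apply a β
  fin_cases i
  · simp only [Fin.zero_eta, Fin.isValue]
    rw [sheetAmps_singleMode_apply_0 ha1, sqrt_neg_khLam_eq_beta ha1, e00, e01]
    exact mode_creation_num_le ha hθ0 hθ h0 hh hE₀ hE₁
  · simp only [Fin.mk_one, Fin.isValue]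
    rw [sheetAmps_singleMode_apply_1 ha1, sqrt_neg_khLam_eq_beta ha1, e10, e11]
    exact mode_creation_num_le' ha hθ0 hθ h0 hh hE₀ hE₁

/-! ## §9 (v2, E6-a) Finite mode profiles: linearity and the ξ-resolved COHERENT creation bound per line -/

/-- The forcing is linear in the interior content (tree `integral_forcing_finset_sum`). -/
theorem forcing_modeProfile {a : ℝ} (ha : 0 < a) (β s : ℝ) (K : ℕ) (c : ℤ → ℂ) :
    forcing a β ⟨modeProfile β K c, []⟩ s = ∑ n ∈ win K, c n • forcing a β (singleMode (β + n)) s := by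
  have h1 := integral_forcing_finset_sum ha β s (K := kernelK a β) rfl (lineKernel_eq ha β) (y₀ := 1 / 4) (Or.inl rfl) (win K) c
  have h2 := integral_forcing_finset_sum ha β s (K := kernelK a β) rfl (lineKernel_eq ha β) (y₀ := -(1 / 4)) (Or.inr rfl) (win K) c
  ext i
  rw [Finset.sum_apply]
  fin_cases i
  · simp only [forcing, modeProfile, singleMode, transportPhase, List.map_nil, List.sum_nil, add_zero, Fin.zero_eta, Fin.isValue,
      Matrix.cons_val_zero, Pi.smul_apply, smul_eq_mul]
    rw [h1, Finset.mul_sum]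
    exact Finset.sum_congr rfl fun n _ => by ring
  · simp only [forcing, modeProfile, singleMode, transportPhase, List.map_nil, List.sum_nil, add_zero, Fin.mk_one, Fin.isValue,
      Matrix.cons_val_one, Matrix.cons_val_zero, Pi.smul_apply, smul_eq_mul]
    rw [h2, Finset.mul_sum]
    exact Finset.sum_congr rfl fun n _ => by ring

/-- **Linearity of the created amplitudes** over a finite mode profile (`a ≥ 1`). -/
theorem sheetAmps_modeProfile {a : ℝ} (ha : 1 ≤ a) (β θ : ℝ) (K : ℕ) (c : ℤ → ℂ) :
    sheetAmps a β θ ⟨modeProfile β K c, []⟩ = ∑ n ∈ win K, c n • sheetAmps a β θ (singleMode (β + n)) := by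
  have ha0 : 0 < a := by linarith
  unfold sheetAmps
  simp_rw [forcing_modeProfile ha0, Matrix.mulVec_sum, Matrix.mulVec_smul]
  have hint : ∀ n ∈ win K, IntervalIntegrable (fun s => c n • (propagator a β (θ - s)).mulVec (forcing a β (singleMode (β + n)) s))
      volume 0 θ := fun n _ => ((continuous_duhamelIntegrand_singleMode ha β (β + n) θ).intervalIntegrable (μ := volume) _ _).smul (c n)
  rw [intervalIntegral.integral_finsetSum hint]
  refine Finset.sum_congr rfl fun n _ => ?_
  exact intervalIntegral.integral_smul _ _

/-! ## §10 (v3, E6-b) Transport cannot create energy beyond enstrophy/a² (Parseval, tree `…KHTransportParseval`) -/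

/-- The triangle wave is continuous. -/
theorem continuous_triWave : Continuous triWave := by
  have h : triWave = (fun t : ℝ => 1 / 4 - |t - 1 / 2|) ∘ Int.fract ∘ (fun ξ : ℝ => ξ + 1 / 4) := by
    funext ξ; simp [triWave, Function.comp]
  rw [h]
  have hI : Continuous ((fun t : ℝ => 1 / 4 - |t - 1 / 2|) ∘ Int.fract) :=
    ContinuousOn.comp_fract'' (Continuous.continuousOn (by fun_prop)) (by norm_num)
  exact hI.comp (continuous_id.add continuous_const)

/-- The transport phase is continuous in `y` and unimodular. -/
theorem continuous_transportPhase (a θ : ℝ) : Continuous (transportPhase a θ) := by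
  unfold transportPhase
  have := continuous_triWave
  fun_prop

/-! ## §16 (copy) straight H-pair energy, evenness -/

/-- **Straight H-pair energy BY NAME (upper).** For a class `(α, β)` with `β ∈ [0,1]` and H-pair densities `q` vanishing on the zero line `α + m = 0`:
`cEnergy α β ℓ K (hPairState β q) ≤ (1/(4π²4^ℓ))·Σ_{|m| ≤ K} (‖q m 0‖² + ‖q m 1‖²)·(π/|α+m| + 4/(α+m)²)` (tree `vPair_column_energy_upper`, rows ↔ columns). -/
theorem cEnergy_hPairState_le {β : ℝ} (hβ0 : 0 ≤ β) (hβ1 : β ≤ 1) (α : ℝ) (ℓ K : ℕ) (q : ℤ → Fin 2 → ℂ)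
    (hq : ∀ m ∈ win K, α + (m : ℝ) = 0 → q m = 0) :
    cEnergy α β ℓ K (hPairState β q) ≤
      (1 / (4 * Real.pi ^ 2 * (4 : ℝ) ^ ℓ)) * ∑ m ∈ win K, (‖q m 0‖ ^ 2 + ‖q m 1‖ ^ 2) * (Real.pi / |α + m| + 4 / (α + m) ^ 2) := by
  unfold cEnergy
  rw [Finset.mul_sum]
  refine Finset.sum_le_sum fun m hm => ?_
  have e : ∀ (v : ℂ) (n : ℤ), ‖v‖ ^ 2 / (4 * Real.pi ^ 2 * (4 : ℝ) ^ ℓ * ((α + m) ^ 2 + (β + n) ^ 2)) =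
      (1 / (4 * Real.pi ^ 2 * (4 : ℝ) ^ ℓ)) * (‖v‖ ^ 2 / ((β + n) ^ 2 + (α + m) ^ 2)) := by
    intro v n
    rw [add_comm ((α + (m : ℝ)) ^ 2), mul_comm (4 * Real.pi ^ 2 * (4 : ℝ) ^ ℓ) ((β + (n : ℝ)) ^ 2 + (α + m) ^ 2), ← div_div,
      div_eq_mul_one_div, mul_comm]
  simp only [hPairState]
  simp_rw [e, ← Finset.mul_sum]
  refine mul_le_mul_of_nonneg_left ?_ (by positivity)
  rcases eq_or_ne (α + (m : ℝ)) 0 with hb | hb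
  · have h0 : q m = 0 := hq m hm hb
    simp [h0]
  · exact vPair_column_energy_upper hβ0 hβ1 hb K (q m 0) (q m 1)

/-- `c²` is even in the Bloch phase (tree `sawSigma0_neg_bloch`, `sawS_neg_bloch`). -/
theorem sawC2_neg_bloch (a β : ℝ) : sawC2 a (-β) = sawC2 a β := by
  unfold sawC2
  rw [sawSigma0_neg_bloch, sawS_neg_bloch, Complex.normSq_conj]

/-! ## §17 (v10) P2-S at general Bloch phase: `(a, β, ξ) ↦ (−a, −β, −ξ)` is complex conjugation — the creation law for NEGATIVE lines -/

/-- `conj (lineKernel a β y) = lineKernel a (−β) y`. -/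
theorem conj_lineKernel (a β y : ℝ) : starRingEnd ℂ (lineKernel a β y) = lineKernel a (-β) y := by
  have hz : starRingEnd ℂ (Complex.exp (2 * Real.pi * β * Complex.I)) = Complex.exp (2 * Real.pi * (((-β : ℝ)) : ℂ) * Complex.I) := by
    rw [← Complex.exp_conj]; congr 1
    simp only [map_mul, map_ofNat, Complex.conj_ofReal, Complex.conj_I]; push_cast; ring
  have hz' : starRingEnd ℂ (Complex.exp (2 * Real.pi * β * (⌊y⌋ : ℝ) * Complex.I)) = Complex.exp (2 * Real.pi * (((-β : ℝ)) : ℂ) * (⌊y⌋ : ℝ) * Complex.I) := by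
    rw [← Complex.exp_conj]; congr 1
    simp only [map_mul, map_ofNat, Complex.conj_ofReal, Complex.conj_I]; push_cast; ring
  simp only [lineKernel, map_mul, map_div₀, map_add, map_neg, map_sub, map_one, map_ofNat, Complex.conj_ofReal, hz, hz']

/-- `sawQ (−k) = (sawQ k)⁻¹`. -/
theorem sawQ_neg (k : ℝ) : sawQ (-k) = (sawQ k)⁻¹ := by
  simp only [sawQ, mul_neg, neg_neg, ← Real.exp_neg]

/-- `Σ₀` is even in the streamwise wavenumber (`k ≠ 0`). -/
theorem sawSigma0_neg_arg {k : ℝ} (hk : k ≠ 0) (β : ℝ) : sawSigma0 (-k) β = sawSigma0 k β := by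
  have hq : 0 < sawQ k := Real.exp_pos _
  have hq1 : sawQ k ≠ 1 := by
    simp only [sawQ]; rw [Ne, Real.exp_eq_one_iff]; intro h; apply hk; nlinarith [Real.pi_pos]
  have hc : Real.cos (2 * Real.pi * β) ≤ 1 := Real.cos_le_one _
  have hc' : -1 ≤ Real.cos (2 * Real.pi * β) := Real.neg_one_le_cos _
  have hden : 1 - 2 * sawQ k * Real.cos (2 * Real.pi * β) + sawQ k ^ 2 ≠ 0 := by
    intro h
    have h1 : (1 - sawQ k) ^ 2 ≤ 1 - 2 * sawQ k * Real.cos (2 * Real.pi * β) + sawQ k ^ 2 := by nlinarith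
    have h2 : (1 - sawQ k) ^ 2 = 0 := le_antisymm (by rw [← h]; exact h1) (sq_nonneg _)
    exact hq1 (by nlinarith [pow_eq_zero_iff (n := 2) (two_ne_zero) |>.1 h2])
  unfold sawSigma0
  rw [sawQ_neg]
  field_simp
  ring

/-- `S` is even in the streamwise wavenumber (`k ≠ 0`). -/
theorem sawS_neg_arg {k : ℝ} (hk : k ≠ 0) (β : ℝ) : sawS (-k) β = sawS k β := by
  have hq : 0 < sawQ k := Real.exp_pos _
  have hq1 : sawQ k ≠ 1 := by
    simp only [sawQ]; rw [Ne, Real.exp_eq_one_iff]; intro h; apply hk; nlinarith [Real.pi_pos]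
  set z : ℂ := Complex.exp (((2 * Real.pi * β : ℝ) : ℂ) * Complex.I) with hz
  set Q : ℂ := ((sawQ k : ℝ) : ℂ) with hQ
  have hzn : ‖z‖ = 1 := by rw [hz, Complex.norm_exp_ofReal_mul_I]
  have hz0 : z ≠ 0 := by intro h; rw [h, norm_zero] at hzn; exact zero_ne_one hzn
  have hzz : z * starRingEnd ℂ z = 1 := by
    rw [Complex.mul_conj, Complex.normSq_eq_norm_sq, hzn]; norm_num
  have hzbar : starRingEnd ℂ z = z⁻¹ := by
    have := congrArg (fun w => z⁻¹ * w) hzz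
    simp only [← mul_assoc, inv_mul_cancel₀ hz0, one_mul, mul_one] at this
    exact this
  have hQ0 : Q ≠ 0 := by rw [hQ]; exact_mod_cast hq.ne'
  have hQn : ‖Q‖ = sawQ k := by rw [hQ, Complex.norm_real, Real.norm_eq_abs, abs_of_pos hq]
  -- the two non-resonance facts `z ≠ Q`, `zQ ≠ 1`
  have F2 : Q - z ≠ 0 := by
    intro h
    have : ‖Q‖ = ‖z‖ := by rw [sub_eq_zero.1 h]
    rw [hQn, hzn] at this
    exact hq1 this
  have F1 : 1 - z * Q ≠ 0 := by
    intro h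
    have : ‖z * Q‖ = 1 := by rw [← sub_eq_zero.1 h]; exact norm_one
    rw [norm_mul, hzn, hQn, one_mul] at this
    exact hq1 this
  have F3 : Q - z⁻¹ ≠ 0 := by
    intro h
    have h' : z * Q = 1 := by
      have := congrArg (fun w => z * w) (sub_eq_zero.1 h)
      simpa [mul_inv_cancel₀ hz0] using this
    exact F1 (by rw [h']; ring)
  have F4 : z - Q ≠ 0 := by intro h; exact F2 (by rw [← neg_sub, h, neg_zero])
  have F1' : 1 - Q * z ≠ 0 := by rwa [mul_comm] at F1
  have F1'' : -1 + Q * z ≠ 0 := by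
    intro h; apply F1'; linear_combination -h
  have F5 : Q * z - 1 ≠ 0 := by
    intro h; apply F1'; linear_combination -h
  have hk' : (k : ℂ) ≠ 0 := by exact_mod_cast hk
  -- rewrite everything in terms of `z`, `z⁻¹`, `Q`, `Q⁻¹`
  have hexp : ((Real.exp (-(-k * Real.pi)) / (2 * -k) : ℝ) : ℂ) = -(((Real.exp (-(k * Real.pi)) / (2 * k) : ℝ) : ℂ) * Q⁻¹ * Q⁻¹ * Q) := by
    have e1 : Real.exp (-(-k * Real.pi)) = Real.exp (-(k * Real.pi)) * ((sawQ k)⁻¹) := by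
      rw [sawQ, ← Real.exp_neg, ← Real.exp_add]; congr 1; ring
    rw [e1, hQ]; push_cast; field_simp
  simp only [sawS, sawQ_neg]
  rw [← hz, hzbar, hexp]
  push_cast
  rw [← hQ]
  field_simp
  ring


/-- `c²` is even in the streamwise wavenumber (`a ≠ 0`). -/
theorem sawC2_neg_arg {a : ℝ} (ha : a ≠ 0) (β : ℝ) : sawC2 (-a) β = sawC2 a β := by
  unfold sawC2
  rw [sawSigma0_neg_arg ha, sawS_neg_arg ha]

/-- `λ(−a, −β) = λ(a, β)` (`a ≠ 0`). -/
theorem khLam_neg_neg {a : ℝ} (ha : a ≠ 0) (β : ℝ) : khLam (-a) (-β) = khLam a β := by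
  unfold khLam
  rw [sawC2_neg_bloch, sawC2_neg_arg ha, neg_sq]

/-- The propagator scalars at `(−a, −β)`. -/
theorem propC_neg_neg {a : ℝ} (ha : a ≠ 0) (β t : ℝ) : propC (-a) (-β) t = propC a β t := by
  simp only [propC, khLam_neg_neg ha]

/-- The propagator scalars at `(−a, −β)`. -/
theorem propSn_neg_neg {a : ℝ} (ha : a ≠ 0) (β t : ℝ) : propSn (-a) (-β) t = propSn a β t := by
  simp only [propSn, khLam_neg_neg ha]

/-- The block at `(−a, −β)` is the entrywise conjugate of the block at `(a, β)`. -/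
theorem blockX_neg_neg (a β : ℝ) (i j : Fin 2) : blockX (-a) (-β) i j = starRingEnd ℂ (blockX a β i j) := by
  obtain ⟨e00, e01, e10, e11⟩ := blockX_apply (-a) (-β)
  obtain ⟨f00, f01, f10, f11⟩ := blockX_apply a β
  have hG : lineKernel a (-β) 0 = starRingEnd ℂ (lineKernel a β 0) := (conj_lineKernel a β 0).symm
  have hH : lineKernel a (-β) (1 / 2) = starRingEnd ℂ (lineKernel a β (1 / 2)) := (conj_lineKernel a β (1 / 2)).symm
  fin_cases i <;> fin_cases j
  · simp only [Fin.zero_eta, Fin.isValue, e00, f00, lineKernel_neg, hG, map_mul, map_sub, map_neg, map_div₀, map_one, map_ofNat,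
      Complex.conj_ofReal, Complex.conj_I]
    push_cast; ring
  · simp only [Fin.zero_eta, Fin.mk_one, Fin.isValue, e01, f01, lineKernel_neg, hH, map_mul, map_neg, map_ofNat, Complex.conj_ofReal,
      Complex.conj_I]
    push_cast; ring
  · simp only [Fin.zero_eta, Fin.mk_one, Fin.isValue, e10, f10, lineKernel_neg, hH, map_mul, map_ofNat, Complex.conj_ofReal, Complex.conj_I,
      Complex.conj_conj]
    push_cast; ring
  · simp only [Fin.mk_one, Fin.isValue, e11, f11, lineKernel_neg, hG, map_mul, map_add, map_div₀, map_one, map_ofNat, Complex.conj_ofReal,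
      Complex.conj_I]
    push_cast; ring

/-- The propagator at `(−a, −β)` is the entrywise conjugate (`a ≠ 0`). -/
theorem propagator_neg_neg {a : ℝ} (ha : a ≠ 0) (β t : ℝ) (i j : Fin 2) :
    propagator (-a) (-β) t i j = starRingEnd ℂ (propagator a β t i j) := by
  simp only [propagator, Matrix.add_apply, Matrix.smul_apply, smul_eq_mul, propC_neg_neg ha, propSn_neg_neg ha, map_add, map_mul,
    Complex.conj_ofReal, blockX_neg_neg]
  congr 2
  fin_cases i <;> fin_cases j <;> simp

/-- The transport phase at `−a` is the conjugate (any strain time). -/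
theorem transportPhase_neg' (a s y : ℝ) : transportPhase (-a) s y = starRingEnd ℂ (transportPhase a s y) := transportPhase_neg a s y

/-- **The forcing of a CONJUGATED interior at `(−a, −β)` is the conjugate of the forcing** (no sheets). -/
theorem forcing_neg_neg_nosheet (a β : ℝ) (g : ℝ → ℂ) (s : ℝ) (j : Fin 2) :
    forcing (-a) (-β) ⟨fun y => starRingEnd ℂ (g y), []⟩ s j = starRingEnd ℂ (forcing a β ⟨g, []⟩ s j) := by
  have hsrc : ∀ y₀ : ℝ, (∫ y in (-(1 / 2 : ℝ))..(1 / 2), lineKernel (-a) (-β) (y₀ - y) * starRingEnd ℂ (g y) * transportPhase (-a) s y) =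
      starRingEnd ℂ (∫ y in (-(1 / 2 : ℝ))..(1 / 2), lineKernel a β (y₀ - y) * g y * transportPhase a s y) := by
    intro y₀
    rw [← intervalIntegral.intervalIntegral_conj]
    refine intervalIntegral.integral_congr fun y _ => ?_
    simp only [map_mul, conj_lineKernel, lineKernel_neg, transportPhase_neg']
  fin_cases j
  · simp only [forcing, List.map_nil, List.sum_nil, add_zero, Fin.zero_eta, Fin.isValue, Matrix.cons_val_zero, hsrc, map_mul, map_neg,
      map_ofNat, Complex.conj_ofReal, Complex.conj_I]
    push_cast; ring
  · simp only [forcing, List.map_nil, List.sum_nil, add_zero, Fin.mk_one, Fin.isValue, Matrix.cons_val_one, Matrix.cons_val_zero, hsrc, map_mul,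
      map_ofNat, Complex.conj_ofReal, Complex.conj_I]
    push_cast; ring

/-- The Duhamel integrand at `(−a, −β)` with conjugated interior is the componentwise conjugate (`a ≠ 0`). -/
theorem duhamelIntegrand_neg_neg_nosheet {a : ℝ} (ha : a ≠ 0) (β θ s : ℝ) (g : ℝ → ℂ) :
    (propagator (-a) (-β) (θ - s)).mulVec (forcing (-a) (-β) ⟨fun y => starRingEnd ℂ (g y), []⟩ s) =
      star ((propagator a β (θ - s)).mulVec (forcing a β ⟨g, []⟩ s)) := by
  funext i
  simp only [Matrix.mulVec, dotProduct, Fin.sum_univ_two, Pi.star_apply, propagator_neg_neg ha, forcing_neg_neg_nosheet, star_add, star_mul',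
    Complex.star_def]

/-- The conjugate of a mode profile is the mode profile of the reflected class with reflected, conjugated coefficients. -/
theorem conj_modeProfile (β : ℝ) (K : ℕ) (c : ℤ → ℂ) (y : ℝ) :
    starRingEnd ℂ (modeProfile β K c y) = modeProfile (-β) K (fun n => starRingEnd ℂ (c (-n))) y := by
  simp only [modeProfile, map_sum, map_mul]
  refine Finset.sum_nbij' (fun n => -n) (fun n => -n) (fun n hn => by simp only [win, Finset.mem_Icc] at hn ⊢; omega) (fun n hn => by simp only [win, Finset.mem_Icc] at hn ⊢; omega)
    (fun n _ => neg_neg n) (fun n _ => neg_neg n) (fun n _ => ?_)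
  rw [neg_neg, ← Complex.exp_conj, map_mul, Complex.conj_ofReal, Complex.conj_I]
  congr 1
  push_cast
  ring

/-- **P2-S for profile states (any Bloch phase):** `sheetAmps (−a) (−β) θ ⟨modeProfile (−β) K c̃, []⟩ i = conj (sheetAmps a β θ ⟨modeProfile β K c, []⟩ i)`
with `c̃ n = conj (c (−n))` (`a ≥ 1`). -/
theorem sheetAmps_neg_neg_modeProfile {a : ℝ} (ha : 1 ≤ a) (β θ : ℝ) (K : ℕ) (c : ℤ → ℂ) (i : Fin 2) :
    sheetAmps (-a) (-β) θ ⟨modeProfile (-β) K (fun n => starRingEnd ℂ (c (-n))), []⟩ i =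
      starRingEnd ℂ (sheetAmps a β θ ⟨modeProfile β K c, []⟩ i) := by
  have ha0 : a ≠ 0 := by linarith
  -- the integrand at `(a, β)` is a finite sum of single-mode integrands, hence continuous
  have hF : Continuous fun s : ℝ => (propagator a β (θ - s)).mulVec (forcing a β ⟨modeProfile β K c, []⟩ s) := by
    have e : (fun s : ℝ => (propagator a β (θ - s)).mulVec (forcing a β ⟨modeProfile β K c, []⟩ s)) =
        fun s : ℝ => ∑ n ∈ win K, c n • (propagator a β (θ - s)).mulVec (forcing a β (singleMode (β + n)) s) := by
      funext s
      rw [forcing_modeProfile (by linarith : (0 : ℝ) < a) β s K c, Matrix.mulVec_sum]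
      refine Finset.sum_congr rfl fun n _ => ?_
      rw [Matrix.mulVec_smul]
    rw [e]
    exact continuous_finsetSum _ fun n _ => (continuous_duhamelIntegrand_singleMode ha β (β + n) θ).const_smul (c n)
  -- the interior at `(−a, −β)` is the conjugated interior
  have hint_eq : (⟨modeProfile (-β) K (fun n => starRingEnd ℂ (c (-n))), []⟩ : LamState) = ⟨fun y => starRingEnd ℂ (modeProfile β K c y), []⟩ := by
    congr 1
    funext y
    rw [conj_modeProfile]
  rw [hint_eq]
  have e : (fun s : ℝ => (propagator (-a) (-β) (θ - s)).mulVec (forcing (-a) (-β) ⟨fun y => starRingEnd ℂ (modeProfile β K c y), []⟩ s)) =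
      fun s : ℝ => star ((propagator a β (θ - s)).mulVec (forcing a β ⟨modeProfile β K c, []⟩ s)) :=
    funext fun s => duhamelIntegrand_neg_neg_nosheet ha0 β θ s (modeProfile β K c)
  have hF' : Continuous fun s : ℝ => (propagator (-a) (-β) (θ - s)).mulVec (forcing (-a) (-β) ⟨fun y => starRingEnd ℂ (modeProfile β K c y), []⟩ s) := by
    rw [e]; exact continuous_star.comp hF
  have hint := hF.intervalIntegrable (μ := volume) 0 θ
  have hint' := hF'.intervalIntegrable (μ := volume) 0 θ
  have h1 := ((ContinuousLinearMap.proj (R := ℂ) (φ := fun _ : Fin 2 => ℂ) i).intervalIntegral_comp_comm hint).symm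
  have h2 := ((ContinuousLinearMap.proj (R := ℂ) (φ := fun _ : Fin 2 => ℂ) i).intervalIntegral_comp_comm hint').symm
  simp only [ContinuousLinearMap.proj_apply] at h1 h2
  unfold sheetAmps
  rw [h1, h2, ← intervalIntegral.intervalIntegral_conj]
  refine intervalIntegral.integral_congr fun s _ => ?_
  have := congrFun (duhamelIntegrand_neg_neg_nosheet ha0 β θ s (modeProfile β K c)) i
  simp only [Pi.star_apply, Complex.star_def] at this
  exact this

/-! ## §15 (copy) the V slot's transport in energy form -/

/-- One column of `vTransport`, inside the window, is the transport coefficient of the column profile. -/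
theorem vTransport_apply_of_mem (α β θ : ℝ) (K : ℕ) (ζ : CState) {m' n : ℤ} (hm' : m' ∈ win K) (hn : n ∈ win K) :
    vTransport α β θ K ζ m' n = ∫ x in (-(1 / 2 : ℝ))..(1 / 2),
      ((∑ m ∈ win K, ζ m n * Complex.exp ((2 * Real.pi * (α + m) * x : ℝ) * Complex.I)) *
        Complex.exp (-((2 * Real.pi * (β + n) * θ * triWave x : ℝ) : ℂ) * Complex.I)) * Complex.exp (-(2 * Real.pi * (α + m') * x : ℝ) * Complex.I) := by
  simp only [vTransport, if_pos (And.intro hm' hn), coeff, modeProfile, transportPhase, List.map_nil, List.sum_nil, add_zero]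


/-- The energy-form transport bound for ONE column of `vTransport` (line `β + n`, any value incl. `0`). -/
theorem vTransport_column_energy_le (α β θ : ℝ) (ℓ K : ℕ) (ζ : CState) {n : ℤ} (hn : n ∈ win K) :
    ∑ m' ∈ win K, ‖vTransport α β θ K ζ m' n‖ ^ 2 / (4 * Real.pi ^ 2 * (4 : ℝ) ^ ℓ * ((α + m') ^ 2 + (β + n) ^ 2)) ≤
      (θ ^ 2 + 2) * ∑ m ∈ win K, ‖ζ m n‖ ^ 2 / (4 * Real.pi ^ 2 * (4 : ℝ) ^ ℓ * ((α + m) ^ 2 + (β + n) ^ 2)) := by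
  have hc : (0 : ℝ) < 4 * Real.pi ^ 2 * (4 : ℝ) ^ ℓ := by positivity
  have e : ∀ (v : ℂ) (m : ℤ), ‖v‖ ^ 2 / (4 * Real.pi ^ 2 * (4 : ℝ) ^ ℓ * ((α + m) ^ 2 + (β + n) ^ 2)) =
      (1 / (4 * Real.pi ^ 2 * (4 : ℝ) ^ ℓ)) * (‖v‖ ^ 2 / ((α + m) ^ 2 + (β + n) ^ 2)) := by
    intro v m
    rw [mul_comm (4 * Real.pi ^ 2 * (4 : ℝ) ^ ℓ) ((α + (m : ℝ)) ^ 2 + (β + n) ^ 2), ← div_div, div_eq_mul_one_div, mul_comm]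
  simp_rw [e, ← Finset.mul_sum]
  rw [mul_left_comm]
  refine mul_le_mul_of_nonneg_left ?_ (by positivity)
  rcases eq_or_ne (β + (n : ℝ)) 0 with hb | hb
  · -- the untransported column `β + n = 0`
    have hid : ∀ m' ∈ win K, vTransport α β θ K ζ m' n = ζ m' n := by
      intro m' hm'
      rw [vTransport_apply_of_mem α β θ K ζ hm' hn]
      have h1 : ∀ x : ℝ, Complex.exp (-((2 * Real.pi * (β + n) * θ * triWave x : ℝ) : ℂ) * Complex.I) = 1 := by
        intro x; rw [hb]; simp
      simp_rw [h1, mul_one]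
      rw [integral_blochPoly_mul_conjExp, if_pos hm']
    rw [Finset.sum_congr rfl fun m' hm' => by rw [hid m' hm']]
    have h0 : 0 ≤ ∑ m ∈ win K, ‖ζ m n‖ ^ 2 / ((α + m) ^ 2 + (β + n) ^ 2) := Finset.sum_nonneg fun _ _ => by positivity
    nlinarith [sq_nonneg θ]
  · rw [Finset.sum_congr rfl fun m' hm' => by rw [vTransport_apply_of_mem α β θ K ζ hm' hn]]
    exact transport_energy_duality α θ hb (win K) (win K) (fun m => ζ m n)

/-- **L-i-b BY NAME (V slot).** For every class `(α, β)`, strain `θ`, level `ℓ`, window `K` and lattice state `ζ`: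
`cEnergy α β ℓ K (vTransport α β θ K ζ) ≤ (θ² + 2)·cEnergy α β ℓ K ζ`. -/
theorem cEnergy_vTransport_le (α β θ : ℝ) (ℓ K : ℕ) (ζ : CState) :
    cEnergy α β ℓ K (vTransport α β θ K ζ) ≤ (θ ^ 2 + 2) * cEnergy α β ℓ K ζ := by
  unfold cEnergy
  rw [Finset.sum_comm]
  conv_rhs => rw [Finset.sum_comm]
  rw [Finset.mul_sum]
  exact Finset.sum_le_sum fun n hn => vTransport_column_energy_le α β θ ℓ K ζ hn

/-! ## §13/§14/§18 (copies) transport locality, V-input energy, child bookkeeping -/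

/-- Integers `n` with `|β + n| ≤ R` inside any finset number at most `2R + 1`. -/
theorem card_filter_abs_le (β : ℝ) {R : ℝ} (hR : 0 ≤ R) (S : Finset ℤ) :
    (((S.filter fun n : ℤ => |β + n| ≤ R).card : ℕ) : ℝ) ≤ 2 * R + 1 := by
  set T := S.filter fun n : ℤ => |β + n| ≤ R with hT
  have hsub : T ⊆ Finset.Icc ⌈-β - R⌉ ⌊-β + R⌋ := by
    intro n hn
    rw [hT, Finset.mem_filter] at hn
    obtain ⟨h1, h2⟩ := abs_le.1 hn.2
    rw [Finset.mem_Icc]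
    constructor
    · exact Int.ceil_le.2 (by linarith)
    · exact Int.le_floor.2 (by linarith)
  have hcard := Finset.card_le_card hsub
  rw [Int.card_Icc] at hcard
  have h1 : ((T.card : ℕ) : ℝ) ≤ (((⌊-β + R⌋ + 1 - ⌈-β - R⌉).toNat : ℕ) : ℝ) := by exact_mod_cast hcard
  refine h1.trans ?_
  have h2 : ((⌊-β + R⌋ + 1 - ⌈-β - R⌉ : ℤ) : ℝ) ≤ 2 * R + 1 := by
    have hf : ((⌊-β + R⌋ : ℤ) : ℝ) ≤ -β + R := Int.floor_le _
    have hc : -β - R ≤ ((⌈-β - R⌉ : ℤ) : ℝ) := Int.le_ceil _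
    push_cast; linarith
  rcases le_or_gt 0 (⌊-β + R⌋ + 1 - ⌈-β - R⌉) with h | h
  · rw [show (((⌊-β + R⌋ + 1 - ⌈-β - R⌉).toNat : ℕ) : ℝ) = ((⌊-β + R⌋ + 1 - ⌈-β - R⌉ : ℤ) : ℝ) by
      rw [← Int.toNat_of_nonneg h]; push_cast; rw [Int.toNat_of_nonneg h]]
    exact h2
  · rw [Int.toNat_eq_zero.2 h.le]; push_cast; linarith


/-! ## §13 (v6, E6-b locality) p4's `hTransport` entries in closed form: the transported profile's coefficients are `Σ_n c_n τ(a,θ; β+n → β+n′)`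
with `|τ| ≤ min(1, 4/|Λ₊| + 2/|Λ₋|)`, `Λ± = 2π(n − n′ ± aθ)` (tree `…KHTransportCoeff`) -/

/-! ## §14 (v7) L-i-c BY NAME: the windowed input energy of a V source in `Transfer` (tree `…KHStraightPairEnergy`, p707331) -/

/-- The level-0 windowed energy of the V-source input state, spelled out (the window truncation is invisible inside `cEnergy`'s window sums). -/
theorem cEnergy_inputState_V (α β θ : ℝ) (K : ℕ) (d : ℤ → Fin 2 → ℂ) :
    cEnergy α β 0 K (inputState α β θ K PType.V d) = ∑ m ∈ win K, ∑ n ∈ win K,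
      ‖d n 0 * Complex.exp (-(Real.pi * (α + m) / 2 : ℝ) * Complex.I) + d n 1 * Complex.exp ((Real.pi * (α + m) / 2 : ℝ) * Complex.I)‖ ^ 2 /
        (4 * Real.pi ^ 2 * ((α + m) ^ 2 + (β + n) ^ 2)) := by
  unfold cEnergy
  refine Finset.sum_congr rfl fun m hm => Finset.sum_congr rfl fun n hn => ?_
  simp only [inputState, truncW, vPairState, if_pos (And.intro hm hn), pow_zero, mul_one]

/-- **L-i-c BY NAME** (E6 far-row schema, piece (i), A27-7): for a class `(α, β)` with `α ∈ [0,1]`, every strain `θ`, truncation `K` and V-pair densities `d`,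
`cEnergy α β 0 K (inputState α β θ K V d) ≥ (1/4π²)·Σ_{|n| ≤ K} (‖d n 0‖² + ‖d n 1‖²)·(π/|β+n| − 2/(K+1) − 4/(β+n)²)`: every source column in shell `s`
(`|β+n| ≥ 2^{s−1}`) inside the window carries at least `1 − (2/π)2^{s−1}/(K+1) − 8/(π2^s)` of its full-lattice energy `(‖d n 0‖²+‖d n 1‖²)/(4π|β+n|)` —
the denominator of every far entry `M[(t′,s′) ← (V,s)]`. -/
theorem cEnergy_inputState_V_lower {α : ℝ} (hα0 : 0 ≤ α) (hα1 : α ≤ 1) (β θ : ℝ) (K : ℕ) (d : ℤ → Fin 2 → ℂ) :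
    (∑ n ∈ win K, (‖d n 0‖ ^ 2 + ‖d n 1‖ ^ 2) * (Real.pi / |β + n| - 2 / (K + 1) - 4 / (β + n) ^ 2)) / (4 * Real.pi ^ 2) ≤
      cEnergy α β 0 K (inputState α β θ K PType.V d) := by
  rw [cEnergy_inputState_V]
  exact vPair_window_energy_lower hα0 hα1 β K d

/-- **The input energy of a V source supported in shell `s ≥ 2` (uniform form):** if `d` vanishes off shell `s` (`|β+n| ∈ [2^{s−1}, 2^s)`), then
`cEnergy α β 0 K (inputState α β θ K V d) ≥ (1/4π²)·(π/2^s − 2/(K+1) − 4/4^{s−1})·Σ_{|n| ≤ K} (‖d n 0‖² + ‖d n 1‖²)`. -/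
theorem cEnergy_inputState_V_shell_lower {α : ℝ} (hα0 : 0 ≤ α) (hα1 : α ≤ 1) (β θ : ℝ) (K : ℕ) {s : ℕ} (hs : 2 ≤ s) (d : ℤ → Fin 2 → ℂ)
    (hd : SupportedIn s β d) :
    (Real.pi / 2 ^ s - 2 / (K + 1) - 4 / 4 ^ (s - 1)) * (∑ n ∈ win K, (‖d n 0‖ ^ 2 + ‖d n 1‖ ^ 2)) / (4 * Real.pi ^ 2) ≤
      cEnergy α β 0 K (inputState α β θ K PType.V d) := by
  refine le_trans ?_ (cEnergy_inputState_V_lower hα0 hα1 β θ K d)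
  refine div_le_div_of_nonneg_right ?_ (by positivity)
  rw [Finset.mul_sum]
  refine Finset.sum_le_sum fun n _ => ?_
  by_cases hin : InShell s (β + (n : ℝ))
  · obtain ⟨k, rfl⟩ : ∃ k, s = k + 2 := ⟨s - 2, by omega⟩
    have hlo : (2 : ℝ) ^ (k + 1) ≤ |β + n| := hin.1
    have hhi : |β + n| < (2 : ℝ) ^ (k + 2) := hin.2
    have hpos : (0 : ℝ) < 2 ^ (k + 1) := by positivity
    have hb0 : 0 < |β + n| := hpos.trans_le hlo
    rw [mul_comm]
    refine mul_le_mul_of_nonneg_left ?_ (by positivity)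
    have e1 : Real.pi / 2 ^ (k + 2) ≤ Real.pi / |β + n| := div_le_div_of_nonneg_left Real.pi_pos.le hb0 hhi.le
    have e2 : 4 / (β + (n : ℝ)) ^ 2 ≤ 4 / 4 ^ (k + 2 - 1) := by
      rw [show k + 2 - 1 = k + 1 by omega, ← sq_abs]
      refine div_le_div_of_nonneg_left (by norm_num) (by positivity) ?_
      calc (4 : ℝ) ^ (k + 1) = (2 ^ (k + 1)) ^ 2 := by rw [← pow_mul, show (4 : ℝ) = 2 ^ 2 by norm_num, ← pow_mul]; ring_nf
        _ ≤ |β + n| ^ 2 := pow_le_pow_left₀ hpos.le hlo 2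
    linarith
  · have h0 : d n = 0 := hd n hin
    simp [h0]

/-- The child of the V-source input state, entrywise. -/
theorem norm_child_inputState_V_le (α β θ : ℝ) (K : ℕ) (d : ℤ → Fin 2 → ℂ) (pm pn m n : ℤ) :
    ‖child pm pn (inputState α β θ K PType.V d) m n‖ ≤ ‖d (2 * n + pn) 0‖ + ‖d (2 * n + pn) 1‖ := by
  simp only [child, inputState, truncW, vPairState]
  split_ifs with h
  · refine (norm_add_le _ _).trans (le_of_eq ?_)
    rw [norm_mul, norm_mul, Complex.norm_exp_ofReal_mul_I, mul_one,
      show -((Real.pi * (α + ((2 * m + pm : ℤ) : ℝ)) / 2 : ℝ) : ℂ) * Complex.I = ((-(Real.pi * (α + ((2 * m + pm : ℤ) : ℝ)) / 2) : ℝ) : ℂ) * Complex.I by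
        push_cast; ring, Complex.norm_exp_ofReal_mul_I, mul_one]
  · simp only [norm_zero]; positivity

/-- Counting the rows of a shell inside any finite set: at most `2·2^{s} + 1`. -/
theorem card_filter_inShell_le (c : ℝ) (s : ℕ) (hs : 2 ≤ s) (S : Finset ℤ) :
    (((S.filter fun m : ℤ => shellLo s ≤ |c + (m : ℝ)| ∧ |c + (m : ℝ)| < shellHi s).card : ℕ) : ℝ) ≤ 2 * 2 ^ s + 1 := by
  have hsub : (S.filter fun m : ℤ => shellLo s ≤ |c + (m : ℝ)| ∧ |c + (m : ℝ)| < shellHi s) ⊆ S.filter fun m : ℤ => |c + m| ≤ (2 : ℝ) ^ s := by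
    intro m hm
    rw [Finset.mem_filter] at hm ⊢
    refine ⟨hm.1, ?_⟩
    have h2 := hm.2.2
    obtain ⟨k, rfl⟩ : ∃ k, s = k + 2 := ⟨s - 2, by omega⟩
    simp only [shellHi, shellLo] at h2
    rw [show k + 2 = (k + 1) + 1 by ring]
    exact h2.le
  calc (((S.filter fun m : ℤ => shellLo s ≤ |c + (m : ℝ)| ∧ |c + (m : ℝ)| < shellHi s).card : ℕ) : ℝ)
      ≤ (((S.filter fun m : ℤ => |c + m| ≤ (2 : ℝ) ^ s).card : ℕ) : ℝ) := by exact_mod_cast Finset.card_le_card hsub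
    _ ≤ 2 * 2 ^ s + 1 := card_filter_abs_le c (by positivity) S

/-- The input-energy coefficient from shell 3 on: `1/(2·2^s) ≤ π/2^s − 2/(K+1) − 4/4^{s−1}` for `s ≥ 3`, `K + 1 ≥ 2^{s+2}`. -/
theorem input_coef_lower3 {s : ℕ} (hs : 3 ≤ s) {K : ℕ} (hK : (2 : ℝ) ^ (s + 2) ≤ K + 1) :
    1 / (2 * (2 : ℝ) ^ s) ≤ Real.pi / 2 ^ s - 2 / ((K : ℝ) + 1) - 4 / 4 ^ (s - 1) := by
  set X : ℝ := (2 : ℝ) ^ s with hX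
  have hX8 : 8 ≤ X := by
    rw [hX]; calc (8 : ℝ) = 2 ^ 3 := by norm_num
      _ ≤ 2 ^ s := pow_le_pow_right₀ (by norm_num) hs
  have hXpos : 0 < X := by linarith
  have h4 : (4 : ℝ) / 4 ^ (s - 1) = 16 / X ^ 2 := by
    obtain ⟨j, rfl⟩ : ∃ j, s = j + 1 := ⟨s - 1, by omega⟩
    rw [show j + 1 - 1 = j by omega]
    have h' : (4 : ℝ) ^ j * 4 = X ^ 2 := by
      rw [hX, ← pow_succ, ← pow_mul, show (4 : ℝ) = 2 ^ 2 by norm_num, ← pow_mul]; ring_nf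
    rw [← h']
    field_simp
    ring
  have hK' : 2 / ((K : ℝ) + 1) ≤ 1 / (2 * X) := by
    rw [div_le_div_iff₀ (by positivity) (by positivity)]
    have : (2 : ℝ) ^ (s + 2) = 4 * X := by rw [hX, pow_add]; ring
    nlinarith
  have hx16 : 16 / X ^ 2 ≤ (Real.pi - 1) / X := by
    rw [div_le_div_iff₀ (by positivity) hXpos]
    have hπ := Real.pi_gt_three
    nlinarith
  have e1 : (Real.pi - 1) / X = Real.pi / X - 1 / (2 * X) - 1 / (2 * X) := by ring
  rw [h4]
  linarith


/-! ## §20 (copies from `K2TruncationRK.lean`) windows, tails, (F1)/(F3) -/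

/-- `shellHi s ≤ 2^s`. -/
theorem shellHi_le_two_pow (s : ℕ) : shellHi s ≤ (2 : ℝ) ^ s := by
  cases s with
  | zero => simp only [shellHi, shellLo]; norm_num
  | succ k => simp only [shellHi, shellLo]; rw [pow_succ]

/-- A density supported in shell `s` (class coordinate `c ∈ [0,1)`) vanishes at every `k` with `|k| ≥ 2^s + 1`. -/
theorem supportedIn_apply_eq_zero {s : ℕ} {c : ℝ} (hc0 : 0 ≤ c) (hc1 : c < 1) {d : ℤ → Fin 2 → ℂ} (hd : SupportedIn s c d) {k : ℤ}
    (hk : (2 : ℝ) ^ s + 1 ≤ |(k : ℝ)|) : d k = 0 := by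
  refine hd k fun h => ?_
  have h2 := h.2
  have hs := shellHi_le_two_pow s
  have : |(k : ℝ)| ≤ |c + k| + |c| := by
    have h := abs_add_le (c + k) (-c)
    rw [abs_neg, show c + (k : ℝ) + -c = k by ring] at h
    exact h
  rw [abs_of_nonneg hc0] at this
  linarith

/-- Membership in the window, unfolded. -/
theorem mem_win {K : ℕ} {x : ℤ} : x ∈ win K ↔ -(K : ℤ) ≤ x ∧ x ≤ K := by
  simp only [win, Finset.mem_Icc]

/-- **(F3)** The windowed input energy of a V source is monotone in the window. -/
theorem cEnergy_inputState_V_mono (α β θ : ℝ) {K₀ K : ℕ} (hK : K₀ ≤ K) (d : ℤ → Fin 2 → ℂ) :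
    cEnergy α β 0 K₀ (inputState α β θ K₀ PType.V d) ≤ cEnergy α β 0 K (inputState α β θ K PType.V d) := by
  rw [cEnergy_inputState_V, cEnergy_inputState_V]
  have hsub : win K₀ ⊆ win K := by
    intro x hx; rw [mem_win] at hx ⊢; omega
  refine (Finset.sum_le_sum_of_subset_of_nonneg hsub fun m _ _ => Finset.sum_nonneg fun n _ => by positivity).trans ?_
  exact Finset.sum_le_sum fun m _ => Finset.sum_le_sum_of_subset_of_nonneg hsub fun n _ _ => by positivity

/-- **(F1), profile level.** The row profile of a child of the V-source input state does not depend on the truncation once the window contains the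
source shell (`2^s + 1 ≤ K₀ ≤ K`) and the row (`2m + pm ∈ win K₀`). -/
theorem modeProfile_child_inputState_V_eq {α β θ : ℝ} (hβ0 : 0 ≤ β) (hβ1 : β < 1) {s : ℕ} {d : ℤ → Fin 2 → ℂ} (hd : SupportedIn s β d)
    {K₀ K : ℕ} (hK₀ : 2 ^ s + 1 ≤ K₀) (hK : K₀ ≤ K) {pm pn : ℤ} (hpn : pn ∈ parities) {m : ℤ} (hm : 2 * m + pm ∈ win K₀) :
    modeProfile ((β + pn) / 2) K (child pm pn (inputState α β θ K PType.V d) m) =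
      modeProfile ((β + pn) / 2) K₀ (child pm pn (inputState α β θ K₀ PType.V d) m) := by
  have hsub : win K₀ ⊆ win K := by
    intro x hx; rw [mem_win] at hx ⊢; omega
  have hpn' : pn = 0 ∨ pn = 1 := by simpa [parities] using hpn
  have hK₀r : (2 : ℝ) ^ s + 1 ≤ (K₀ : ℝ) := by exact_mod_cast hK₀
  -- a column index outside the small window carries no density
  have hzero : ∀ n : ℤ, n ∉ win K₀ → d (2 * n + pn) = 0 := by
    intro n hn
    rw [mem_win, not_and_or, not_le, not_le] at hn
    apply supportedIn_apply_eq_zero hβ0 hβ1 hd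
    have : (K₀ : ℝ) + 1 ≤ |((2 * n + pn : ℤ) : ℝ)| := by
      rcases hn with h | h
      · have h' : (n : ℝ) ≤ -(K₀ : ℝ) - 1 := by exact_mod_cast (show n ≤ -(K₀ : ℤ) - 1 by omega)
        rw [abs_of_neg (by push_cast; rcases hpn' with h1 | h1 <;> rw [h1] <;> push_cast <;> linarith)]
        push_cast; rcases hpn' with h1 | h1 <;> rw [h1] <;> push_cast <;> linarith
      · have h' : (K₀ : ℝ) + 1 ≤ n := by exact_mod_cast (show (K₀ : ℤ) + 1 ≤ n by omega)
        rw [abs_of_pos (by push_cast; rcases hpn' with h1 | h1 <;> rw [h1] <;> push_cast <;> linarith)]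
        push_cast; rcases hpn' with h1 | h1 <;> rw [h1] <;> push_cast <;> linarith
    linarith
  have hm' : 2 * m + pm ∈ win K := hsub hm
  funext y
  simp only [modeProfile, child, inputState, truncW]
  symm
  refine Finset.sum_subset_zero_on_sdiff hsub (fun n hn => ?_) (fun n hn => ?_)
  · rw [Finset.mem_sdiff] at hn
    have h0 := hzero n hn.2
    simp [vPairState, h0]
  · by_cases hdn : d (2 * n + pn) = 0
    · simp [vPairState, hdn]
    · have hn2 : 2 * n + pn ∈ win K₀ := by
        by_contra hc
        rw [mem_win, not_and_or, not_le, not_le] at hc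
        apply hdn
        apply supportedIn_apply_eq_zero hβ0 hβ1 hd
        rcases hc with h | h
        · have h' : (((2 * n + pn : ℤ)) : ℝ) ≤ -(K₀ : ℝ) - 1 := by exact_mod_cast (show 2 * n + pn ≤ -(K₀ : ℤ) - 1 by omega)
          rw [abs_of_neg (by linarith)]; linarith
        · have h' : (K₀ : ℝ) + 1 ≤ ((2 * n + pn : ℤ) : ℝ) := by exact_mod_cast (show (K₀ : ℤ) + 1 ≤ 2 * n + pn by omega)
          rw [abs_of_pos (by linarith)]; linarith
      rw [if_pos ⟨hm, hn2⟩, if_pos ⟨hm', hsub hn2⟩]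

/-- The window grows by the two end points. -/
theorem win_succ (K : ℕ) : win (K + 1) = insert (-((K : ℤ) + 1)) (insert ((K : ℤ) + 1) (win K)) := by
  ext n
  simp only [win, Finset.mem_Icc, Finset.mem_insert, Nat.cast_add, Nat.cast_one]
  omega

/-- Splitting a window sum at the two new end points. -/
theorem sum_win_succ (f : ℤ → ℝ) (K : ℕ) :
    ∑ n ∈ win (K + 1), f n = f (-((K : ℤ) + 1)) + (f ((K : ℤ) + 1) + ∑ n ∈ win K, f n) := by
  rw [win_succ, Finset.sum_insert, Finset.sum_insert]
  · simp only [win, Finset.mem_Icc]; omega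
  · simp only [win, Finset.mem_insert, Finset.mem_Icc]; omega

/-- **The column tail:** `Σ_{K₀ < |n| ≤ K} 1/(|n|−1)² ≤ 2/(K₀−1)` (`K₀ ≥ 2`; telescoping). -/
theorem sum_win_tail_inv_sq_le {K₀ : ℕ} (hK₀ : 2 ≤ K₀) {K : ℕ} (hK : K₀ ≤ K) :
    ∑ n ∈ win K, (if n ∈ win K₀ then (0 : ℝ) else 1 / ((|(n : ℝ)| - 1) ^ 2)) ≤ 2 / ((K₀ : ℝ) - 1) - 2 / ((K : ℝ) - 1) := by
  induction K, hK using Nat.le_induction with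
  | base => rw [Finset.sum_eq_zero fun n hn => if_pos hn]; simp
  | succ K hKK ih =>
    have hK1 : (1 : ℝ) ≤ (K : ℝ) - 1 := by
      have : (2 : ℝ) ≤ K := by exact_mod_cast hK₀.trans hKK
      linarith
    rw [sum_win_succ]
    have hn1 : (-((K : ℤ) + 1)) ∉ win K₀ := by rw [mem_win]; omega
    have hn2 : ((K : ℤ) + 1) ∉ win K₀ := by rw [mem_win]; omega
    rw [if_neg hn1, if_neg hn2]
    have e1 : |((-((K : ℤ) + 1) : ℤ) : ℝ)| - 1 = K := by push_cast; rw [abs_of_neg (by linarith)]; ring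
    have e2 : |((((K : ℤ) + 1) : ℤ) : ℝ)| - 1 = K := by push_cast; rw [abs_of_pos (by linarith)]; ring
    rw [e1, e2]
    push_cast
    have hK0 : (0 : ℝ) < K := by linarith
    have key : 1 / (K : ℝ) ^ 2 + 1 / (K : ℝ) ^ 2 ≤ 2 / ((K : ℝ) - 1) - 2 / ((K : ℝ) + 1 - 1) := by
      rw [show (K : ℝ) + 1 - 1 = K by ring, show 2 / ((K : ℝ) - 1) - 2 / K = 2 / (((K : ℝ) - 1) * K) by field_simp; ring,
        show 1 / (K : ℝ) ^ 2 + 1 / (K : ℝ) ^ 2 = 2 / ((K : ℝ) ^ 2) by ring]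
      exact div_le_div_of_nonneg_left (by norm_num) (by nlinarith) (by nlinarith)
    linarith


/-! ## §21 (p2 g12) THE PAIRED SINGLE-MODE LAW BY NAME and the best per-mode creation weight -/

/-- **Paired envelope of the single-mode sources at a lattice mode `ξ = β + n`** (tree `norm_src_lattice_env_le`, p713713). -/
theorem norm_src_lattice_le {a : ℝ} (ha : 0 < a) (β : ℝ) (n : ℤ) {y₀ : ℝ} (hy₀ : y₀ = 1 / 4 ∨ y₀ = -(1 / 4)) (s : ℝ) :
    ‖src a β (β + n) y₀ s‖ ≤
      (1 + Real.exp (-(2 * Real.pi * a)) + 2 * Real.exp (-(2 * Real.pi * a) / 4) ^ 2) * (1 + |s| / 2) *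
          (1 / (1 + ((β + n) / a + 1 * s) ^ 2) + 1 / (1 + ((β + n) / a + (-1) * s) ^ 2)) /
        ((1 - Real.exp (-(2 * Real.pi * a))) * (2 * Real.pi * a) ^ 2) :=
  norm_src_lattice_env_le ha β n rfl hy₀ s (K := kernelK a β) (G := lineKernel a β) rfl (lineKernel_eq ha β)

/-- **THE PAIRED SINGLE-MODE CREATION LAW BY NAME** (`a ≥ 1`, `θ ≥ 0`, any Bloch phase `β`, lattice mode `ξ = β + n`):
`‖sheetAmps a β θ (singleMode (β+n)) i‖ ≤ 4πa(ap+2a‖S‖)/ω · (1+q+2x²)(1+θ/2)(arctan((β+n)/a+θ) − arctan((β+n)/a−θ))/((1−q)κ²)` — the weight that decays like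
`a/ξ²` for far modes (tree `mode_component_paired_le`, p714232). -/
theorem norm_sheetAmps_singleMode_paired {a : ℝ} (ha : 1 ≤ a) (β : ℝ) (n : ℤ) {θ : ℝ} (hθ0 : 0 ≤ θ) (i : Fin 2) :
    ‖sheetAmps a β θ (singleMode (β + n)) i‖ ≤
      4 * Real.pi * a * (a * (Real.pi / 2 + 2 * sawSigma0 a β) + 2 * a * ‖sawS a β‖) / (a * Real.sqrt (max 0 (sawC2 a β))) *
        ((1 + Real.exp (-(2 * Real.pi * a)) + 2 * Real.exp (-(2 * Real.pi * a) / 4) ^ 2) * (1 + θ / 2) *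
          (Real.arctan ((β + n) / a + θ) - Real.arctan ((β + n) / a - θ)) / ((1 - Real.exp (-(2 * Real.pi * a))) * (2 * Real.pi * a) ^ 2)) := by
  have ha0 : 0 < a := by linarith
  have h0 := twoPi_lineKernel_zero' ha0 β
  have hh := twoPi_conj_lineKernel_half' ha0 β
  have hE₀ := norm_src_lattice_le ha0 β n (y₀ := 1 / 4) (Or.inl rfl)
  have hE₁ := norm_src_lattice_le ha0 β n (y₀ := -(1 / 4)) (Or.inr rfl)
  obtain ⟨e00, e01, e10, e11⟩ := blockX_apply a β
  fin_cases i
  · simp only [Fin.zero_eta, Fin.isValue]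
    rw [sheetAmps_singleMode_apply_0 ha, sqrt_neg_khLam_eq_beta ha, e00, e01]
    exact mode_component_paired_le ha hθ0 h0 hh hE₀ hE₁
  · simp only [Fin.mk_one, Fin.isValue]
    rw [sheetAmps_singleMode_apply_1 ha, sqrt_neg_khLam_eq_beta ha, e10, e11]
    exact mode_component_paired_le' ha hθ0 h0 hh hE₀ hE₁

/-- **The BEST per-mode creation weight BY NAME** (`a ≥ 4`, `0 ≤ θ ≤ 8`, lattice mode `ξ = β + n`): `‖sheetAmps a β θ (singleMode ξ) i‖ ≤ 0.889/a`
for `|ξ| < 16a` (the sharp law) and `≤ 102·a/ξ²` for `|ξ| ≥ 16a` (the paired far law, `25.5/(a(1+(|ξ/a|−8)²)) ≤ 102a/ξ²`). -/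
theorem norm_sheetAmps_singleMode_best {a : ℝ} (ha : 4 ≤ a) (β : ℝ) (n : ℤ) {θ : ℝ} (hθ0 : 0 ≤ θ) (hθ : θ ≤ 8) (i : Fin 2) :
    ‖sheetAmps a β θ (singleMode (β + n)) i‖ ≤ if |β + (n : ℝ)| < 16 * a then 0.889 / a else 102 * a / (β + n) ^ 2 := by
  have ha0 : 0 < a := by linarith
  split_ifs with h
  · exact norm_sheetAmps_singleMode_le ha β (β + n) hθ0 hθ i
  · have hfar : 16 * a ≤ |β + (n : ℝ)| := not_lt.mp h
    refine (norm_sheetAmps_singleMode_paired (by linarith) β n hθ0 i).trans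
      ((paired_mode_factor_far_le ha β (β + n) hθ0 hθ hfar).trans ?_)
    -- `25.5/(a(1+(|u|−8)²)) ≤ 102 a/ξ²`: `(|u|−8)² ≥ u²/4` for `|u| ≥ 16`
    have hu : 16 ≤ |(β + n) / a| := by rw [abs_div, abs_of_pos ha0, le_div_iff₀ ha0]; linarith
    have hξ2 : (β + (n : ℝ)) ^ 2 = a ^ 2 * |(β + n) / a| ^ 2 := by
      rw [abs_div, abs_of_pos ha0, div_pow, sq_abs]; field_simp
    have hpos : 0 < (β + (n : ℝ)) ^ 2 := by rw [hξ2]; positivity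
    rw [div_le_div_iff₀ (by positivity) hpos, hξ2]
    nlinarith [sq_nonneg (|(β + ↑n) / a| - 16), ha0, mul_pos ha0 ha0, sq_nonneg a]

/-! ## §22 (p2 g12) THE ENERGY-FORM (ℓ²) CREATION LAW BY NAME: `‖q‖² ≤ 8000·a·Σ_n ‖c n‖²/(a²+(β+n)²)` for EVERY profile -/

/-- **THE ENERGY-FORM CREATION LAW, positive lines** (`a ≥ 4`, `|β| ≤ 1`, `0 ≤ θ ≤ 8`, any window `K`, ANY profile `c`):
`‖sheetAmps a β θ ⟨modeProfile β K c, []⟩ i‖² ≤ 8000·a·Σ_{|n|≤K} ‖c n‖²/(a²+(β+n)²)` — linearity over modes, the best per-mode weight, Cauchy–Schwarz and the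
square sum of the weights (`sum_sq_creationWeight_le`, tree p714393). Uniform in the window ONLY through the `1/ξ²` far law. -/
theorem norm_sq_sheetAmps_modeProfile_le {a : ℝ} (ha : 4 ≤ a) {β : ℝ} (hβ : |β| ≤ 1) {θ : ℝ} (hθ0 : 0 ≤ θ) (hθ : θ ≤ 8) (K : ℕ)
    (c : ℤ → ℂ) (i : Fin 2) :
    ‖sheetAmps a β θ ⟨modeProfile β K c, []⟩ i‖ ^ 2 ≤ 8000 * a * ∑ n ∈ win K, ‖c n‖ ^ 2 / (a ^ 2 + (β + n) ^ 2) := by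
  have ha0 : 0 < a := by linarith
  have ha1 : 1 ≤ a := by linarith
  -- linearity over the modes and the per-mode weights
  have hlin : ‖sheetAmps a β θ ⟨modeProfile β K c, []⟩ i‖ ≤
      ∑ n ∈ win K, ‖c n‖ * (if |β + (n : ℝ)| < 16 * a then 0.889 / a else 102 * a / (β + n) ^ 2) := by
    rw [sheetAmps_modeProfile ha1 β θ K c, Finset.sum_apply]
    refine (norm_sum_le _ _).trans (Finset.sum_le_sum fun n _ => ?_)
    rw [Pi.smul_apply, norm_smul]
    exact mul_le_mul_of_nonneg_left (norm_sheetAmps_singleMode_best ha β n hθ0 hθ i) (norm_nonneg _)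
  have hsum0 : 0 ≤ ∑ n ∈ win K, ‖c n‖ * (if |β + (n : ℝ)| < 16 * a then 0.889 / a else 102 * a / (β + n) ^ 2) :=
    Finset.sum_nonneg fun n _ => mul_nonneg (norm_nonneg _) (by split_ifs <;> positivity)
  -- Cauchy–Schwarz with `f = ‖c‖²/(a²+ξ²)`, `g = W²(a²+ξ²)`
  have hCS := Finset.sum_sq_le_sum_mul_sum_of_sq_le_mul (win K)
    (r := fun n : ℤ => ‖c n‖ * (if |β + (n : ℝ)| < 16 * a then 0.889 / a else 102 * a / (β + n) ^ 2))
    (f := fun n : ℤ => ‖c n‖ ^ 2 / (a ^ 2 + (β + n) ^ 2))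
    (g := fun n : ℤ => if |β + (n : ℝ)| < 16 * a then (0.889 / a) ^ 2 * (a ^ 2 + (β + n) ^ 2) else (102 * a / (β + n) ^ 2) ^ 2 * (a ^ 2 + (β + n) ^ 2))
    (fun n _ => by positivity) (fun n _ => by split_ifs <;> positivity) (fun n _ => le_of_eq ?_)
  · have hW := sum_sq_creationWeight_le ha hβ K
    have hwin : win K = Finset.Icc (-(K : ℤ)) K := rfl
    rw [← hwin] at hW
    have hf0 : 0 ≤ ∑ n ∈ win K, ‖c n‖ ^ 2 / (a ^ 2 + (β + n) ^ 2) := Finset.sum_nonneg fun n _ => by positivity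
    calc ‖sheetAmps a β θ ⟨modeProfile β K c, []⟩ i‖ ^ 2
        ≤ (∑ n ∈ win K, ‖c n‖ * (if |β + (n : ℝ)| < 16 * a then 0.889 / a else 102 * a / (β + n) ^ 2)) ^ 2 :=
          pow_le_pow_left₀ (norm_nonneg _) hlin 2
      _ ≤ (∑ n ∈ win K, ‖c n‖ ^ 2 / (a ^ 2 + (β + n) ^ 2)) *
            ∑ n ∈ win K, (if |β + (n : ℝ)| < 16 * a then (0.889 / a) ^ 2 * (a ^ 2 + (β + n) ^ 2)
              else (102 * a / (β + n) ^ 2) ^ 2 * (a ^ 2 + (β + n) ^ 2)) := hCS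
      _ ≤ (∑ n ∈ win K, ‖c n‖ ^ 2 / (a ^ 2 + (β + n) ^ 2)) * (8000 * a) := mul_le_mul_of_nonneg_left hW hf0
      _ = 8000 * a * ∑ n ∈ win K, ‖c n‖ ^ 2 / (a ^ 2 + (β + n) ^ 2) := by ring
  · -- `r² = f·g`
    have hpos : 0 < a ^ 2 + (β + (n : ℝ)) ^ 2 := by positivity
    split_ifs <;> field_simp

/-- **THE ENERGY-FORM CREATION LAW, negative lines** (`a ≤ −4`; by the conjugation symmetry `(a,β,ξ) ↦ (−a,−β,−ξ)` of §17). -/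
theorem norm_sq_sheetAmps_modeProfile_le_of_neg {a : ℝ} (ha : a ≤ -4) {β : ℝ} (hβ : |β| ≤ 1) {θ : ℝ} (hθ0 : 0 ≤ θ) (hθ : θ ≤ 8) (K : ℕ)
    (c : ℤ → ℂ) (i : Fin 2) :
    ‖sheetAmps a β θ ⟨modeProfile β K c, []⟩ i‖ ^ 2 ≤ 8000 * |a| * ∑ n ∈ win K, ‖c n‖ ^ 2 / (a ^ 2 + (β + n) ^ 2) := by
  have ha' : 4 ≤ -a := by linarith
  have ha1 : 1 ≤ -a := by linarith
  have hc : (fun n : ℤ => starRingEnd ℂ ((fun n : ℤ => starRingEnd ℂ (c (-n))) (-n))) = c := by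
    funext n; simp
  have h := sheetAmps_neg_neg_modeProfile ha1 (-β) θ K (fun n => starRingEnd ℂ (c (-n))) i
  rw [neg_neg, neg_neg, hc] at h
  rw [h, Complex.norm_conj, abs_of_neg (by linarith)]
  have hβ' : |-β| ≤ 1 := by rwa [abs_neg]
  refine (norm_sq_sheetAmps_modeProfile_le ha' hβ' hθ0 hθ K (fun n => starRingEnd ℂ (c (-n))) i).trans (le_of_eq ?_)
  congr 1
  refine Finset.sum_nbij' (fun n => -n) (fun n => -n) (fun n hn => by simp only [win, Finset.mem_Icc] at hn ⊢; omega)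
    (fun n hn => by simp only [win, Finset.mem_Icc] at hn ⊢; omega) (fun n _ => neg_neg n) (fun n _ => neg_neg n) (fun n _ => ?_)
  rw [Complex.norm_conj]
  push_cast
  ring

/-- **The energy-form law on every far line** (`|a| ≥ 4`): `‖q_i‖² ≤ 8000·|a|·Σ_n ‖c n‖²/(a²+(β+n)²)`. -/
theorem norm_sq_sheetAmps_modeProfile_le_abs {a : ℝ} (ha : 4 ≤ |a|) {β : ℝ} (hβ : |β| ≤ 1) {θ : ℝ} (hθ0 : 0 ≤ θ) (hθ : θ ≤ 8) (K : ℕ)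
    (c : ℤ → ℂ) (i : Fin 2) :
    ‖sheetAmps a β θ ⟨modeProfile β K c, []⟩ i‖ ^ 2 ≤ 8000 * |a| * ∑ n ∈ win K, ‖c n‖ ^ 2 / (a ^ 2 + (β + n) ^ 2) := by
  rcases le_or_gt 0 a with h | h
  · rw [abs_of_nonneg h] at ha ⊢
    exact norm_sq_sheetAmps_modeProfile_le ha hβ hθ0 hθ K c i
  · have : a ≤ -4 := by rw [abs_of_neg h] at ha; linarith
    exact norm_sq_sheetAmps_modeProfile_le_of_neg this hβ hθ0 hθ K c i

/-! ## §23 (p2 g12) K-UNIFORM H-TARGET ENTRIES BY NAME: `Transfer α β θ K t s H s′ 2100` for every input type, source shell, window and class -/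

/-- **Fresh H densities in energy form** (`|α+m| ≥ 4`, `|β| ≤ 1`, `0 ≤ θ ≤ 8`, `m ∈ win K`):
`‖hFresh α β θ K ζ m i‖² ≤ 8000·|α+m|·Σ_n ‖ζ m n‖²/((α+m)²+(β+n)²)`. -/
theorem norm_sq_hFresh_le (α : ℝ) {β : ℝ} (hβ : |β| ≤ 1) {θ : ℝ} (hθ0 : 0 ≤ θ) (hθ : θ ≤ 8) (K : ℕ) (ζ : CState) {m : ℤ} (hm : m ∈ win K)
    (ha : 4 ≤ |α + (m : ℝ)|) (i : Fin 2) :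
    ‖hFresh α β θ K ζ m i‖ ^ 2 ≤ 8000 * |α + m| * ∑ n ∈ win K, ‖ζ m n‖ ^ 2 / ((α + m) ^ 2 + (β + n) ^ 2) := by
  simp only [hFresh, if_pos hm]
  exact norm_sq_sheetAmps_modeProfile_le_abs ha hβ hθ0 hθ K (ζ m) i

/-- **The straight H pair of the fresh densities of a state, in energy form** (target shell `s′ ≥ 3`, class `(α, β)` with `β ∈ [0,1]`, level `ℓ`):
`cEnergy α β ℓ K (hPairState β (restrictShell s′ α (hFresh α β θ K ζ))) ≤ 16000(π+1)·cEnergy α β ℓ K ζ`. -/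
theorem cEnergy_hPairState_fresh_le {α β : ℝ} (hβ0 : 0 ≤ β) (hβ1 : β ≤ 1) {θ : ℝ} (hθ0 : 0 ≤ θ) (hθ : θ ≤ 8) (ℓ K : ℕ) {s' : ℕ} (hs' : 3 ≤ s')
    (ζ : CState) :
    cEnergy α β ℓ K (hPairState β (restrictShell s' α (hFresh α β θ K ζ))) ≤ 16000 * (Real.pi + 1) * cEnergy α β ℓ K ζ := by
  have hβ : |β| ≤ 1 := abs_le.2 ⟨by linarith, hβ1⟩
  have hlo : (4 : ℝ) ≤ shellLo s' := by
    obtain ⟨k, rfl⟩ : ∃ k, s' = k + 3 := ⟨s' - 3, by omega⟩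
    simp only [shellLo]
    calc (4 : ℝ) = 2 ^ 2 := by norm_num
      _ ≤ 2 ^ (k + 1 + 1) := pow_le_pow_right₀ (by norm_num) (by omega)
  set Q := restrictShell s' α (hFresh α β θ K ζ) with hQ
  -- rows: outside the shell `Q m = 0`; inside, `|α+m| ≥ 4`
  have hrow : ∀ m : ℤ, Q m = 0 ∨ (4 ≤ |α + (m : ℝ)| ∧ m ∈ win K ∧ Q m = hFresh α β θ K ζ m) := by
    intro m
    by_cases hsh : shellLo s' ≤ |α + (m : ℝ)| ∧ |α + (m : ℝ)| < shellHi s'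
    · by_cases hm : m ∈ win K
      · right; refine ⟨hlo.trans hsh.1, hm, ?_⟩; rw [hQ]; funext i; simp [restrictShell, hsh]
      · left; rw [hQ]; funext i; simp [restrictShell, hFresh, hm]
    · left; rw [hQ]; funext i; simp only [restrictShell, if_neg hsh]
  have hq0 : ∀ m ∈ win K, α + (m : ℝ) = 0 → Q m = 0 := by
    intro m _ h0
    rcases hrow m with h | ⟨h4, _, _⟩
    · exact h
    · rw [h0, abs_zero] at h4; linarith
  refine (cEnergy_hPairState_le hβ0 hβ1 α ℓ K Q hq0).trans ?_
  -- per row: `(‖Q m 0‖² + ‖Q m 1‖²)(π/|a| + 4/a²) ≤ 16000(π+1)·S_m`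
  have hc : 0 < 4 * Real.pi ^ 2 * (4 : ℝ) ^ ℓ := by positivity
  have hper : ∀ m ∈ win K, (‖Q m 0‖ ^ 2 + ‖Q m 1‖ ^ 2) * (Real.pi / |α + m| + 4 / (α + m) ^ 2) ≤
      16000 * (Real.pi + 1) * ∑ n ∈ win K, ‖ζ m n‖ ^ 2 / ((α + m) ^ 2 + (β + n) ^ 2) := by
    intro m hm
    have hS0 : 0 ≤ ∑ n ∈ win K, ‖ζ m n‖ ^ 2 / ((α + m) ^ 2 + (β + n) ^ 2) := Finset.sum_nonneg fun n _ => by positivity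
    rcases hrow m with h | ⟨h4, _, hQm⟩
    · rw [h]; simp; positivity
    · set S := ∑ n ∈ win K, ‖ζ m n‖ ^ 2 / ((α + m) ^ 2 + (β + n) ^ 2) with hS
      have ha0 : 0 < |α + (m : ℝ)| := by linarith
      have h0 : ‖Q m 0‖ ^ 2 ≤ 8000 * |α + m| * S := by rw [hQm]; exact norm_sq_hFresh_le α hβ hθ0 hθ K ζ hm h4 0
      have h1 : ‖Q m 1‖ ^ 2 ≤ 8000 * |α + m| * S := by rw [hQm]; exact norm_sq_hFresh_le α hβ hθ0 hθ K ζ hm h4 1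
      have hw : Real.pi / |α + m| + 4 / (α + m) ^ 2 ≤ (Real.pi + 1) / |α + m| := by
        rw [← sq_abs, div_add_div _ _ ha0.ne' (by positivity), div_le_div_iff₀ (by positivity) ha0]
        nlinarith [Real.pi_pos]
      have hw0 : 0 ≤ Real.pi / |α + m| + 4 / (α + m) ^ 2 := by positivity
      calc (‖Q m 0‖ ^ 2 + ‖Q m 1‖ ^ 2) * (Real.pi / |α + m| + 4 / (α + m) ^ 2)
          ≤ (2 * (8000 * |α + m| * S)) * ((Real.pi + 1) / |α + m|) := mul_le_mul (by linarith) hw hw0 (by positivity)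
        _ = 16000 * (Real.pi + 1) * S := by field_simp; ring
  calc 1 / (4 * Real.pi ^ 2 * (4 : ℝ) ^ ℓ) * ∑ m ∈ win K, (‖Q m 0‖ ^ 2 + ‖Q m 1‖ ^ 2) * (Real.pi / |α + m| + 4 / (α + m) ^ 2)
      ≤ 1 / (4 * Real.pi ^ 2 * (4 : ℝ) ^ ℓ) * ∑ m ∈ win K, 16000 * (Real.pi + 1) * ∑ n ∈ win K, ‖ζ m n‖ ^ 2 / ((α + m) ^ 2 + (β + n) ^ 2) :=
        mul_le_mul_of_nonneg_left (Finset.sum_le_sum hper) (by positivity)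
    _ = 16000 * (Real.pi + 1) * cEnergy α β ℓ K ζ := by
        unfold cEnergy
        simp only [Finset.mul_sum]
        refine Finset.sum_congr rfl fun m _ => Finset.sum_congr rfl fun n _ => ?_
        field_simp

/-- **The output H piece of one phase in energy form** (target shell `s′ ≥ 3`, strain `0 ≤ θ ≤ 8`, class `(α,β)` with `β ∈ [0,1]`):
`outEnergy α β θ K s′ (phasePieces α β θ K ζ) H ≤ (θ²+2)·16000(π+1)·cEnergy α β 1 K ζ`. -/
theorem outEnergy_H_le_cEnergy {α β : ℝ} (hβ0 : 0 ≤ β) (hβ1 : β ≤ 1) {θ : ℝ} (hθ0 : 0 ≤ θ) (hθ : θ ≤ 8) (K : ℕ) {s' : ℕ} (hs' : 3 ≤ s')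
    (ζ : CState) :
    outEnergy α β θ K s' (phasePieces α β θ K ζ) PType.H ≤ (θ ^ 2 + 2) * (16000 * (Real.pi + 1)) * cEnergy α β 1 K ζ := by
  simp only [outEnergy, outEnergyAt, phasePieces]
  refine (cEnergy_vTransport_le α β θ 1 K _).trans ?_
  rw [mul_assoc]
  exact mul_le_mul_of_nonneg_left (cEnergy_hPairState_fresh_le hβ0 hβ1 hθ0 hθ 1 K hs' ζ) (by positivity)

/-- One-coordinate re-framing: the two parities of a windowed nonnegative sequence re-index into the window. -/
theorem sum_parities_win_le (K : ℕ) (g : ℤ → ℝ) (hg0 : ∀ M, 0 ≤ g M) (hgz : ∀ M, M ∉ win K → g M = 0) :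
    ∑ p ∈ parities, ∑ m ∈ win K, g (2 * m + p) ≤ ∑ M ∈ win K, g M := by
  rw [← Finset.sum_product']
  have hinj : ∀ x ∈ parities ×ˢ win K, ∀ y ∈ parities ×ˢ win K, (fun x : ℤ × ℤ => 2 * x.2 + x.1) x = (fun x : ℤ × ℤ => 2 * x.2 + x.1) y → x = y := by
    intro x hx y hy hxy
    simp only [Finset.mem_product, parities, Finset.mem_insert, Finset.mem_singleton] at hx hy
    simp only at hxy
    ext <;> omega
  rw [← Finset.sum_image hinj]
  rw [← Finset.sum_filter_of_ne (p := fun M => M ∈ win K) (fun M _ hM => by by_contra h; exact hM (hgz M h))]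
  exact Finset.sum_le_sum_of_subset_of_nonneg (fun M hM => (Finset.mem_filter.1 hM).2) fun M _ _ => hg0 M

/-- **Re-framing does not increase energy:** the level-`ℓ+1` energies of the four children of a windowed state sum to at most its level-`ℓ` energy
(equality in fact; `≤` is what the entries need). -/
theorem sum_cEnergy_child_le (α β : ℝ) (ℓ K : ℕ) (Z : CState) (hZ : ∀ m n : ℤ, (m ∉ win K ∨ n ∉ win K) → Z m n = 0) :
    ∑ pm ∈ parities, ∑ pn ∈ parities, cEnergy ((α + pm) / 2) ((β + pn) / 2) (ℓ + 1) K (child pm pn Z) ≤ cEnergy α β ℓ K Z := by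
  set T : ℤ → ℤ → ℝ := fun M N => ‖Z M N‖ ^ 2 / (4 * Real.pi ^ 2 * (4 : ℝ) ^ ℓ * ((α + M) ^ 2 + (β + N) ^ 2)) with hT
  have hT0 : ∀ M N, 0 ≤ T M N := fun M N => by rw [hT]; positivity
  have hTz : ∀ M N, (M ∉ win K ∨ N ∉ win K) → T M N = 0 := fun M N h => by rw [hT]; simp only; rw [hZ M N h]; simp
  have hchild : ∀ pm pn : ℤ, cEnergy ((α + pm) / 2) ((β + pn) / 2) (ℓ + 1) K (child pm pn Z) =
      ∑ m ∈ win K, ∑ n ∈ win K, T (2 * m + pm) (2 * n + pn) := by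
    intro pm pn
    unfold cEnergy
    refine Finset.sum_congr rfl fun m _ => Finset.sum_congr rfl fun n _ => ?_
    rw [hT]
    simp only [child]
    congr 1
    push_cast
    ring
  simp_rw [hchild]
  -- re-index the `n` coordinate, then the `m` coordinate
  have step1 : ∀ pm ∈ parities, ∀ m ∈ win K, ∑ pn ∈ parities, ∑ n ∈ win K, T (2 * m + pm) (2 * n + pn) ≤ ∑ N ∈ win K, T (2 * m + pm) N :=
    fun pm _ m _ => sum_parities_win_le K (fun N => T (2 * m + pm) N) (fun N => hT0 _ N) (fun N hN => hTz _ N (Or.inr hN))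
  have step2 : ∀ N ∈ win K, ∑ pm ∈ parities, ∑ m ∈ win K, T (2 * m + pm) N ≤ ∑ M ∈ win K, T M N :=
    fun N _ => sum_parities_win_le K (fun M => T M N) (fun M => hT0 M N) (fun M hM => hTz M N (Or.inl hM))
  calc ∑ pm ∈ parities, ∑ pn ∈ parities, ∑ m ∈ win K, ∑ n ∈ win K, T (2 * m + pm) (2 * n + pn)
      = ∑ pm ∈ parities, ∑ m ∈ win K, ∑ pn ∈ parities, ∑ n ∈ win K, T (2 * m + pm) (2 * n + pn) := by
        refine Finset.sum_congr rfl fun pm _ => ?_; rw [Finset.sum_comm]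
    _ ≤ ∑ pm ∈ parities, ∑ m ∈ win K, ∑ N ∈ win K, T (2 * m + pm) N :=
        Finset.sum_le_sum fun pm hpm => Finset.sum_le_sum fun m hm => step1 pm hpm m hm
    _ = ∑ N ∈ win K, ∑ pm ∈ parities, ∑ m ∈ win K, T (2 * m + pm) N := by
        rw [show (∑ pm ∈ parities, ∑ m ∈ win K, ∑ N ∈ win K, T (2 * m + pm) N) =
          ∑ pm ∈ parities, ∑ N ∈ win K, ∑ m ∈ win K, T (2 * m + pm) N from Finset.sum_congr rfl fun pm _ => Finset.sum_comm,
          Finset.sum_comm]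
    _ ≤ ∑ N ∈ win K, ∑ M ∈ win K, T M N := Finset.sum_le_sum step2
    _ = cEnergy α β ℓ K Z := by rw [Finset.sum_comm]; rfl

/-- The input state of `Transfer` is windowed (both piece types). -/
theorem inputState_apply_eq_zero (α β θ : ℝ) (K : ℕ) (t : PType) (d : ℤ → Fin 2 → ℂ) (m n : ℤ) (h : m ∉ win K ∨ n ∉ win K) :
    inputState α β θ K t d m n = 0 := by
  cases t with
  | V => simp only [inputState, truncW]; rw [if_neg (by tauto)]
  | H => simp only [inputState, vTransport]; rw [if_neg (by tauto)]

/-- **K-UNIFORM H-TARGET ENTRIES BY NAME** (the `EntryBoundsW` truth for the whole H-target half of the law matrix, structure not numbers): for EVERY class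
(`α` arbitrary, `β ∈ [0,1)`), EVERY strain `0 ≤ θ ≤ 8`, EVERY window `K`, EVERY input type `t` and source shell `s`, and every target shell `s′ ≥ 3`:
`Transfer α β θ K t s H s′ 2100` (`2100² ≥ 66·16000·(π+1)`). Ingredients: the energy-form creation law (§22), the straight-pair energy, L-i-b (`θ²+2`), and
re-framing; no window condition, no `ℓ¹`/Cauchy–Schwarz over source columns. -/
theorem transfer_to_H (α : ℝ) {β : ℝ} (hβ0 : 0 ≤ β) (hβ1 : β < 1) {θ : ℝ} (hθ0 : 0 ≤ θ) (hθ : θ ≤ 8) (K : ℕ)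
    (t : PType) (s : ℕ) {s' : ℕ} (hs' : 3 ≤ s') :
    Transfer α β θ K t s PType.H s' 2100 := by
  intro d _
  set Z := inputState α β θ K t d with hZ
  have hZw : ∀ m n : ℤ, (m ∉ win K ∨ n ∉ win K) → Z m n = 0 := fun m n h => inputState_apply_eq_zero α β θ K t d m n h
  have hθ2 : (θ ^ 2 + 2) * (16000 * (Real.pi + 1)) ≤ (2100 : ℝ) ^ 2 := by
    have hπ : Real.pi < 3.1416 := Real.pi_lt_d4
    nlinarith
  have hE0 : 0 ≤ cEnergy α β 0 K Z := Finset.sum_nonneg fun _ _ => Finset.sum_nonneg fun _ _ => by positivity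
  have hchild : ∀ pm ∈ parities, ∀ pn ∈ parities,
      outEnergy ((α + pm) / 2) ((β + pn) / 2) θ K s' (phasePieces ((α + pm) / 2) ((β + pn) / 2) θ K (child pm pn Z)) PType.H ≤
        (θ ^ 2 + 2) * (16000 * (Real.pi + 1)) * cEnergy ((α + pm) / 2) ((β + pn) / 2) (0 + 1) K (child pm pn Z) := by
    intro pm _ pn hpn
    have hpn' : (pn : ℝ) = 0 ∨ (pn : ℝ) = 1 := by
      have : pn = 0 ∨ pn = 1 := by simpa [parities] using hpn
      rcases this with h | h <;> simp [h]
    have hb0 : 0 ≤ (β + pn) / 2 := by rcases hpn' with h | h <;> rw [h] <;> linarith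
    have hb1 : (β + pn) / 2 ≤ 1 := by rcases hpn' with h | h <;> rw [h] <;> linarith
    exact outEnergy_H_le_cEnergy hb0 hb1 hθ0 hθ K hs' _
  calc (∑ pm ∈ parities, ∑ pn ∈ parities,
          outEnergy ((α + pm) / 2) ((β + pn) / 2) θ K s' (phasePieces ((α + pm) / 2) ((β + pn) / 2) θ K (child pm pn Z)) PType.H)
      ≤ ∑ pm ∈ parities, ∑ pn ∈ parities, (θ ^ 2 + 2) * (16000 * (Real.pi + 1)) * cEnergy ((α + pm) / 2) ((β + pn) / 2) (0 + 1) K (child pm pn Z) :=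
        Finset.sum_le_sum fun pm hpm => Finset.sum_le_sum fun pn hpn => hchild pm hpm pn hpn
    _ = (θ ^ 2 + 2) * (16000 * (Real.pi + 1)) * ∑ pm ∈ parities, ∑ pn ∈ parities, cEnergy ((α + pm) / 2) ((β + pn) / 2) (0 + 1) K (child pm pn Z) := by
        rw [Finset.mul_sum]; refine Finset.sum_congr rfl fun pm _ => ?_; rw [Finset.mul_sum]
    _ ≤ (θ ^ 2 + 2) * (16000 * (Real.pi + 1)) * cEnergy α β 0 K Z :=
        mul_le_mul_of_nonneg_left (sum_cEnergy_child_le α β 0 K Z hZw) (by positivity)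
    _ ≤ 2100 ^ 2 * cEnergy α β 0 K Z := mul_le_mul_of_nonneg_right hθ2 hE0


/-! ## §24 (p2 g12) V→V (R-K), part 1: the NEW-ROWS DECOMPOSITION of the V-slot input and the linear split of the fresh V densities -/

/-- The created amplitudes of an EMPTY interior vanish (any family, any strain). -/
theorem sheetAmps_zero_interior (a β θ : ℝ) : sheetAmps a β θ ⟨fun _ => 0, []⟩ = 0 := by
  have hf : ∀ s : ℝ, forcing a β ⟨fun _ => 0, []⟩ s = 0 := by
    intro s
    funext j
    fin_cases j <;> simp [forcing]
  unfold sheetAmps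
  simp_rw [hf, Matrix.mulVec_zero]
  simp

/-- `modeProfile` of the zero row. -/
theorem modeProfile_zero (β : ℝ) (K : ℕ) : modeProfile β K (fun _ => (0 : ℂ)) = fun _ => 0 := by
  funext y; simp [modeProfile]

/-- `modeProfile` is additive in the coefficients. -/
theorem modeProfile_add (β : ℝ) (K : ℕ) (c₁ c₂ : ℤ → ℂ) :
    modeProfile β K (fun n => c₁ n + c₂ n) = fun y => modeProfile β K c₁ y + modeProfile β K c₂ y := by
  funext y
  simp only [modeProfile, add_mul, Finset.sum_add_distrib]

/-- `modeProfile` over a larger window equals the one over a smaller window when the coefficients vanish outside the smaller one. -/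
theorem modeProfile_window_eq {K₀ K : ℕ} (hK : K₀ ≤ K) (β : ℝ) (c : ℤ → ℂ) (hc : ∀ n, n ∉ win K₀ → c n = 0) :
    modeProfile β K c = modeProfile β K₀ c := by
  have hsub : win K₀ ⊆ win K := by intro x hx; rw [mem_win] at hx ⊢; omega
  funext y
  simp only [modeProfile]
  exact (Finset.sum_subset hsub fun n _ hn => by rw [hc n hn, zero_mul]).symm

/-- **Additivity of the created amplitudes over mode profiles** on every far line (`|a| ≥ 1`; negative lines by the conjugation symmetry). -/
theorem sheetAmps_modeProfile_add {a : ℝ} (ha : 1 ≤ |a|) (β θ : ℝ) (K : ℕ) (c₁ c₂ : ℤ → ℂ) :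
    sheetAmps a β θ ⟨modeProfile β K (fun n => c₁ n + c₂ n), []⟩ =
      sheetAmps a β θ ⟨modeProfile β K c₁, []⟩ + sheetAmps a β θ ⟨modeProfile β K c₂, []⟩ := by
  have pos : ∀ {a' : ℝ}, 1 ≤ a' → ∀ (β' : ℝ) (e₁ e₂ : ℤ → ℂ), sheetAmps a' β' θ ⟨modeProfile β' K (fun n => e₁ n + e₂ n), []⟩ =
      sheetAmps a' β' θ ⟨modeProfile β' K e₁, []⟩ + sheetAmps a' β' θ ⟨modeProfile β' K e₂, []⟩ := by
    intro a' ha' β' e₁ e₂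
    rw [sheetAmps_modeProfile ha', sheetAmps_modeProfile ha', sheetAmps_modeProfile ha', ← Finset.sum_add_distrib]
    exact Finset.sum_congr rfl fun n _ => by rw [add_smul]
  rcases le_or_gt 0 a with h | h
  · rw [abs_of_nonneg h] at ha; exact pos ha β c₁ c₂
  · rw [abs_of_neg h] at ha
    -- reflect: `c = conj ∘ c̃ ∘ neg` with `c̃ n = conj (c (−n))`
    have key : ∀ e : ℤ → ℂ, sheetAmps a β θ ⟨modeProfile β K e, []⟩ =
        star (sheetAmps (-a) (-β) θ ⟨modeProfile (-β) K (fun n => starRingEnd ℂ (e (-n))), []⟩) := by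
      intro e
      funext i
      have h1 := sheetAmps_neg_neg_modeProfile ha (-β) θ K (fun n => starRingEnd ℂ (e (-n))) i
      simp only [neg_neg, Complex.conj_conj] at h1
      rw [Pi.star_apply, Complex.star_def]
      exact h1
    rw [key, key c₁, key c₂, ← star_add]
    congr 1
    have hadd : (fun n : ℤ => starRingEnd ℂ ((fun n => c₁ n + c₂ n) (-n))) =
        fun n => (fun n => starRingEnd ℂ (c₁ (-n))) n + (fun n => starRingEnd ℂ (c₂ (-n))) n := by
      funext n; simp
    rw [hadd]
    exact pos ha (-β) _ _

section newrows

variable {α β θ : ℝ} {s : ℕ} {d : ℤ → Fin 2 → ℂ} {K₀ K : ℕ} {pm pn : ℤ}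

/-- A child row whose parent row is outside the window is the zero row. -/
theorem child_inputState_V_row_eq_zero (α β θ : ℝ) (K : ℕ) (d : ℤ → Fin 2 → ℂ) {pm pn m : ℤ} (hm : 2 * m + pm ∉ win K) :
    child pm pn (inputState α β θ K PType.V d) m = fun _ => 0 := by
  funext n
  simp only [child, inputState, truncW]
  rw [if_neg (fun h => hm h.1)]

/-- **(F1), row version, `hFresh`:** the fresh H densities of an OLD row (`2m+pm ∈ win K₀`) do not depend on the truncation. -/
theorem hFresh_child_eq_of_row (hβ0 : 0 ≤ β) (hβ1 : β < 1) (hd : SupportedIn s β d) (hK₀ : 2 ^ s + 1 ≤ K₀) (hK : K₀ ≤ K)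
    (hpn : pn ∈ parities) {m : ℤ} (hm : 2 * m + pm ∈ win K₀) (hpm : pm ∈ parities) :
    hFresh ((α + pm) / 2) ((β + pn) / 2) θ K (child pm pn (inputState α β θ K PType.V d)) m =
      hFresh ((α + pm) / 2) ((β + pn) / 2) θ K₀ (child pm pn (inputState α β θ K₀ PType.V d)) m := by
  have hpm' : pm = 0 ∨ pm = 1 := by simpa [parities] using hpm
  have hmK₀ : m ∈ win K₀ := by rw [mem_win] at hm ⊢; rcases hpm' with h | h <;> rw [h] at hm <;> omega
  have hmK : m ∈ win K := by rw [mem_win] at hmK₀ ⊢; omega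
  simp only [hFresh, if_pos hmK₀, if_pos hmK]
  rw [modeProfile_child_inputState_V_eq hβ0 hβ1 hd hK₀ hK hpn hm]

/-- **(F1), row version, `hTransport`:** the transported entries of an OLD row at a column of the small window do not depend on the truncation. -/
theorem hTransport_child_eq_of_row (hβ0 : 0 ≤ β) (hβ1 : β < 1) (hd : SupportedIn s β d) (hK₀ : 2 ^ s + 1 ≤ K₀) (hK : K₀ ≤ K)
    (hpn : pn ∈ parities) {m : ℤ} (hm : 2 * m + pm ∈ win K₀) (hpm : pm ∈ parities) {n' : ℤ} (hn' : n' ∈ win K₀) :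
    hTransport ((α + pm) / 2) ((β + pn) / 2) θ K (child pm pn (inputState α β θ K PType.V d)) m n' =
      hTransport ((α + pm) / 2) ((β + pn) / 2) θ K₀ (child pm pn (inputState α β θ K₀ PType.V d)) m n' := by
  have hpm' : pm = 0 ∨ pm = 1 := by simpa [parities] using hpm
  have hmK₀ : m ∈ win K₀ := by rw [mem_win] at hm ⊢; rcases hpm' with h | h <;> rw [h] at hm <;> omega
  have hmK : m ∈ win K := by rw [mem_win] at hmK₀ ⊢; omega
  have hn'K : n' ∈ win K := by rw [mem_win] at hn' ⊢; omega
  simp only [hTransport, if_pos (And.intro hmK hn'K), if_pos (And.intro hmK₀ hn')]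
  rw [modeProfile_child_inputState_V_eq hβ0 hβ1 hd hK₀ hK hpn hm]

/-- On a NEW row (`2m+pm ∉ win K₀`) the small truncation has no fresh H densities. -/
theorem hFresh_child_eq_zero_of_new_row (α β θ : ℝ) (K₀ : ℕ) (d : ℤ → Fin 2 → ℂ) {pm pn m : ℤ} (hm : 2 * m + pm ∉ win K₀) :
    hFresh ((α + pm) / 2) ((β + pn) / 2) θ K₀ (child pm pn (inputState α β θ K₀ PType.V d)) m = 0 := by
  unfold hFresh
  split_ifs with h
  · rw [child_inputState_V_row_eq_zero α β θ K₀ d hm, modeProfile_zero]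
    exact sheetAmps_zero_interior _ _ _
  · rfl

/-- On a NEW row the small truncation has no transported entries either. -/
theorem hTransport_child_eq_zero_of_new_row (α β θ : ℝ) (K₀ : ℕ) (d : ℤ → Fin 2 → ℂ) {pm pn m : ℤ} (hm : 2 * m + pm ∉ win K₀) (n' : ℤ) :
    hTransport ((α + pm) / 2) ((β + pn) / 2) θ K₀ (child pm pn (inputState α β θ K₀ PType.V d)) m n' = 0 := by
  unfold hTransport
  split_ifs with h
  · rw [child_inputState_V_row_eq_zero α β θ K₀ d hm, modeProfile_zero]
    simp [coeff]
  · rfl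

end newrows

/-- The V-slot input of a phase (`S = hTransport ζ + hPairState (hFresh ζ)`) as a named state, and `phasePieces.freshV = vFresh … S`. -/
theorem phasePieces_freshV (α β θ : ℝ) (K : ℕ) (ζ : CState) :
    (phasePieces α β θ K ζ).freshV = vFresh α β θ K (fun m n => hTransport α β θ K ζ m n + hPairState β (hFresh α β θ K ζ) m n) := by
  simp only [phasePieces]

/-- **(S1) THE NEW-ROWS DECOMPOSITION.** For a V source of shell `s`, child `(pm, pn)`, truncations `K₀ ≤ K` with `2^s + 1 ≤ K₀` and a column `n′ ∈ win K₀`: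
the V-slot input state at truncation `K` agrees with the one at `K₀` on every OLD row, and the one at `K₀` vanishes on every NEW row. -/
theorem vslotInput_old_row_eq {α β : ℝ} (hβ0 : 0 ≤ β) (hβ1 : β < 1) (θ : ℝ) {s : ℕ} {d : ℤ → Fin 2 → ℂ} (hd : SupportedIn s β d)
    {K₀ K : ℕ} (hK₀ : 2 ^ s + 1 ≤ K₀) (hK : K₀ ≤ K) {pm pn : ℤ} (hpm : pm ∈ parities) (hpn : pn ∈ parities) {m : ℤ}
    (hm : 2 * m + pm ∈ win K₀) {n' : ℤ} (hn' : n' ∈ win K₀) :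
    hTransport ((α + pm) / 2) ((β + pn) / 2) θ K (child pm pn (inputState α β θ K PType.V d)) m n' +
        hPairState ((β + pn) / 2) (hFresh ((α + pm) / 2) ((β + pn) / 2) θ K (child pm pn (inputState α β θ K PType.V d))) m n' =
      hTransport ((α + pm) / 2) ((β + pn) / 2) θ K₀ (child pm pn (inputState α β θ K₀ PType.V d)) m n' +
        hPairState ((β + pn) / 2) (hFresh ((α + pm) / 2) ((β + pn) / 2) θ K₀ (child pm pn (inputState α β θ K₀ PType.V d))) m n' := by
  rw [hTransport_child_eq_of_row hβ0 hβ1 hd hK₀ hK hpn hm hpm hn']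
  simp only [hPairState]
  rw [hFresh_child_eq_of_row hβ0 hβ1 hd hK₀ hK hpn hm hpm]

theorem vslotInput_new_row_eq_zero (α β θ : ℝ) (K₀ : ℕ) (d : ℤ → Fin 2 → ℂ) {pm pn m : ℤ} (hm : 2 * m + pm ∉ win K₀) (n' : ℤ) :
    hTransport ((α + pm) / 2) ((β + pn) / 2) θ K₀ (child pm pn (inputState α β θ K₀ PType.V d)) m n' +
        hPairState ((β + pn) / 2) (hFresh ((α + pm) / 2) ((β + pn) / 2) θ K₀ (child pm pn (inputState α β θ K₀ PType.V d))) m n' = 0 := by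
  rw [hTransport_child_eq_zero_of_new_row α β θ K₀ d hm n']
  simp only [hPairState, hFresh_child_eq_zero_of_new_row α β θ K₀ d hm, Pi.zero_apply, zero_mul, add_zero]

/-- **(S2) THE LINEAR SPLIT OF THE FRESH V DENSITIES.** With `S_K`, `S_{K₀}` the V-slot inputs at the two truncations and `N := S_K − S_{K₀}` (supported on the new
rows by (S1): `vslotInput_old_row_eq`), for every target column `n′ ∈ win K₀` on a far line (`|β′ + n′| ≥ 1`):
`vFresh … K S_K n′ = vFresh … K₀ S_{K₀} n′ + sheetAmps (β′+n′) α′ θ ⟨modeProfile α′ K (N(·,n′)), []⟩`. -/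
theorem vFresh_trunc_split (α β θ : ℝ) (d : ℤ → Fin 2 → ℂ) {K₀ K : ℕ} (hK : K₀ ≤ K) {pm : ℤ} (hpm : pm ∈ parities) (pn : ℤ)
    {n' : ℤ} (hn' : n' ∈ win K₀) (hb : 1 ≤ |(β + pn) / 2 + (n' : ℝ)|) :
    vFresh ((α + pm) / 2) ((β + pn) / 2) θ K
        (fun m n => hTransport ((α + pm) / 2) ((β + pn) / 2) θ K (child pm pn (inputState α β θ K PType.V d)) m n +
          hPairState ((β + pn) / 2) (hFresh ((α + pm) / 2) ((β + pn) / 2) θ K (child pm pn (inputState α β θ K PType.V d))) m n) n' =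
      vFresh ((α + pm) / 2) ((β + pn) / 2) θ K₀
        (fun m n => hTransport ((α + pm) / 2) ((β + pn) / 2) θ K₀ (child pm pn (inputState α β θ K₀ PType.V d)) m n +
          hPairState ((β + pn) / 2) (hFresh ((α + pm) / 2) ((β + pn) / 2) θ K₀ (child pm pn (inputState α β θ K₀ PType.V d))) m n) n' +
      sheetAmps ((β + pn) / 2 + n') ((α + pm) / 2) θ
        ⟨modeProfile ((α + pm) / 2) K (fun m =>
          (hTransport ((α + pm) / 2) ((β + pn) / 2) θ K (child pm pn (inputState α β θ K PType.V d)) m n' +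
            hPairState ((β + pn) / 2) (hFresh ((α + pm) / 2) ((β + pn) / 2) θ K (child pm pn (inputState α β θ K PType.V d))) m n') -
          (hTransport ((α + pm) / 2) ((β + pn) / 2) θ K₀ (child pm pn (inputState α β θ K₀ PType.V d)) m n' +
            hPairState ((β + pn) / 2) (hFresh ((α + pm) / 2) ((β + pn) / 2) θ K₀ (child pm pn (inputState α β θ K₀ PType.V d))) m n')), []⟩ := by
  have hn'K : n' ∈ win K := by rw [mem_win] at hn' ⊢; omega
  simp only [vFresh, if_pos hn'K, if_pos hn']
  -- abbreviate the two V-slot input columns and their difference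
  set SK : ℤ → ℂ := fun m => hTransport ((α + pm) / 2) ((β + pn) / 2) θ K (child pm pn (inputState α β θ K PType.V d)) m n' +
    hPairState ((β + pn) / 2) (hFresh ((α + pm) / 2) ((β + pn) / 2) θ K (child pm pn (inputState α β θ K PType.V d))) m n' with hSK
  set S0 : ℤ → ℂ := fun m => hTransport ((α + pm) / 2) ((β + pn) / 2) θ K₀ (child pm pn (inputState α β θ K₀ PType.V d)) m n' +
    hPairState ((β + pn) / 2) (hFresh ((α + pm) / 2) ((β + pn) / 2) θ K₀ (child pm pn (inputState α β θ K₀ PType.V d))) m n' with hS0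
  set N : ℤ → ℂ := fun m =>
    (hTransport ((α + pm) / 2) ((β + pn) / 2) θ K (child pm pn (inputState α β θ K PType.V d)) m n' +
      hPairState ((β + pn) / 2) (hFresh ((α + pm) / 2) ((β + pn) / 2) θ K (child pm pn (inputState α β θ K PType.V d))) m n') -
    (hTransport ((α + pm) / 2) ((β + pn) / 2) θ K₀ (child pm pn (inputState α β θ K₀ PType.V d)) m n' +
      hPairState ((β + pn) / 2) (hFresh ((α + pm) / 2) ((β + pn) / 2) θ K₀ (child pm pn (inputState α β θ K₀ PType.V d))) m n') with hN
  have hS0z : ∀ m, m ∉ win K₀ → S0 m = 0 := by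
    intro m hm
    rw [hS0]
    simp only
    have h2m : 2 * m + pm ∉ win K₀ := by
      have hpm' : pm = 0 ∨ pm = 1 := by simpa [parities] using hpm
      rw [mem_win] at hm ⊢; rcases hpm' with h | h <;> rw [h] <;> omega
    exact vslotInput_new_row_eq_zero α β θ K₀ d h2m n'
  -- `S_K = S_0 + N` as coefficient rows
  have hsplit : SK = fun m => S0 m + N m := by
    funext m; simp only [hSK, hS0, hN]; ring
  rw [hsplit, sheetAmps_modeProfile_add hb, modeProfile_window_eq hK _ S0 hS0z]

/-! ## §24, part 2 (S3): the tail of the fresh V densities by the ENERGY-FORM law — only `ℓ²` summability of the new rows is needed -/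

/-- One row of `hTransport`, inside the window, is the transport coefficient of the row profile. -/
theorem hTransport_apply_of_mem (α β θ : ℝ) (K : ℕ) (ζ : CState) {m n' : ℤ} (hm : m ∈ win K) (hn' : n' ∈ win K) :
    hTransport α β θ K ζ m n' = ∫ y in (-(1 / 2 : ℝ))..(1 / 2),
      ((∑ n ∈ win K, ζ m n * Complex.exp ((2 * Real.pi * (β + n) * y : ℝ) * Complex.I)) *
        Complex.exp (-((2 * Real.pi * (α + m) * θ * triWave y : ℝ) : ℂ) * Complex.I)) * Complex.exp (-(2 * Real.pi * (β + n') * y : ℝ) * Complex.I) := by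
  simp only [hTransport, if_pos (And.intro hm hn'), coeff, modeProfile, transportPhase, List.map_nil, List.sum_nil, add_zero]


/-- **Bessel per row.** `Σ_{n′ ∈ S} ‖hTransport … K ζ m n′‖² ≤ Σ_{n ∈ win K} ‖ζ m n‖²` (the transport phase is unimodular; Parseval for the row profile). -/
theorem sum_norm_sq_hTransport_row_le (α β θ : ℝ) (K : ℕ) (ζ : CState) (m : ℤ) (S : Finset ℤ) (hS : S ⊆ win K) :
    ∑ n' ∈ S, ‖hTransport α β θ K ζ m n'‖ ^ 2 ≤ ∑ n ∈ win K, ‖ζ m n‖ ^ 2 := by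
  by_cases hm : m ∈ win K
  · set g : ℝ → ℂ := fun y => (∑ n ∈ win K, ζ m n * Complex.exp ((2 * Real.pi * (β + n) * y : ℝ) * Complex.I)) *
      Complex.exp (-((2 * Real.pi * (α + m) * θ * triWave y : ℝ) : ℂ) * Complex.I) with hg
    have hgc : Continuous g := by
      rw [hg]; exact (continuous_blochPoly β (win K) (fun n => ζ m n)).mul (continuous_transportPhase (α + m) θ)
    have hrow : ∀ n' ∈ S, hTransport α β θ K ζ m n' = ∫ y in (-(1 / 2 : ℝ))..(1 / 2), g y * Complex.exp (-(2 * Real.pi * (β + n') * y : ℝ) * Complex.I) := by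
      intro n' hn'
      rw [hTransport_apply_of_mem α β θ K ζ hm (hS hn'), hg]
    rw [Finset.sum_congr rfl fun n' hn' => by rw [hrow n' hn']]
    refine (sum_le_hasSum S (fun n' _ => by positivity) (hasSum_sq_coeff hgc β)).trans (le_of_eq ?_)
    have e : ∀ y : ℝ, ‖g y‖ ^ 2 = ‖∑ n ∈ win K, ζ m n * Complex.exp ((2 * Real.pi * (β + n) * y : ℝ) * Complex.I)‖ ^ 2 := by
      intro y
      rw [hg]
      simp only
      rw [norm_mul, show -((2 * Real.pi * (α + m) * θ * triWave y : ℝ) : ℂ) * Complex.I =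
        ((-(2 * Real.pi * (α + m) * θ * triWave y) : ℝ) : ℂ) * Complex.I by push_cast; ring, Complex.norm_exp_ofReal_mul_I, mul_one]
    simp_rw [e]
    exact integral_norm_sq_blochPoly β (win K) (fun n => ζ m n)
  · have h0 : ∀ n' ∈ S, hTransport α β θ K ζ m n' = 0 := fun n' _ => by
      unfold hTransport; rw [if_neg (fun h => hm h.1)]
    rw [Finset.sum_congr rfl fun n' hn' => by rw [h0 n' hn']]
    simp only [norm_zero, ne_eq, OfNat.ofNat_ne_zero, not_false_eq_true, zero_pow, Finset.sum_const_zero]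
    exact Finset.sum_nonneg fun _ _ => by positivity

/-- One transported entry is at most the `ℓ²` size of its row. -/
theorem norm_sq_hTransport_le_row (α β θ : ℝ) (K : ℕ) (ζ : CState) (m n' : ℤ) :
    ‖hTransport α β θ K ζ m n'‖ ^ 2 ≤ ∑ n ∈ win K, ‖ζ m n‖ ^ 2 := by
  by_cases hn' : n' ∈ win K
  · have h := sum_norm_sq_hTransport_row_le α β θ K ζ m {n'} (Finset.singleton_subset_iff.2 hn')
    rwa [Finset.sum_singleton] at h
  · have : hTransport α β θ K ζ m n' = 0 := by unfold hTransport; rw [if_neg (fun h => hn' h.2)]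
    rw [this, norm_zero]
    simp only [ne_eq, OfNat.ofNat_ne_zero, not_false_eq_true, zero_pow]
    exact Finset.sum_nonneg fun _ _ => by positivity

section tail

/-- The squared `ℓ²` size of one row of the child is at most twice that of the source densities (which vanish off the window). -/
theorem sum_norm_sq_child_inputState_V_le (α β θ : ℝ) (K : ℕ) (d : ℤ → Fin 2 → ℂ) (hdW : ∀ k : ℤ, k ∉ win K → d k = 0) (pm pn m : ℤ) :
    ∑ n ∈ win K, ‖child pm pn (inputState α β θ K PType.V d) m n‖ ^ 2 ≤ 2 * ∑ k ∈ win K, (‖d k 0‖ ^ 2 + ‖d k 1‖ ^ 2) := by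
  have hpt : ∀ n ∈ win K, ‖child pm pn (inputState α β θ K PType.V d) m n‖ ^ 2 ≤ 2 * (‖d (2 * n + pn) 0‖ ^ 2 + ‖d (2 * n + pn) 1‖ ^ 2) := by
    intro n _
    have h := norm_child_inputState_V_le α β θ K d pm pn m n
    have h0 : 0 ≤ ‖child pm pn (inputState α β θ K PType.V d) m n‖ := norm_nonneg _
    nlinarith [sq_nonneg (‖d (2 * n + pn) 0‖ - ‖d (2 * n + pn) 1‖), norm_nonneg (d (2 * n + pn) 0), norm_nonneg (d (2 * n + pn) 1)]
  refine (Finset.sum_le_sum hpt).trans ?_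
  rw [← Finset.mul_sum]
  refine mul_le_mul_of_nonneg_left ?_ (by norm_num)
  have hz : ∀ n ∈ win K, 2 * n + pn ∉ win K → ‖d (2 * n + pn) 0‖ ^ 2 + ‖d (2 * n + pn) 1‖ ^ 2 = 0 := by
    intro n _ hn; simp [hdW _ hn]
  rw [← Finset.sum_filter_add_sum_filter_not (win K) (fun n : ℤ => 2 * n + pn ∈ win K)]
  rw [Finset.sum_eq_zero (s := (win K).filter fun n : ℤ => ¬ 2 * n + pn ∈ win K) (fun n hn => hz n (Finset.mem_filter.1 hn).1 (Finset.mem_filter.1 hn).2),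
    add_zero]
  rw [← Finset.sum_image (s := (win K).filter fun n : ℤ => 2 * n + pn ∈ win K) (g := fun n : ℤ => 2 * n + pn)
    (f := fun k : ℤ => ‖d k 0‖ ^ 2 + ‖d k 1‖ ^ 2) (fun x _ y _ h => by simpa using h)]
  refine Finset.sum_le_sum_of_subset_of_nonneg ?_ (fun k _ _ => by positivity)
  intro k hk
  obtain ⟨n, hn, rfl⟩ := Finset.mem_image.1 hk
  exact (Finset.mem_filter.1 hn).2

/-- **(S3a) Size of the V-slot input on a FAR row** (`|α′+m| ≥ 4`, `m ∈ win K`, `β′ = (β+pn)/2` with `|β′| ≤ 1`, `0 ≤ θ ≤ 8`):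
`‖S_K(m,n′)‖² ≤ (6 + 96000/|α′+m|)·D₂`, `D₂ = Σ_k (‖d k 0‖² + ‖d k 1‖²)` — Bessel for the transported part, the ENERGY-FORM law for the fresh H pair. -/
theorem norm_sq_vslotInput_far_row_le (α : ℝ) {β : ℝ} (hβ0 : 0 ≤ β) (hβ1 : β < 1) {θ : ℝ} (hθ0 : 0 ≤ θ) (hθ : θ ≤ 8) (K : ℕ)
    (d : ℤ → Fin 2 → ℂ) (hdW : ∀ k : ℤ, k ∉ win K → d k = 0) (pm : ℤ) {pn : ℤ} (hpn : pn ∈ parities) {m : ℤ} (hm : m ∈ win K)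
    (ha : 4 ≤ |(α + pm) / 2 + (m : ℝ)|) (n' : ℤ) :
    ‖hTransport ((α + pm) / 2) ((β + pn) / 2) θ K (child pm pn (inputState α β θ K PType.V d)) m n' +
        hPairState ((β + pn) / 2) (hFresh ((α + pm) / 2) ((β + pn) / 2) θ K (child pm pn (inputState α β θ K PType.V d))) m n'‖ ^ 2 ≤
      (6 + 96000 / |(α + pm) / 2 + (m : ℝ)|) * ∑ k ∈ win K, (‖d k 0‖ ^ 2 + ‖d k 1‖ ^ 2) := by
  set ζ' := child pm pn (inputState α β θ K PType.V d) with hζ'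
  set a : ℝ := (α + pm) / 2 + (m : ℝ) with ha_def
  set D₂ : ℝ := ∑ k ∈ win K, (‖d k 0‖ ^ 2 + ‖d k 1‖ ^ 2) with hD₂
  have hD₂0 : 0 ≤ D₂ := Finset.sum_nonneg fun _ _ => by positivity
  have ha0 : 0 < |a| := by linarith
  have hpn' : (pn : ℝ) = 0 ∨ (pn : ℝ) = 1 := by
    have : pn = 0 ∨ pn = 1 := by simpa [parities] using hpn
    rcases this with h | h <;> simp [h]
  have hβ' : |(β + pn) / 2| ≤ 1 := by rw [abs_le]; rcases hpn' with h | h <;> rw [h] <;> constructor <;> linarith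
  have hrow : ∑ n ∈ win K, ‖ζ' m n‖ ^ 2 ≤ 2 * D₂ := sum_norm_sq_child_inputState_V_le α β θ K d hdW pm pn m
  have hane : a ≠ 0 := abs_pos.mp ha0
  have ha2 : 0 < a ^ 2 := by positivity
  -- transported part (Bessel)
  have hT : ‖hTransport ((α + pm) / 2) ((β + pn) / 2) θ K ζ' m n'‖ ^ 2 ≤ 2 * D₂ :=
    (norm_sq_hTransport_le_row _ _ θ K ζ' m n').trans hrow
  -- fresh part (energy-form law, then the crude weight `1/(a²+ξ²) ≤ 1/a²`)
  have hF : ∀ i : Fin 2, ‖hFresh ((α + pm) / 2) ((β + pn) / 2) θ K ζ' m i‖ ^ 2 ≤ 16000 * D₂ / |a| := by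
    intro i
    refine (norm_sq_hFresh_le _ hβ' hθ0 hθ K ζ' hm ha i).trans ?_
    have hsum : ∑ n ∈ win K, ‖ζ' m n‖ ^ 2 / (a ^ 2 + ((β + pn) / 2 + n) ^ 2) ≤ (2 * D₂) / a ^ 2 := by
      calc ∑ n ∈ win K, ‖ζ' m n‖ ^ 2 / (a ^ 2 + ((β + pn) / 2 + n) ^ 2) ≤ ∑ n ∈ win K, ‖ζ' m n‖ ^ 2 / a ^ 2 :=
            Finset.sum_le_sum fun n _ => div_le_div_of_nonneg_left (by positivity) ha2
              (by nlinarith [sq_nonneg ((β + pn) / 2 + (n : ℝ))])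
        _ = (∑ n ∈ win K, ‖ζ' m n‖ ^ 2) / a ^ 2 := by rw [Finset.sum_div]
        _ ≤ (2 * D₂) / a ^ 2 := div_le_div_of_nonneg_right hrow (by positivity)
    calc 8000 * |a| * ∑ n ∈ win K, ‖ζ' m n‖ ^ 2 / (a ^ 2 + ((β + pn) / 2 + n) ^ 2) ≤ 8000 * |a| * ((2 * D₂) / a ^ 2) :=
          mul_le_mul_of_nonneg_left hsum (by positivity)
      _ = 16000 * D₂ / |a| := by rw [← sq_abs]; field_simp; ring
  have hZ : ‖hPairState ((β + pn) / 2) (hFresh ((α + pm) / 2) ((β + pn) / 2) θ K ζ') m n'‖ ≤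
      ‖hFresh ((α + pm) / 2) ((β + pn) / 2) θ K ζ' m 0‖ + ‖hFresh ((α + pm) / 2) ((β + pn) / 2) θ K ζ' m 1‖ := by
    simp only [hPairState]
    refine (norm_add_le _ _).trans (le_of_eq ?_)
    rw [norm_mul, norm_mul, show -((Real.pi * ((β + pn) / 2 + n') / 2 : ℝ) : ℂ) * Complex.I = ((-(Real.pi * ((β + pn) / 2 + n') / 2) : ℝ) : ℂ) * Complex.I by push_cast; ring,
      Complex.norm_exp_ofReal_mul_I, Complex.norm_exp_ofReal_mul_I, mul_one, mul_one]
  -- `(T + Z)² ≤ 3(T² + h₀² + h₁²)`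
  have h3 : ∀ x y z : ℝ, (x + (y + z)) ^ 2 ≤ 3 * (x ^ 2 + y ^ 2 + z ^ 2) := fun x y z => by
    nlinarith [sq_nonneg (x - y), sq_nonneg (y - z), sq_nonneg (x - z)]
  have hsum := norm_add_le (hTransport ((α + pm) / 2) ((β + pn) / 2) θ K ζ' m n') (hPairState ((β + pn) / 2) (hFresh ((α + pm) / 2) ((β + pn) / 2) θ K ζ') m n')
  have hx0 := norm_nonneg (hTransport ((α + pm) / 2) ((β + pn) / 2) θ K ζ' m n')
  calc ‖hTransport ((α + pm) / 2) ((β + pn) / 2) θ K ζ' m n' + hPairState ((β + pn) / 2) (hFresh ((α + pm) / 2) ((β + pn) / 2) θ K ζ') m n'‖ ^ 2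
      ≤ (‖hTransport ((α + pm) / 2) ((β + pn) / 2) θ K ζ' m n'‖ +
          (‖hFresh ((α + pm) / 2) ((β + pn) / 2) θ K ζ' m 0‖ + ‖hFresh ((α + pm) / 2) ((β + pn) / 2) θ K ζ' m 1‖)) ^ 2 :=
        pow_le_pow_left₀ (norm_nonneg _) (hsum.trans (add_le_add le_rfl hZ)) 2
    _ ≤ 3 * (‖hTransport ((α + pm) / 2) ((β + pn) / 2) θ K ζ' m n'‖ ^ 2 + ‖hFresh ((α + pm) / 2) ((β + pn) / 2) θ K ζ' m 0‖ ^ 2 +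
          ‖hFresh ((α + pm) / 2) ((β + pn) / 2) θ K ζ' m 1‖ ^ 2) := h3 _ _ _
    _ ≤ 3 * (2 * D₂ + 16000 * D₂ / |a| + 16000 * D₂ / |a|) := by
        refine mul_le_mul_of_nonneg_left (add_le_add (add_le_add hT (hF 0)) (hF 1)) (by norm_num)
    _ = (6 + 96000 / |a|) * D₂ := by field_simp; ring

end tail

section tailsum

/-- **(S3b) The weight of ONE row of the difference `N = S_K − S_{K₀}`** (zero on the old rows `|m| ≤ K₀′`, `2K₀′+1 ≤ K₀`; on a new row the far-row size (S3a)
with `|α′+m| ≥ |m| − 1 ≥ K₀′ ≥ 4` and the weight `1/(b² + (α′+m)²) ≤ 1/(|m|−1)²`). -/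
theorem norm_sq_vslotDiff_div_le {α β : ℝ} (hα0 : 0 ≤ α) (hα1 : α < 1) (hβ0 : 0 ≤ β) (hβ1 : β < 1) {θ : ℝ} (hθ0 : 0 ≤ θ) (hθ : θ ≤ 8)
    {s : ℕ} {d : ℤ → Fin 2 → ℂ} (hd : SupportedIn s β d) {K₀ K K₀' : ℕ} (hK₀ : 2 ^ s + 1 ≤ K₀) (hK : K₀ ≤ K)
    (hdW : ∀ k : ℤ, k ∉ win K → d k = 0) (hK₀'4 : 4 ≤ K₀') (hK₀' : 2 * K₀' + 1 ≤ K₀)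
    {pm pn : ℤ} (hpm : pm ∈ parities) (hpn : pn ∈ parities) {n' : ℤ} (hn' : n' ∈ win K₀) (b : ℝ) {m : ℤ} (hm : m ∈ win K) :
    ‖(hTransport ((α + pm) / 2) ((β + pn) / 2) θ K (child pm pn (inputState α β θ K PType.V d)) m n' + hPairState ((β + pn) / 2) (hFresh ((α + pm) / 2) ((β + pn) / 2) θ K (child pm pn (inputState α β θ K PType.V d))) m n') -
        (hTransport ((α + pm) / 2) ((β + pn) / 2) θ K₀ (child pm pn (inputState α β θ K₀ PType.V d)) m n' + hPairState ((β + pn) / 2) (hFresh ((α + pm) / 2) ((β + pn) / 2) θ K₀ (child pm pn (inputState α β θ K₀ PType.V d))) m n')‖ ^ 2 / (b ^ 2 + ((α + pm) / 2 + m) ^ 2) ≤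
      if m ∈ win K₀' then (0 : ℝ) else (6 + 96000 / (K₀' : ℝ)) * (∑ k ∈ win K, (‖d k 0‖ ^ 2 + ‖d k 1‖ ^ 2)) * (1 / ((|(m : ℝ)| - 1) ^ 2)) := by
  have hpm' : pm = 0 ∨ pm = 1 := by simpa [parities] using hpm
  have hpmr : (pm : ℝ) = 0 ∨ (pm : ℝ) = 1 := by rcases hpm' with h | h <;> simp [h]
  have hD0 : 0 ≤ (∑ k ∈ win K, (‖d k 0‖ ^ 2 + ‖d k 1‖ ^ 2)) := Finset.sum_nonneg fun _ _ => by positivity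
  have hK₀'r : (4 : ℝ) ≤ K₀' := by exact_mod_cast hK₀'4
  split_ifs with hm0
  · have hold : 2 * m + pm ∈ win K₀ := by
      rw [mem_win] at hm0 ⊢; rcases hpm' with h | h <;> rw [h] <;> omega
    rw [vslotInput_old_row_eq hβ0 hβ1 θ hd hK₀ hK hpm hpn hold hn', sub_self, norm_zero]
    simp
  · by_cases hold : 2 * m + pm ∈ win K₀
    · rw [vslotInput_old_row_eq hβ0 hβ1 θ hd hK₀ hK hpm hpn hold hn', sub_self, norm_zero]
      simp only [ne_eq, OfNat.ofNat_ne_zero, not_false_eq_true, zero_pow, zero_div]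
      positivity
    · rw [vslotInput_new_row_eq_zero α β θ K₀ d hold n', sub_zero]
      rw [mem_win, not_and_or, not_le, not_le] at hm0
      have hm1 : (K₀' : ℝ) + 1 ≤ |(m : ℝ)| := by
        rcases hm0 with h | h
        · have : (m : ℝ) ≤ -(K₀' : ℝ) - 1 := by exact_mod_cast (show m ≤ -(K₀' : ℤ) - 1 by omega)
          rw [abs_of_neg (by linarith)]; linarith
        · have : (K₀' : ℝ) + 1 ≤ m := by exact_mod_cast (show (K₀' : ℤ) + 1 ≤ m by omega)
          rw [abs_of_pos (by linarith)]; linarith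
      have ha1 : |(m : ℝ)| - 1 ≤ |(α + pm) / 2 + m| := by
        have h1 := abs_add_le ((α + pm) / 2 + m) (-((α + pm) / 2))
        have h2 : |(-((α + pm) / 2))| ≤ 1 := by rw [abs_neg, abs_le]; rcases hpmr with h | h <;> rw [h] <;> constructor <;> linarith
        rw [show (α + pm) / 2 + (m : ℝ) + -((α + pm) / 2) = m by ring] at h1
        linarith
      have ha : (K₀' : ℝ) ≤ |(α + pm) / 2 + m| := by linarith
      have ha4 : 4 ≤ |(α + pm) / 2 + (m : ℝ)| := le_trans hK₀'r ha
      have hS := norm_sq_vslotInput_far_row_le α hβ0 hβ1 hθ0 hθ K d hdW pm hpn hm ha4 n'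
      have hC : (6 + 96000 / |(α + pm) / 2 + (m : ℝ)|) * (∑ k ∈ win K, (‖d k 0‖ ^ 2 + ‖d k 1‖ ^ 2)) ≤
          (6 + 96000 / (K₀' : ℝ)) * (∑ k ∈ win K, (‖d k 0‖ ^ 2 + ‖d k 1‖ ^ 2)) :=
        mul_le_mul_of_nonneg_right (by
          have := div_le_div_of_nonneg_left (by norm_num : (0 : ℝ) ≤ 96000) (by linarith : (0 : ℝ) < K₀') ha
          linarith) hD0
      have hpos : 0 < |(m : ℝ)| - 1 := by linarith
      have hw : 1 / (b ^ 2 + ((α + pm) / 2 + m) ^ 2) ≤ 1 / ((|(m : ℝ)| - 1) ^ 2) := by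
        refine one_div_le_one_div_of_le (by positivity) ?_
        calc (|(m : ℝ)| - 1) ^ 2 ≤ |(α + pm) / 2 + m| ^ 2 := pow_le_pow_left₀ hpos.le ha1 2
          _ = ((α + pm) / 2 + m) ^ 2 := sq_abs _
          _ ≤ b ^ 2 + ((α + pm) / 2 + m) ^ 2 := by nlinarith [sq_nonneg b]
      rw [div_eq_mul_one_div]
      exact mul_le_mul (hS.trans hC) hw (by positivity) (by positivity)

/-- **(S3c) The weighted `ℓ²` size of the difference profile:** `Σ_{m ∈ win K} ‖N(m)‖²/(b² + (α′+m)²) ≤ (6 + 96000/K₀′)·D₂·2/(K₀′−1)`. -/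
theorem sum_norm_sq_vslotDiff_div_le {α β : ℝ} (hα0 : 0 ≤ α) (hα1 : α < 1) (hβ0 : 0 ≤ β) (hβ1 : β < 1) {θ : ℝ} (hθ0 : 0 ≤ θ) (hθ : θ ≤ 8)
    {s : ℕ} {d : ℤ → Fin 2 → ℂ} (hd : SupportedIn s β d) {K₀ K K₀' : ℕ} (hK₀ : 2 ^ s + 1 ≤ K₀) (hK : K₀ ≤ K)
    (hdW : ∀ k : ℤ, k ∉ win K → d k = 0) (hK₀'4 : 4 ≤ K₀') (hK₀' : 2 * K₀' + 1 ≤ K₀)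
    {pm pn : ℤ} (hpm : pm ∈ parities) (hpn : pn ∈ parities) {n' : ℤ} (hn' : n' ∈ win K₀) (b : ℝ) :
    ∑ m ∈ win K, ‖(hTransport ((α + pm) / 2) ((β + pn) / 2) θ K (child pm pn (inputState α β θ K PType.V d)) m n' + hPairState ((β + pn) / 2) (hFresh ((α + pm) / 2) ((β + pn) / 2) θ K (child pm pn (inputState α β θ K PType.V d))) m n') -
        (hTransport ((α + pm) / 2) ((β + pn) / 2) θ K₀ (child pm pn (inputState α β θ K₀ PType.V d)) m n' + hPairState ((β + pn) / 2) (hFresh ((α + pm) / 2) ((β + pn) / 2) θ K₀ (child pm pn (inputState α β θ K₀ PType.V d))) m n')‖ ^ 2 / (b ^ 2 + ((α + pm) / 2 + m) ^ 2) ≤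
      (6 + 96000 / (K₀' : ℝ)) * (∑ k ∈ win K, (‖d k 0‖ ^ 2 + ‖d k 1‖ ^ 2)) * (2 / ((K₀' : ℝ) - 1)) := by
  refine (Finset.sum_le_sum fun m hm => norm_sq_vslotDiff_div_le hα0 hα1 hβ0 hβ1 hθ0 hθ hd hK₀ hK hdW hK₀'4 hK₀' hpm hpn hn' b hm).trans ?_
  set C : ℝ := (6 + 96000 / (K₀' : ℝ)) * (∑ k ∈ win K, (‖d k 0‖ ^ 2 + ‖d k 1‖ ^ 2)) with hC
  have hC0 : 0 ≤ C := by rw [hC]; exact mul_nonneg (by positivity) (Finset.sum_nonneg fun _ _ => by positivity)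
  rw [Finset.sum_congr rfl fun m _ => show (if m ∈ win K₀' then (0 : ℝ) else C * (1 / ((|(m : ℝ)| - 1) ^ 2))) =
      C * (if m ∈ win K₀' then (0 : ℝ) else 1 / ((|(m : ℝ)| - 1) ^ 2)) by split_ifs <;> simp, ← Finset.mul_sum]
  have hK₀'2 : 2 ≤ K₀' := by omega
  have hK₀'K : K₀' ≤ K := by omega
  refine mul_le_mul_of_nonneg_left ((sum_win_tail_inv_sq_le hK₀'2 hK₀'K).trans ?_) hC0
  have : 0 ≤ 2 / ((K : ℝ) - 1) := by
    have : (2 : ℝ) ≤ K := by exact_mod_cast hK₀'2.trans hK₀'K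
    exact div_nonneg (by norm_num) (by linarith)
  linarith

/-- **(S3) THE TRUNCATION TAIL OF THE FRESH V DENSITIES** on a target column `n′ ∈ win K₀` with `|β′+n′| ≥ 4`:
`‖δ_i(n′)‖² ≤ 8000|β′+n′|·(6 + 96000/K₀′)·D₂·2/(K₀′−1)` — the energy-form law (§22) on the new-row difference profile; only the rows' `ℓ²` size is used. -/
theorem norm_sq_vFresh_trunc_tail_le {α β : ℝ} (hα0 : 0 ≤ α) (hα1 : α < 1) (hβ0 : 0 ≤ β) (hβ1 : β < 1) {θ : ℝ} (hθ0 : 0 ≤ θ) (hθ : θ ≤ 8)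
    {s : ℕ} {d : ℤ → Fin 2 → ℂ} (hd : SupportedIn s β d) {K₀ K K₀' : ℕ} (hK₀ : 2 ^ s + 1 ≤ K₀) (hK : K₀ ≤ K)
    (hdW : ∀ k : ℤ, k ∉ win K → d k = 0) (hK₀'4 : 4 ≤ K₀') (hK₀' : 2 * K₀' + 1 ≤ K₀)
    {pm pn : ℤ} (hpm : pm ∈ parities) (hpn : pn ∈ parities) {n' : ℤ} (hn' : n' ∈ win K₀)
    (hb : 4 ≤ |(β + pn) / 2 + (n' : ℝ)|) (i : Fin 2) :
    ‖sheetAmps ((β + pn) / 2 + n') ((α + pm) / 2) θ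
        ⟨modeProfile ((α + pm) / 2) K (fun m =>
          (hTransport ((α + pm) / 2) ((β + pn) / 2) θ K (child pm pn (inputState α β θ K PType.V d)) m n' + hPairState ((β + pn) / 2) (hFresh ((α + pm) / 2) ((β + pn) / 2) θ K (child pm pn (inputState α β θ K PType.V d))) m n') -
          (hTransport ((α + pm) / 2) ((β + pn) / 2) θ K₀ (child pm pn (inputState α β θ K₀ PType.V d)) m n' + hPairState ((β + pn) / 2) (hFresh ((α + pm) / 2) ((β + pn) / 2) θ K₀ (child pm pn (inputState α β θ K₀ PType.V d))) m n')), []⟩ i‖ ^ 2 ≤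
      8000 * |(β + pn) / 2 + (n' : ℝ)| * ((6 + 96000 / (K₀' : ℝ)) * (∑ k ∈ win K, (‖d k 0‖ ^ 2 + ‖d k 1‖ ^ 2)) * (2 / ((K₀' : ℝ) - 1))) := by
  have hpmr : (pm : ℝ) = 0 ∨ (pm : ℝ) = 1 := by
    have : pm = 0 ∨ pm = 1 := by simpa [parities] using hpm
    rcases this with h | h <;> simp [h]
  have hα' : |(α + pm) / 2| ≤ 1 := by rw [abs_le]; rcases hpmr with h | h <;> rw [h] <;> constructor <;> linarith
  refine (norm_sq_sheetAmps_modeProfile_le_abs hb hα' hθ0 hθ K _ i).trans ?_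
  exact mul_le_mul_of_nonneg_left (sum_norm_sq_vslotDiff_div_le hα0 hα1 hβ0 hβ1 hθ0 hθ hd hK₀ hK hdW hK₀'4 hK₀' hpm hpn hn' _) (by positivity)

end tailsum

section straightV

/-- `‖vPairState α p m n‖² ≤ 2(‖p n 0‖² + ‖p n 1‖²)`. -/
theorem norm_sq_vPairState_le (α : ℝ) (p : ℤ → Fin 2 → ℂ) (m n : ℤ) :
    ‖vPairState α p m n‖ ^ 2 ≤ 2 * (‖p n 0‖ ^ 2 + ‖p n 1‖ ^ 2) := by
  have h1 : ‖vPairState α p m n‖ ≤ ‖p n 0‖ + ‖p n 1‖ := by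
    simp only [vPairState]
    refine (norm_add_le _ _).trans (le_of_eq ?_)
    rw [norm_mul, norm_mul, show -((Real.pi * (α + m) / 2 : ℝ) : ℂ) * Complex.I = ((-(Real.pi * (α + m) / 2) : ℝ) : ℂ) * Complex.I by push_cast; ring,
      Complex.norm_exp_ofReal_mul_I, Complex.norm_exp_ofReal_mul_I, mul_one, mul_one]
  have h0 : 0 ≤ ‖vPairState α p m n‖ := norm_nonneg _
  nlinarith [sq_nonneg (‖p n 0‖ - ‖p n 1‖)]

/-- **Straight V-pair energy BY NAME (upper), every level:** for a class `(α, β)` with `α ∈ [0,1]` and V-pair densities `p` vanishing on the zero line `β + n = 0`: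
`cEnergy α β ℓ K (vPairState α p) ≤ (1/(4π²4^ℓ))·Σ_{|n| ≤ K} (‖p n 0‖² + ‖p n 1‖²)·(π/|β+n| + 4/(β+n)²)` (tree `vPair_column_energy_upper`). -/
theorem cEnergy_vPairState_le {α : ℝ} (hα0 : 0 ≤ α) (hα1 : α ≤ 1) (β : ℝ) (ℓ K : ℕ) (p : ℤ → Fin 2 → ℂ)
    (hp : ∀ n ∈ win K, β + (n : ℝ) = 0 → p n = 0) :
    cEnergy α β ℓ K (vPairState α p) ≤
      (1 / (4 * Real.pi ^ 2 * (4 : ℝ) ^ ℓ)) * ∑ n ∈ win K, (‖p n 0‖ ^ 2 + ‖p n 1‖ ^ 2) * (Real.pi / |β + n| + 4 / (β + n) ^ 2) := by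
  unfold cEnergy
  rw [Finset.sum_comm, Finset.mul_sum]
  refine Finset.sum_le_sum fun n hn => ?_
  have e : ∀ (v : ℂ) (m : ℤ), ‖v‖ ^ 2 / (4 * Real.pi ^ 2 * (4 : ℝ) ^ ℓ * ((α + m) ^ 2 + (β + n) ^ 2)) =
      (1 / (4 * Real.pi ^ 2 * (4 : ℝ) ^ ℓ)) * (‖v‖ ^ 2 / ((α + m) ^ 2 + (β + n) ^ 2)) := by
    intro v m
    rw [mul_comm (4 * Real.pi ^ 2 * (4 : ℝ) ^ ℓ) ((α + (m : ℝ)) ^ 2 + (β + n) ^ 2), ← div_div, div_eq_mul_one_div, mul_comm]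
  simp only [vPairState]
  simp_rw [e, ← Finset.mul_sum]
  refine mul_le_mul_of_nonneg_left ?_ (by positivity)
  rcases eq_or_ne (β + (n : ℝ)) 0 with hb | hb
  · have h0 : p n = 0 := hp n hn hb
    simp [h0]
  · exact vPair_column_energy_upper hα0 hα1 hb K (p n 0) (p n 1)

/-- **Young's inequality for the lattice energy:** `E(x + y) ≤ (1 + 1/t)E(x) + (1 + t)E(y)`. -/
theorem cEnergy_add_le_young (α β : ℝ) (ℓ K : ℕ) (x y : CState) {t : ℝ} (ht : 0 < t) :
    cEnergy α β ℓ K (fun m n => x m n + y m n) ≤ (1 + 1 / t) * cEnergy α β ℓ K x + (1 + t) * cEnergy α β ℓ K y := by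
  unfold cEnergy
  rw [Finset.mul_sum, Finset.mul_sum, ← Finset.sum_add_distrib]
  refine Finset.sum_le_sum fun m _ => ?_
  rw [Finset.mul_sum, Finset.mul_sum, ← Finset.sum_add_distrib]
  refine Finset.sum_le_sum fun n _ => ?_
  rw [mul_div_assoc', mul_div_assoc', ← add_div]
  refine div_le_div_of_nonneg_right ?_ (by positivity)
  show ‖x m n + y m n‖ ^ 2 ≤ _
  calc ‖x m n + y m n‖ ^ 2 ≤ (‖x m n‖ + ‖y m n‖) ^ 2 := pow_le_pow_left₀ (norm_nonneg _) (norm_add_le _ _) 2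
    _ ≤ (1 + 1 / t) * ‖x m n‖ ^ 2 + (1 + t) * ‖y m n‖ ^ 2 := add_sq_le_young ht

/-- **(S4a) ROW TRUNCATION TAIL OF A STRAIGHT V PAIR.** For densities `q` on the columns `|n| ≤ K₀` of a child class (`α′ ∈ [0,1)`), enlarging the window from `K₀` to `K`
adds at most `Q/(4π²(K₀−1))` to the level-1 energy, `Q = Σ_{|n| ≤ K₀} (‖q n 0‖² + ‖q n 1‖²)` (new rows `|m| ≥ K₀+1` weigh `≤ 1/(16π²(|m|−1)²)` each). -/
theorem cEnergy_vPairState_trunc_le {α' : ℝ} (hα0 : 0 ≤ α') (hα1 : α' < 1) (β' : ℝ) {K₀ K : ℕ} (hK₀ : 2 ≤ K₀) (hK : K₀ ≤ K)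
    (q : ℤ → Fin 2 → ℂ) (hq : ∀ n, n ∉ win K₀ → q n = 0) :
    cEnergy α' β' 1 K (vPairState α' q) ≤
      cEnergy α' β' 1 K₀ (vPairState α' q) + (∑ n ∈ win K₀, (‖q n 0‖ ^ 2 + ‖q n 1‖ ^ 2)) / (4 * Real.pi ^ 2 * ((K₀ : ℝ) - 1)) := by
  set Qt : ℝ := ∑ n ∈ win K₀, (‖q n 0‖ ^ 2 + ‖q n 1‖ ^ 2) with hQt
  have hQt0 : 0 ≤ Qt := Finset.sum_nonneg fun _ _ => by positivity
  have hsub : win K₀ ⊆ win K := by intro x hx; rw [mem_win] at hx ⊢; omega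
  have hK₀r : (2 : ℝ) ≤ K₀ := by exact_mod_cast hK₀
  have hK₀1 : 0 < (K₀ : ℝ) - 1 := by linarith
  set F : ℤ → ℤ → ℝ := fun m n => ‖vPairState α' q m n‖ ^ 2 / (4 * Real.pi ^ 2 * (4 : ℝ) ^ (1 : ℕ) * ((α' + m) ^ 2 + (β' + n) ^ 2)) with hF
  have hF0 : ∀ m n, 0 ≤ F m n := fun m n => by rw [hF]; positivity
  have hFz : ∀ m n, n ∉ win K₀ → F m n = 0 := by
    intro m n hn; rw [hF]; simp only [vPairState, hq n hn, Pi.zero_apply, zero_mul, add_zero, norm_zero]; simp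
  have hinter : win K ∩ win K₀ = win K₀ := Finset.inter_eq_right.mpr hsub
  -- columns: only `win K₀` matters
  have hcolw : ∀ m : ℤ, ∑ n ∈ win K, F m n = ∑ n ∈ win K₀, F m n := fun m =>
    (Finset.sum_subset hsub fun n _ hn => hFz m n hn).symm
  -- rows: split old/new
  have hsplit : ∑ m ∈ win K, ∑ n ∈ win K₀, F m n =
      (∑ m ∈ win K₀, ∑ n ∈ win K₀, F m n) + ∑ m ∈ win K, (if m ∈ win K₀ then 0 else ∑ n ∈ win K₀, F m n) := by
    have e1 : ∑ m ∈ win K, ∑ n ∈ win K₀, F m n =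
        ∑ m ∈ win K, ((if m ∈ win K₀ then ∑ n ∈ win K₀, F m n else 0) + (if m ∈ win K₀ then 0 else ∑ n ∈ win K₀, F m n)) :=
      Finset.sum_congr rfl fun m _ => by split_ifs <;> simp
    rw [e1, Finset.sum_add_distrib, Finset.sum_ite_mem, hinter]
  have hwrow : ∀ (m n : ℤ), m ∉ win K₀ → F m n ≤ ‖vPairState α' q m n‖ ^ 2 * (1 / (16 * Real.pi ^ 2 * (|(m : ℝ)| - 1) ^ 2)) := by
    intro m n hm
    rw [mem_win, not_and_or, not_le, not_le] at hm
    have hm1 : (K₀ : ℝ) ≤ |(m : ℝ)| - 1 := by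
      rcases hm with h | h
      · have : (m : ℝ) ≤ -(K₀ : ℝ) - 1 := by exact_mod_cast (show m ≤ -(K₀ : ℤ) - 1 by omega)
        rw [abs_of_neg (by linarith)]; linarith
      · have : (K₀ : ℝ) + 1 ≤ m := by exact_mod_cast (show (K₀ : ℤ) + 1 ≤ m by omega)
        rw [abs_of_pos (by linarith)]; linarith
    have hpos : 0 < |(m : ℝ)| - 1 := by linarith
    have hb : (|(m : ℝ)| - 1) ^ 2 ≤ (α' + m) ^ 2 := by
      have h1 : |(m : ℝ)| - 1 ≤ |α' + m| := by
        have := abs_add_le (α' + m) (-α'); rw [abs_neg, abs_of_nonneg hα0, show α' + (m : ℝ) + -α' = m by ring] at this; linarith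
      calc (|(m : ℝ)| - 1) ^ 2 ≤ |α' + m| ^ 2 := pow_le_pow_left₀ hpos.le h1 2
        _ = (α' + m) ^ 2 := sq_abs _
    rw [hF]; simp only
    rw [div_eq_mul_one_div]
    refine mul_le_mul_of_nonneg_left (one_div_le_one_div_of_le (by positivity) ?_) (sq_nonneg _)
    rw [pow_one]; nlinarith [sq_nonneg (β' + (n : ℝ))]
  have hrow : ∑ m ∈ win K, (if m ∈ win K₀ then 0 else ∑ n ∈ win K₀, F m n) ≤ Qt / (8 * Real.pi ^ 2) * (2 / ((K₀ : ℝ) - 1)) := by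
    have step : ∀ m ∈ win K, (if m ∈ win K₀ then 0 else ∑ n ∈ win K₀, F m n) ≤
        Qt / (8 * Real.pi ^ 2) * (if m ∈ win K₀ then (0 : ℝ) else 1 / ((|(m : ℝ)| - 1) ^ 2)) := by
      intro m _
      split_ifs with hm0
      · simp
      · calc ∑ n ∈ win K₀, F m n ≤ ∑ n ∈ win K₀, ‖vPairState α' q m n‖ ^ 2 * (1 / (16 * Real.pi ^ 2 * (|(m : ℝ)| - 1) ^ 2)) :=
              Finset.sum_le_sum fun n _ => hwrow m n hm0
          _ = (∑ n ∈ win K₀, ‖vPairState α' q m n‖ ^ 2) * (1 / (16 * Real.pi ^ 2 * (|(m : ℝ)| - 1) ^ 2)) := by rw [Finset.sum_mul]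
          _ ≤ (2 * Qt) * (1 / (16 * Real.pi ^ 2 * (|(m : ℝ)| - 1) ^ 2)) := by
              refine mul_le_mul_of_nonneg_right ?_ (by positivity)
              rw [hQt, Finset.mul_sum]
              exact Finset.sum_le_sum fun n _ => norm_sq_vPairState_le α' q m n
          _ = Qt / (8 * Real.pi ^ 2) * (1 / (|(m : ℝ)| - 1) ^ 2) := by field_simp; ring
    refine (Finset.sum_le_sum step).trans ?_
    rw [← Finset.mul_sum]
    refine mul_le_mul_of_nonneg_left ((sum_win_tail_inv_sq_le hK₀ hK).trans ?_) (by positivity)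
    have : 0 ≤ 2 / ((K : ℝ) - 1) := by
      have : (2 : ℝ) ≤ K := by exact_mod_cast hK₀.trans hK
      exact div_nonneg (by norm_num) (by linarith)
    linarith
  have hcore : ∑ m ∈ win K₀, ∑ n ∈ win K₀, F m n = cEnergy α' β' 1 K₀ (vPairState α' q) := by unfold cEnergy; rfl
  change ∑ m ∈ win K, ∑ n ∈ win K, F m n ≤ cEnergy α' β' 1 K₀ (vPairState α' q) + Qt / (4 * Real.pi ^ 2 * ((K₀ : ℝ) - 1))
  rw [Finset.sum_congr rfl fun m _ => hcolw m, hsplit, hcore]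
  refine add_le_add le_rfl (hrow.trans (le_of_eq ?_))
  field_simp
  ring

end straightV

section perchild

/-- **(S4) ONE CHILD:** Young split of the restricted fresh V pair into its `K₀` part (row tail (S4a)) and the truncation difference (shell columns, (S3),
`cEnergy_vPairState_le`, `≤ 2·2^{s′}+1` columns). -/
theorem outEnergy_V_trunc_le {α β : ℝ} (hα0 : 0 ≤ α) (hα1 : α < 1) (hβ0 : 0 ≤ β) (hβ1 : β < 1) {θ : ℝ} (hθ0 : 0 ≤ θ) (hθ : θ ≤ 8)
    {s : ℕ} {d : ℤ → Fin 2 → ℂ} (hd : SupportedIn s β d) {K₀ K K₀' : ℕ} (hK₀ : 2 ^ s + 1 ≤ K₀) (hK : K₀ ≤ K)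
    (hdW : ∀ k : ℤ, k ∉ win K → d k = 0) (hK₀'4 : 4 ≤ K₀') (hK₀' : 2 * K₀' + 1 ≤ K₀)
    {pm pn : ℤ} (hpm : pm ∈ parities) (hpn : pn ∈ parities) {s' : ℕ} (hs' : 3 ≤ s') (hK₀s' : 2 ^ s' ≤ K₀) {t : ℝ} (ht : 0 < t) :
    outEnergy ((α + pm) / 2) ((β + pn) / 2) θ K s' (phasePieces ((α + pm) / 2) ((β + pn) / 2) θ K (child pm pn (inputState α β θ K PType.V d))) PType.V ≤
      (1 + 1 / t) * (outEnergy ((α + pm) / 2) ((β + pn) / 2) θ K₀ s' (phasePieces ((α + pm) / 2) ((β + pn) / 2) θ K₀ (child pm pn (inputState α β θ K₀ PType.V d))) PType.V +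
          (∑ n' ∈ win K₀, (‖restrictShell s' ((β + pn) / 2) (phasePieces ((α + pm) / 2) ((β + pn) / 2) θ K₀ (child pm pn (inputState α β θ K₀ PType.V d))).freshV n' 0‖ ^ 2 + ‖restrictShell s' ((β + pn) / 2) (phasePieces ((α + pm) / 2) ((β + pn) / 2) θ K₀ (child pm pn (inputState α β θ K₀ PType.V d))).freshV n' 1‖ ^ 2)) / (4 * Real.pi ^ 2 * ((K₀ : ℝ) - 1))) +
        (1 + t) * (1000 * (Real.pi + 1) / Real.pi ^ 2 * (2 * 2 ^ s' + 1) * ((6 + 96000 / (K₀' : ℝ)) * (∑ k ∈ win K, (‖d k 0‖ ^ 2 + ‖d k 1‖ ^ 2)) * (2 / ((K₀' : ℝ) - 1)))) := by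
  have hpm' : pm = 0 ∨ pm = 1 := by simpa [parities] using hpm
  have hpn' : pn = 0 ∨ pn = 1 := by simpa [parities] using hpn
  have hpmr : (pm : ℝ) = 0 ∨ (pm : ℝ) = 1 := by rcases hpm' with h | h <;> simp [h]
  have hpnr : (pn : ℝ) = 0 ∨ (pn : ℝ) = 1 := by rcases hpn' with h | h <;> simp [h]
  have ha0 : 0 ≤ (α + pm) / 2 := by rcases hpmr with h | h <;> rw [h] <;> linarith
  have ha1 : (α + pm) / 2 < 1 := by rcases hpmr with h | h <;> rw [h] <;> linarith
  have hb0 : 0 ≤ (β + pn) / 2 := by rcases hpnr with h | h <;> rw [h] <;> linarith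
  have hb1 : (β + pn) / 2 < 1 := by rcases hpnr with h | h <;> rw [h] <;> linarith
  have hK₀2 : 2 ≤ K₀ := by omega
  have hK₀'r : (4 : ℝ) ≤ K₀' := by exact_mod_cast hK₀'4
  have hD0 : 0 ≤ (∑ k ∈ win K, (‖d k 0‖ ^ 2 + ‖d k 1‖ ^ 2)) := Finset.sum_nonneg fun _ _ => by positivity
  have hlo : (4 : ℝ) ≤ shellLo s' := by
    obtain ⟨k, rfl⟩ : ∃ k, s' = k + 2 := ⟨s' - 2, by omega⟩
    simp only [shellLo]
    calc (4 : ℝ) = 2 ^ (1 + 1) := by norm_num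
      _ ≤ 2 ^ (k + 1) := pow_le_pow_right₀ (by norm_num) (by omega)
  have hhi := shellHi_le_two_pow s'
  simp only [outEnergy, outEnergyAt, phasePieces_freshV]
  set TC : ℝ := ((6 + 96000 / (K₀' : ℝ)) * (∑ k ∈ win K, (‖d k 0‖ ^ 2 + ‖d k 1‖ ^ 2)) * (2 / ((K₀' : ℝ) - 1))) with hTC
  have hTC0 : 0 ≤ TC := by
    rw [hTC]; refine mul_nonneg (mul_nonneg (by positivity) hD0) (div_nonneg (by norm_num) (by linarith))
  set RK : ℤ → Fin 2 → ℂ := restrictShell s' ((β + pn) / 2) (vFresh ((α + pm) / 2) ((β + pn) / 2) θ K (fun m n => hTransport ((α + pm) / 2) ((β + pn) / 2) θ K (child pm pn (inputState α β θ K PType.V d)) m n + hPairState ((β + pn) / 2) (hFresh ((α + pm) / 2) ((β + pn) / 2) θ K (child pm pn (inputState α β θ K PType.V d))) m n)) with hRK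
  set R0 : ℤ → Fin 2 → ℂ := restrictShell s' ((β + pn) / 2) (vFresh ((α + pm) / 2) ((β + pn) / 2) θ K₀ (fun m n => hTransport ((α + pm) / 2) ((β + pn) / 2) θ K₀ (child pm pn (inputState α β θ K₀ PType.V d)) m n + hPairState ((β + pn) / 2) (hFresh ((α + pm) / 2) ((β + pn) / 2) θ K₀ (child pm pn (inputState α β θ K₀ PType.V d))) m n)) with hR0
  set Δ : ℤ → Fin 2 → ℂ := fun n i => RK n i - R0 n i with hΔ
  have hsplitV : vPairState ((α + pm) / 2) RK = fun m n => vPairState ((α + pm) / 2) R0 m n + vPairState ((α + pm) / 2) Δ m n := by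
    funext m n; simp only [vPairState, hΔ]; ring
  rw [hsplitV]
  refine (cEnergy_add_le_young _ _ 1 K _ _ ht).trans ?_
  refine add_le_add (mul_le_mul_of_nonneg_left ?_ (by positivity)) (mul_le_mul_of_nonneg_left ?_ (by positivity))
  · -- the `K₀` part: straight-pair row tail
    refine cEnergy_vPairState_trunc_le ha0 ha1 _ hK₀2 hK R0 fun n hn => ?_
    rw [hR0]; funext i; simp [restrictShell, vFresh, hn]
  · -- the difference: shell columns only
    have hΔ0 : ∀ n : ℤ, ¬ (shellLo s' ≤ |(β + pn) / 2 + (n : ℝ)| ∧ |(β + pn) / 2 + (n : ℝ)| < shellHi s') → Δ n = 0 := by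
      intro n hsh; funext i
      simp only [hΔ, hRK, hR0, restrictShell, if_neg hsh, Pi.zero_apply, sub_self]
    have hΔz : ∀ n ∈ win K, (β + pn) / 2 + (n : ℝ) = 0 → Δ n = 0 := by
      intro n _ hbn
      refine hΔ0 n fun hsh => ?_
      rw [hbn, abs_zero] at hsh
      linarith [hsh.1]
    refine (cEnergy_vPairState_le ha0 ha1.le _ 1 K Δ hΔz).trans ?_
    have hcol : ∀ n ∈ win K, (‖Δ n 0‖ ^ 2 + ‖Δ n 1‖ ^ 2) * (Real.pi / |(β + pn) / 2 + n| + 4 / ((β + pn) / 2 + n) ^ 2) ≤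
        if (shellLo s' ≤ |(β + pn) / 2 + (n : ℝ)| ∧ |(β + pn) / 2 + (n : ℝ)| < shellHi s') then 16000 * (Real.pi + 1) * TC else 0 := by
      intro n hn
      split_ifs with hsh
      · have hb4 : 4 ≤ |(β + pn) / 2 + (n : ℝ)| := hlo.trans hsh.1
        have hbpos : 0 < |(β + pn) / 2 + (n : ℝ)| := by linarith
        -- the shell column is inside the small window
        have hlt : |(n : ℝ)| < (2 : ℝ) ^ s' + 1 := by
          have h1 : |(n : ℝ)| ≤ |(β + pn) / 2 + n| + |(β + pn) / 2| := by
            have h := abs_add_le ((β + pn) / 2 + n) (-((β + pn) / 2))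
            rw [abs_neg, show (β + ↑pn) / 2 + (n : ℝ) + -((β + ↑pn) / 2) = n by ring] at h
            exact h
          rw [abs_of_nonneg hb0] at h1
          linarith [hsh.2]
        have hnz : |n| ≤ (2 : ℤ) ^ s' := by
          have h' : ((|n| : ℤ) : ℝ) < (2 : ℝ) ^ s' + 1 := by rw [Int.cast_abs]; exact hlt
          have h'' : |n| < (2 : ℤ) ^ s' + 1 := by exact_mod_cast h'
          omega
        have hK₀z : (2 : ℤ) ^ s' ≤ (K₀ : ℤ) := by exact_mod_cast hK₀s'
        have habs := abs_le.mp hnz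
        have hnK₀ : n ∈ win K₀ := by rw [mem_win]; omega
        have hΔeq : ∀ i : Fin 2, Δ n i = sheetAmps ((β + pn) / 2 + n) ((α + pm) / 2) θ
            ⟨modeProfile ((α + pm) / 2) K (fun m =>
              (hTransport ((α + pm) / 2) ((β + pn) / 2) θ K (child pm pn (inputState α β θ K PType.V d)) m n + hPairState ((β + pn) / 2) (hFresh ((α + pm) / 2) ((β + pn) / 2) θ K (child pm pn (inputState α β θ K PType.V d))) m n) -
              (hTransport ((α + pm) / 2) ((β + pn) / 2) θ K₀ (child pm pn (inputState α β θ K₀ PType.V d)) m n + hPairState ((β + pn) / 2) (hFresh ((α + pm) / 2) ((β + pn) / 2) θ K₀ (child pm pn (inputState α β θ K₀ PType.V d))) m n)), []⟩ i := by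
          intro i
          simp only [hΔ, hRK, hR0, restrictShell, if_pos hsh]
          rw [vFresh_trunc_split α β θ d hK hpm pn hnK₀ (by linarith)]
          simp
        have hδ : ∀ i : Fin 2, ‖Δ n i‖ ^ 2 ≤ 8000 * |(β + pn) / 2 + (n : ℝ)| * TC := fun i => by
          rw [hΔeq i, hTC]; exact norm_sq_vFresh_trunc_tail_le hα0 hα1 hβ0 hβ1 hθ0 hθ hd hK₀ hK hdW hK₀'4 hK₀' hpm hpn hnK₀ hb4 i
        have hw : Real.pi / |(β + pn) / 2 + n| + 4 / ((β + pn) / 2 + n) ^ 2 ≤ (Real.pi + 1) / |(β + pn) / 2 + (n : ℝ)| := by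
          have h1 : 4 / ((β + pn) / 2 + (n : ℝ)) ^ 2 ≤ 1 / |(β + pn) / 2 + (n : ℝ)| := by
            rw [← sq_abs ((β + pn) / 2 + (n : ℝ)), div_le_div_iff₀ (by positivity) hbpos]
            nlinarith
          have e : (Real.pi + 1) / |(β + pn) / 2 + (n : ℝ)| = Real.pi / |(β + pn) / 2 + (n : ℝ)| + 1 / |(β + pn) / 2 + (n : ℝ)| := by ring
          linarith
        calc (‖Δ n 0‖ ^ 2 + ‖Δ n 1‖ ^ 2) * (Real.pi / |(β + pn) / 2 + n| + 4 / ((β + pn) / 2 + n) ^ 2)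
            ≤ (2 * (8000 * |(β + pn) / 2 + (n : ℝ)| * TC)) * ((Real.pi + 1) / |(β + pn) / 2 + (n : ℝ)|) :=
              mul_le_mul (by linarith [hδ 0, hδ 1]) hw (by positivity) (by positivity)
          _ = 16000 * (Real.pi + 1) * TC := by
              rw [show (2 * (8000 * |(β + pn) / 2 + (n : ℝ)| * TC)) * ((Real.pi + 1) / |(β + pn) / 2 + (n : ℝ)|) =
                16000 * (Real.pi + 1) * TC * (|(β + pn) / 2 + (n : ℝ)| / |(β + pn) / 2 + (n : ℝ)|) by ring, div_self hbpos.ne', mul_one]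
      · simp [hΔ0 n hsh]
    calc (1 / (4 * Real.pi ^ 2 * (4 : ℝ) ^ 1)) * ∑ n ∈ win K, (‖Δ n 0‖ ^ 2 + ‖Δ n 1‖ ^ 2) * (Real.pi / |(β + pn) / 2 + n| + 4 / ((β + pn) / 2 + n) ^ 2)
        ≤ (1 / (4 * Real.pi ^ 2 * (4 : ℝ) ^ 1)) * ∑ n ∈ win K,
            (if (shellLo s' ≤ |(β + pn) / 2 + (n : ℝ)| ∧ |(β + pn) / 2 + (n : ℝ)| < shellHi s') then 16000 * (Real.pi + 1) * TC else 0) :=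
          mul_le_mul_of_nonneg_left (Finset.sum_le_sum hcol) (by positivity)
      _ = (1 / (4 * Real.pi ^ 2 * (4 : ℝ) ^ 1)) *
            ((((win K).filter fun n : ℤ => shellLo s' ≤ |(β + pn) / 2 + (n : ℝ)| ∧ |(β + pn) / 2 + (n : ℝ)| < shellHi s').card : ℝ) *
              (16000 * (Real.pi + 1) * TC)) := by
          rw [Finset.sum_ite, Finset.sum_const_zero, add_zero, Finset.sum_const, nsmul_eq_mul]
      _ ≤ (1 / (4 * Real.pi ^ 2 * (4 : ℝ) ^ 1)) * ((2 * 2 ^ s' + 1) * (16000 * (Real.pi + 1) * TC)) := by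
          refine mul_le_mul_of_nonneg_left (mul_le_mul_of_nonneg_right (card_filter_inShell_le _ s' (by omega) (win K)) (by positivity)) (by positivity)
      _ = 1000 * (Real.pi + 1) / Real.pi ^ 2 * (2 * 2 ^ s' + 1) * TC := by field_simp; ring

end perchild

section assembly

/-- Bookkeeping over the four children: `ΣΣ (a(f + g/c) + X) = a(ΣΣ f + (ΣΣ g)/c) + 4X`. -/
theorem sum_parities_affine (f g : ℤ → ℤ → ℝ) (a c X : ℝ) :
    ∑ pm ∈ parities, ∑ pn ∈ parities, (a * (f pm pn + g pm pn / c) + X) =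
      a * ((∑ pm ∈ parities, ∑ pn ∈ parities, f pm pn) + (∑ pm ∈ parities, ∑ pn ∈ parities, g pm pn) / c) + 4 * X := by
  have h0 : (0 : ℤ) ∉ ({1} : Finset ℤ) := by simp
  simp only [parities, Finset.sum_insert h0, Finset.sum_singleton]
  ring

/-- **(R-K) FOR THE V→V BLOCK, BY NAME** (memo §24): parent class `(α, β) ∈ [0,1)²`, `θ ∈ [0,8]`, target shell `s′ ≥ 3`, inner window `K₀′ ≥ 4`, `2K₀′+1 ≤ K₀`,
`2^s+1 ≤ K₀`, `2^{s′} ≤ K₀`, `t > 0`: ONE inequality at truncation `K₀` (children's V outputs + straight-pair row tail `Q_V/(4π²(K₀−1))` + an explicit identity term)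
gives `Transfer α β θ K V s V s′ M` for EVERY `K ≥ K₀`.  (S1) `vslotInput_old_row_eq`, (S2) `vFresh_trunc_split`, (S3) `norm_sq_vFresh_trunc_tail_le`,
(S4) `outEnergy_V_trunc_le`, (F3) `cEnergy_inputState_V_mono`. -/
theorem transfer_V_V_of_trunc {α β : ℝ} (hα0 : 0 ≤ α) (hα1 : α < 1) (hβ0 : 0 ≤ β) (hβ1 : β < 1) {θ : ℝ} (hθ0 : 0 ≤ θ) (hθ : θ ≤ 8)
    {s s' K₀ K K₀' : ℕ} (hs' : 3 ≤ s') (hK₀s : 2 ^ s + 1 ≤ K₀) (hK₀s' : 2 ^ s' ≤ K₀) (hK₀'4 : 4 ≤ K₀') (hK₀' : 2 * K₀' + 1 ≤ K₀)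
    (hK : K₀ ≤ K) {t : ℝ} (ht : 0 < t) {M : ℝ}
    (h : ∀ d : ℤ → Fin 2 → ℂ, SupportedInW s β K₀ d →
      (1 + 1 / t) * ((∑ pm ∈ parities, ∑ pn ∈ parities, outEnergy ((α + pm) / 2) ((β + pn) / 2) θ K₀ s' (phasePieces ((α + pm) / 2) ((β + pn) / 2) θ K₀ (child pm pn (inputState α β θ K₀ PType.V d))) PType.V) +
          (∑ pm ∈ parities, ∑ pn ∈ parities, (∑ n' ∈ win K₀, (‖restrictShell s' ((β + pn) / 2) (phasePieces ((α + pm) / 2) ((β + pn) / 2) θ K₀ (child pm pn (inputState α β θ K₀ PType.V d))).freshV n' 0‖ ^ 2 + ‖restrictShell s' ((β + pn) / 2) (phasePieces ((α + pm) / 2) ((β + pn) / 2) θ K₀ (child pm pn (inputState α β θ K₀ PType.V d))).freshV n' 1‖ ^ 2))) / (4 * Real.pi ^ 2 * ((K₀ : ℝ) - 1))) +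
        (1 + t) * (4000 * (Real.pi + 1) / Real.pi ^ 2 * (2 * 2 ^ s' + 1) * ((6 + 96000 / (K₀' : ℝ)) * (∑ k ∈ win K₀, (‖d k 0‖ ^ 2 + ‖d k 1‖ ^ 2)) * (2 / ((K₀' : ℝ) - 1)))) ≤
      M ^ 2 * cEnergy α β 0 K₀ (inputState α β θ K₀ PType.V d)) :
    Transfer α β θ K PType.V s PType.V s' M := by
  intro d hd
  have hdS : SupportedIn s β d := hd.1
  have hdWK : ∀ k : ℤ, k ∉ win K → d k = 0 := hd.2
  have hsub : win K₀ ⊆ win K := by intro x hx; rw [mem_win] at hx ⊢; omega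
  -- `d` qualifies at truncation `K₀`
  have hdW₀ : SupportedInW s β K₀ d := by
    refine ⟨hdS, fun k hk => supportedIn_apply_eq_zero hβ0 hβ1 hdS ?_⟩
    rw [mem_win, not_and_or, not_le, not_le] at hk
    have hK₀r : (2 : ℝ) ^ s + 1 ≤ (K₀ : ℝ) := by exact_mod_cast hK₀s
    have : (K₀ : ℝ) + 1 ≤ |(k : ℝ)| := by
      rcases hk with hk | hk
      · have h' : (k : ℝ) ≤ -(K₀ : ℝ) - 1 := by exact_mod_cast (show k ≤ -(K₀ : ℤ) - 1 by omega)
        rw [abs_of_neg (by linarith)]; linarith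
      · have h' : (K₀ : ℝ) + 1 ≤ k := by exact_mod_cast (show (K₀ : ℤ) + 1 ≤ k by omega)
        rw [abs_of_pos (by linarith)]; linarith
    linarith
  have hD : (∑ k ∈ win K, (‖d k 0‖ ^ 2 + ‖d k 1‖ ^ 2)) = (∑ k ∈ win K₀, (‖d k 0‖ ^ 2 + ‖d k 1‖ ^ 2)) :=
    (Finset.sum_subset hsub fun k _ hk => by simp [hdW₀.2 k hk]).symm
  have hmain := h d hdW₀
  rw [← hD] at hmain
  have hchild : ∀ pm ∈ parities, ∀ pn ∈ parities,
      outEnergy ((α + pm) / 2) ((β + pn) / 2) θ K s' (phasePieces ((α + pm) / 2) ((β + pn) / 2) θ K (child pm pn (inputState α β θ K PType.V d))) PType.V ≤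
        (1 + 1 / t) * (outEnergy ((α + pm) / 2) ((β + pn) / 2) θ K₀ s' (phasePieces ((α + pm) / 2) ((β + pn) / 2) θ K₀ (child pm pn (inputState α β θ K₀ PType.V d))) PType.V +
            (∑ n' ∈ win K₀, (‖restrictShell s' ((β + pn) / 2) (phasePieces ((α + pm) / 2) ((β + pn) / 2) θ K₀ (child pm pn (inputState α β θ K₀ PType.V d))).freshV n' 0‖ ^ 2 + ‖restrictShell s' ((β + pn) / 2) (phasePieces ((α + pm) / 2) ((β + pn) / 2) θ K₀ (child pm pn (inputState α β θ K₀ PType.V d))).freshV n' 1‖ ^ 2)) / (4 * Real.pi ^ 2 * ((K₀ : ℝ) - 1))) +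
          (1 + t) * (1000 * (Real.pi + 1) / Real.pi ^ 2 * (2 * 2 ^ s' + 1) * ((6 + 96000 / (K₀' : ℝ)) * (∑ k ∈ win K, (‖d k 0‖ ^ 2 + ‖d k 1‖ ^ 2)) * (2 / ((K₀' : ℝ) - 1)))) :=
    fun pm hpm pn hpn => outEnergy_V_trunc_le hα0 hα1 hβ0 hβ1 hθ0 hθ hdS hK₀s hK hdWK hK₀'4 hK₀' hpm hpn hs' hK₀s' ht
  calc (∑ pm ∈ parities, ∑ pn ∈ parities, outEnergy ((α + pm) / 2) ((β + pn) / 2) θ K s' (phasePieces ((α + pm) / 2) ((β + pn) / 2) θ K (child pm pn (inputState α β θ K PType.V d))) PType.V)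
      ≤ ∑ pm ∈ parities, ∑ pn ∈ parities,
          ((1 + 1 / t) * (outEnergy ((α + pm) / 2) ((β + pn) / 2) θ K₀ s' (phasePieces ((α + pm) / 2) ((β + pn) / 2) θ K₀ (child pm pn (inputState α β θ K₀ PType.V d))) PType.V +
              (∑ n' ∈ win K₀, (‖restrictShell s' ((β + pn) / 2) (phasePieces ((α + pm) / 2) ((β + pn) / 2) θ K₀ (child pm pn (inputState α β θ K₀ PType.V d))).freshV n' 0‖ ^ 2 + ‖restrictShell s' ((β + pn) / 2) (phasePieces ((α + pm) / 2) ((β + pn) / 2) θ K₀ (child pm pn (inputState α β θ K₀ PType.V d))).freshV n' 1‖ ^ 2)) / (4 * Real.pi ^ 2 * ((K₀ : ℝ) - 1))) +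
            (1 + t) * (1000 * (Real.pi + 1) / Real.pi ^ 2 * (2 * 2 ^ s' + 1) * ((6 + 96000 / (K₀' : ℝ)) * (∑ k ∈ win K, (‖d k 0‖ ^ 2 + ‖d k 1‖ ^ 2)) * (2 / ((K₀' : ℝ) - 1))))) :=
        Finset.sum_le_sum fun pm hpm => Finset.sum_le_sum fun pn hpn => hchild pm hpm pn hpn
    _ = (1 + 1 / t) * ((∑ pm ∈ parities, ∑ pn ∈ parities, outEnergy ((α + pm) / 2) ((β + pn) / 2) θ K₀ s' (phasePieces ((α + pm) / 2) ((β + pn) / 2) θ K₀ (child pm pn (inputState α β θ K₀ PType.V d))) PType.V) +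
          (∑ pm ∈ parities, ∑ pn ∈ parities, (∑ n' ∈ win K₀, (‖restrictShell s' ((β + pn) / 2) (phasePieces ((α + pm) / 2) ((β + pn) / 2) θ K₀ (child pm pn (inputState α β θ K₀ PType.V d))).freshV n' 0‖ ^ 2 + ‖restrictShell s' ((β + pn) / 2) (phasePieces ((α + pm) / 2) ((β + pn) / 2) θ K₀ (child pm pn (inputState α β θ K₀ PType.V d))).freshV n' 1‖ ^ 2))) / (4 * Real.pi ^ 2 * ((K₀ : ℝ) - 1))) +
        4 * ((1 + t) * (1000 * (Real.pi + 1) / Real.pi ^ 2 * (2 * 2 ^ s' + 1) * ((6 + 96000 / (K₀' : ℝ)) * (∑ k ∈ win K, (‖d k 0‖ ^ 2 + ‖d k 1‖ ^ 2)) * (2 / ((K₀' : ℝ) - 1))))) :=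
        sum_parities_affine
          (fun pm pn => outEnergy ((α + pm) / 2) ((β + pn) / 2) θ K₀ s' (phasePieces ((α + pm) / 2) ((β + pn) / 2) θ K₀ (child pm pn (inputState α β θ K₀ PType.V d))) PType.V)
          (fun pm pn => (∑ n' ∈ win K₀, (‖restrictShell s' ((β + pn) / 2) (phasePieces ((α + pm) / 2) ((β + pn) / 2) θ K₀ (child pm pn (inputState α β θ K₀ PType.V d))).freshV n' 0‖ ^ 2 + ‖restrictShell s' ((β + pn) / 2) (phasePieces ((α + pm) / 2) ((β + pn) / 2) θ K₀ (child pm pn (inputState α β θ K₀ PType.V d))).freshV n' 1‖ ^ 2)))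
          (1 + 1 / t) (4 * Real.pi ^ 2 * ((K₀ : ℝ) - 1)) _
    _ = (1 + 1 / t) * ((∑ pm ∈ parities, ∑ pn ∈ parities, outEnergy ((α + pm) / 2) ((β + pn) / 2) θ K₀ s' (phasePieces ((α + pm) / 2) ((β + pn) / 2) θ K₀ (child pm pn (inputState α β θ K₀ PType.V d))) PType.V) +
          (∑ pm ∈ parities, ∑ pn ∈ parities, (∑ n' ∈ win K₀, (‖restrictShell s' ((β + pn) / 2) (phasePieces ((α + pm) / 2) ((β + pn) / 2) θ K₀ (child pm pn (inputState α β θ K₀ PType.V d))).freshV n' 0‖ ^ 2 + ‖restrictShell s' ((β + pn) / 2) (phasePieces ((α + pm) / 2) ((β + pn) / 2) θ K₀ (child pm pn (inputState α β θ K₀ PType.V d))).freshV n' 1‖ ^ 2))) / (4 * Real.pi ^ 2 * ((K₀ : ℝ) - 1))) +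
        (1 + t) * (4000 * (Real.pi + 1) / Real.pi ^ 2 * (2 * 2 ^ s' + 1) * ((6 + 96000 / (K₀' : ℝ)) * (∑ k ∈ win K, (‖d k 0‖ ^ 2 + ‖d k 1‖ ^ 2)) * (2 / ((K₀' : ℝ) - 1)))) := by ring
    _ ≤ M ^ 2 * cEnergy α β 0 K₀ (inputState α β θ K₀ PType.V d) := hmain
    _ ≤ M ^ 2 * cEnergy α β 0 K (inputState α β θ K PType.V d) :=
        mul_le_mul_of_nonneg_left (cEnergy_inputState_V_mono α β θ hK d) (sq_nonneg M)


/-- **The `ℓ²` mass of a shell-`s ≥ 3` V source against its windowed energy:** `Σ_k (‖d k 0‖² + ‖d k 1‖²) ≤ 8π²·2^s·E_K(d)` once `2^{s+2} ≤ K + 1`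
(`cEnergy_inputState_V_shell_lower` + `input_coef_lower3`). -/
theorem sum_norm_sq_le_cEnergy_inputState_V {α : ℝ} (hα0 : 0 ≤ α) (hα1 : α ≤ 1) (β θ : ℝ) {s K : ℕ} (hs : 3 ≤ s)
    (hK : (2 : ℝ) ^ (s + 2) ≤ K + 1) (d : ℤ → Fin 2 → ℂ) (hd : SupportedIn s β d) :
    ∑ n ∈ win K, (‖d n 0‖ ^ 2 + ‖d n 1‖ ^ 2) ≤ 8 * Real.pi ^ 2 * 2 ^ s * cEnergy α β 0 K (inputState α β θ K PType.V d) := by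
  have h1 := cEnergy_inputState_V_shell_lower hα0 hα1 β θ K (by omega : 2 ≤ s) d hd
  have h2 := input_coef_lower3 hs hK
  set D : ℝ := ∑ n ∈ win K, (‖d n 0‖ ^ 2 + ‖d n 1‖ ^ 2) with hDdef
  have hD0 : 0 ≤ D := Finset.sum_nonneg fun _ _ => by positivity
  have h3 : 1 / (2 * (2 : ℝ) ^ s) * D / (4 * Real.pi ^ 2) ≤ cEnergy α β 0 K (inputState α β θ K PType.V d) :=
    le_trans (div_le_div_of_nonneg_right (mul_le_mul_of_nonneg_right h2 hD0) (by positivity)) h1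
  rw [show 1 / (2 * (2 : ℝ) ^ s) * D / (4 * Real.pi ^ 2) = D / (8 * Real.pi ^ 2 * 2 ^ s) by field_simp; ring,
    div_le_iff₀ (by positivity)] at h3
  linarith

/-- **(R-K) FOR THE V→V BLOCK, RAYLEIGH FORM** (`s ≥ 3`, `2^{s+2} ≤ K₀+1`; identity term absorbed by `Σ‖d‖² ≤ 8π²2^s·E_{K₀}`): relative tail
`(1+t)·64000(π+1)·2^s(2·2^{s′}+1)(6+96000/K₀′)/(K₀′−1)` — finite `K₀` certifies all `K` (structure; the constant is not engine-sized). -/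
theorem transfer_V_V_of_trunc' {α β : ℝ} (hα0 : 0 ≤ α) (hα1 : α < 1) (hβ0 : 0 ≤ β) (hβ1 : β < 1) {θ : ℝ} (hθ0 : 0 ≤ θ) (hθ : θ ≤ 8)
    {s s' K₀ K K₀' : ℕ} (hs : 3 ≤ s) (hs' : 3 ≤ s') (hK₀s : (2 : ℝ) ^ (s + 2) ≤ K₀ + 1) (hK₀s' : 2 ^ s' ≤ K₀) (hK₀'4 : 4 ≤ K₀')
    (hK₀' : 2 * K₀' + 1 ≤ K₀) (hK : K₀ ≤ K) {t : ℝ} (ht : 0 < t) {M : ℝ}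
    (h : ∀ d : ℤ → Fin 2 → ℂ, SupportedInW s β K₀ d →
      (1 + 1 / t) * ((∑ pm ∈ parities, ∑ pn ∈ parities, outEnergy ((α + pm) / 2) ((β + pn) / 2) θ K₀ s' (phasePieces ((α + pm) / 2) ((β + pn) / 2) θ K₀ (child pm pn (inputState α β θ K₀ PType.V d))) PType.V) +
          (∑ pm ∈ parities, ∑ pn ∈ parities, (∑ n' ∈ win K₀, (‖restrictShell s' ((β + pn) / 2) (phasePieces ((α + pm) / 2) ((β + pn) / 2) θ K₀ (child pm pn (inputState α β θ K₀ PType.V d))).freshV n' 0‖ ^ 2 + ‖restrictShell s' ((β + pn) / 2) (phasePieces ((α + pm) / 2) ((β + pn) / 2) θ K₀ (child pm pn (inputState α β θ K₀ PType.V d))).freshV n' 1‖ ^ 2))) / (4 * Real.pi ^ 2 * ((K₀ : ℝ) - 1))) +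
        (1 + t) * (64000 * (Real.pi + 1) * 2 ^ s * (2 * 2 ^ s' + 1) * (6 + 96000 / (K₀' : ℝ)) / ((K₀' : ℝ) - 1)) *
          cEnergy α β 0 K₀ (inputState α β θ K₀ PType.V d) ≤
      M ^ 2 * cEnergy α β 0 K₀ (inputState α β θ K₀ PType.V d)) :
    Transfer α β θ K PType.V s PType.V s' M := by
  have hK₀s1 : 2 ^ s + 1 ≤ K₀ := by
    have h4 : (2 : ℝ) ^ (s + 2) = 4 * 2 ^ s := by rw [pow_add]; ring
    have h1 : (1 : ℝ) ≤ 2 ^ s := one_le_pow₀ (by norm_num)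
    have : (2 : ℝ) ^ s + 1 ≤ K₀ := by linarith
    exact_mod_cast this
  refine transfer_V_V_of_trunc hα0 hα1 hβ0 hβ1 hθ0 hθ hs' hK₀s1 hK₀s' hK₀'4 hK₀' hK ht fun d hd => ?_
  refine le_trans ?_ (h d hd)
  refine add_le_add le_rfl ?_
  have hK₀'r : (4 : ℝ) ≤ K₀' := by exact_mod_cast hK₀'4
  have hE := sum_norm_sq_le_cEnergy_inputState_V hα0 hα1.le β θ hs hK₀s d hd.1
  have hpos : 0 ≤ (1 + t) * (4000 * (Real.pi + 1) / Real.pi ^ 2 * (2 * 2 ^ s' + 1) * ((6 + 96000 / (K₀' : ℝ)) * (2 / ((K₀' : ℝ) - 1)))) := by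
    have : 0 < (K₀' : ℝ) - 1 := by linarith
    positivity
  calc (1 + t) * (4000 * (Real.pi + 1) / Real.pi ^ 2 * (2 * 2 ^ s' + 1) * ((6 + 96000 / (K₀' : ℝ)) * (∑ k ∈ win K₀, (‖d k 0‖ ^ 2 + ‖d k 1‖ ^ 2)) * (2 / ((K₀' : ℝ) - 1))))
      = (1 + t) * (4000 * (Real.pi + 1) / Real.pi ^ 2 * (2 * 2 ^ s' + 1) * ((6 + 96000 / (K₀' : ℝ)) * (2 / ((K₀' : ℝ) - 1)))) *
          (∑ k ∈ win K₀, (‖d k 0‖ ^ 2 + ‖d k 1‖ ^ 2)) := by ring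
    _ ≤ (1 + t) * (4000 * (Real.pi + 1) / Real.pi ^ 2 * (2 * 2 ^ s' + 1) * ((6 + 96000 / (K₀' : ℝ)) * (2 / ((K₀' : ℝ) - 1)))) *
          (8 * Real.pi ^ 2 * 2 ^ s * cEnergy α β 0 K₀ (inputState α β θ K₀ PType.V d)) := mul_le_mul_of_nonneg_left hE hpos
    _ = (1 + t) * (64000 * (Real.pi + 1) * 2 ^ s * (2 * 2 ^ s' + 1) * (6 + 96000 / (K₀' : ℝ)) / ((K₀' : ℝ) - 1)) *
          cEnergy α β 0 K₀ (inputState α β θ K₀ PType.V d) := by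
        have hπ : Real.pi ^ 2 ≠ 0 := by positivity
        field_simp
        ring

end assembly


/-! ## §25 (p2 g12) DEBRIS OF EVERY AGE INTO H TARGETS, BY NAME: `DebrisTransfer α β θ K k t s H s′ (2100·66^k)` -/

/-! ### copies (verbatim): `hTransport_row_energy_le` / `cEnergy_hTransport_le` (K2CombColumnLaw §10) and `debrisOut` / `DebrisTransfer` (K2AssemblyS4 §0.7) -/

/-- The energy-form transport bound for ONE row of `hTransport` (line `α + m`, any value incl. `0`). -/
theorem hTransport_row_energy_le (α β θ : ℝ) (ℓ K : ℕ) (ζ : CState) {m : ℤ} (hm : m ∈ win K) :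
    ∑ n' ∈ win K, ‖hTransport α β θ K ζ m n'‖ ^ 2 / (4 * Real.pi ^ 2 * (4 : ℝ) ^ ℓ * ((α + m) ^ 2 + (β + n') ^ 2)) ≤
      (θ ^ 2 + 2) * ∑ n ∈ win K, ‖ζ m n‖ ^ 2 / (4 * Real.pi ^ 2 * (4 : ℝ) ^ ℓ * ((α + m) ^ 2 + (β + n) ^ 2)) := by
  have hc : (0 : ℝ) < 4 * Real.pi ^ 2 * (4 : ℝ) ^ ℓ := by positivity
  have e : ∀ (v : ℂ) (n : ℤ), ‖v‖ ^ 2 / (4 * Real.pi ^ 2 * (4 : ℝ) ^ ℓ * ((α + m) ^ 2 + (β + n) ^ 2)) =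
      (1 / (4 * Real.pi ^ 2 * (4 : ℝ) ^ ℓ)) * (‖v‖ ^ 2 / ((β + n) ^ 2 + (α + m) ^ 2)) := by
    intro v n
    rw [add_comm ((α + (m : ℝ)) ^ 2), mul_comm (4 * Real.pi ^ 2 * (4 : ℝ) ^ ℓ) ((β + (n : ℝ)) ^ 2 + (α + m) ^ 2), ← div_div,
      div_eq_mul_one_div, mul_comm]
  simp_rw [e, ← Finset.mul_sum]
  rw [mul_left_comm]
  refine mul_le_mul_of_nonneg_left ?_ (by positivity)
  rcases eq_or_ne (α + (m : ℝ)) 0 with hb | hb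
  · have hid : ∀ n' ∈ win K, hTransport α β θ K ζ m n' = ζ m n' := by
      intro n' hn'
      rw [hTransport_apply_of_mem α β θ K ζ hm hn']
      have h1 : ∀ y : ℝ, Complex.exp (-((2 * Real.pi * (α + m) * θ * triWave y : ℝ) : ℂ) * Complex.I) = 1 := by
        intro y; rw [hb]; simp
      simp_rw [h1, mul_one]
      rw [integral_blochPoly_mul_conjExp, if_pos hn']
    rw [Finset.sum_congr rfl fun n' hn' => by rw [hid n' hn']]
    have h0 : 0 ≤ ∑ n ∈ win K, ‖ζ m n‖ ^ 2 / ((β + n) ^ 2 + (α + m) ^ 2) := Finset.sum_nonneg fun _ _ => by positivity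
    nlinarith [sq_nonneg θ]
  · rw [Finset.sum_congr rfl fun n' hn' => by rw [hTransport_apply_of_mem α β θ K ζ hm hn']]
    exact transport_energy_duality β θ hb (win K) (win K) (fun n => ζ m n)

/-- **L-i-b BY NAME (H slot).** `cEnergy α β ℓ K (hTransport α β θ K ζ) ≤ (θ² + 2)·cEnergy α β ℓ K ζ`. -/
theorem cEnergy_hTransport_le (α β θ : ℝ) (ℓ K : ℕ) (ζ : CState) :
    cEnergy α β ℓ K (hTransport α β θ K ζ) ≤ (θ ^ 2 + 2) * cEnergy α β ℓ K ζ := by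
  unfold cEnergy
  rw [Finset.mul_sum]
  exact Finset.sum_le_sum fun m hm => hTransport_row_energy_le α β θ ℓ K ζ hm

/-- DEBRIS LINEAGE OUTPUT.  `debrisOut θ K t' s' k ℓ α β ζ` = the energy, at level `ℓ + k + 1` and summed over all
`4^(k+1)` descendant classes, of the output piece `(t', s')` produced by content `ζ` of class `(α, β)` (level `ℓ`) that
travels the DEBRIS path (children ↦ transported by both slots) for `k` phases and then passes one full phase;
`k = 0` is the quantity bounded in `Transfer`.  (WO-p4-K2-4b, `wo_p4_k2_4b.py`, measures the sups for ages `k ≤ 3`.) -/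
def debrisOut (θ : ℝ) (K : ℕ) (t' : PType) (s' : ℕ) : ℕ → ℕ → ℝ → ℝ → CState → ℝ
  | 0, ℓ, α, β, ζ => ∑ pm ∈ parities, ∑ pn ∈ parities,
      outEnergyAt ((α + pm) / 2) ((β + pn) / 2) θ K (ℓ + 1) s'
        (phasePieces ((α + pm) / 2) ((β + pn) / 2) θ K (child pm pn ζ)) t'
  | (k + 1), ℓ, α, β, ζ => ∑ pm ∈ parities, ∑ pn ∈ parities,
      debrisOut θ K t' s' k (ℓ + 1) ((α + pm) / 2) ((β + pn) / 2)
        (phasePieces ((α + pm) / 2) ((β + pn) / 2) θ K (child pm pn ζ)).debris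

/-- RENEWAL (DEBRIS-TRANSFER) ENTRY of age `k ≥ 1`: `D_k[(t', s'), (t, s)] ≤ D` for the parent class `(α, β)` —
the age-`k` debris of an input piece `(t, s)` produces output pieces `(t', s')` of energy ≤ `D²` × the input energy.
No decay in `k` is asked for (the data show persistence, `O→O ≈ 1`, for KH-band debris): the renewal cone below only
needs the entries bounded, uniformly in the age. -/
def DebrisTransfer (α β θ : ℝ) (K k : ℕ) (t : PType) (s : ℕ) (t' : PType) (s' : ℕ) (D : ℝ) : Prop :=
  ∀ d : ℤ → Fin 2 → ℂ, SupportedInW s (alongCoord α β t) K d →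
    debrisOut θ K t' s' k 0 α β (inputState α β θ K t d) ≤ D ^ 2 * cEnergy α β 0 K (inputState α β θ K t d)


/-- Debris states are windowed (the V transport carries the window guard). -/
theorem phasePieces_debris_apply_eq_zero (α β θ : ℝ) (K : ℕ) (ζ : CState) (m n : ℤ) (h : m ∉ win K ∨ n ∉ win K) :
    (phasePieces α β θ K ζ).debris m n = 0 := by
  simp only [phasePieces, vTransport]
  rw [if_neg (by tauto)]

/-- **Debris energy per phase:** `E(debris) ≤ (θ²+2)²·E(ζ)` (both transports, `cEnergy_hTransport_le`, `cEnergy_vTransport_le`). -/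
theorem cEnergy_debris_le (α β θ : ℝ) (ℓ K : ℕ) (ζ : CState) :
    cEnergy α β ℓ K (phasePieces α β θ K ζ).debris ≤ (θ ^ 2 + 2) ^ 2 * cEnergy α β ℓ K ζ := by
  simp only [phasePieces]
  refine (cEnergy_vTransport_le α β θ ℓ K _).trans ?_
  rw [show (θ ^ 2 + 2) ^ 2 * cEnergy α β ℓ K ζ = (θ ^ 2 + 2) * ((θ ^ 2 + 2) * cEnergy α β ℓ K ζ) by ring]
  exact mul_le_mul_of_nonneg_left (cEnergy_hTransport_le α β θ ℓ K ζ) (by positivity)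

/-- The H output of a phase at any level: `outEnergyAt … ℓ s′ (phasePieces … ζ) H ≤ (θ²+2)·16000(π+1)·cEnergy α β ℓ K ζ` (`s′ ≥ 3`, `β ∈ [0,1]`, `θ ∈ [0,8]`). -/
theorem outEnergyAt_H_le_cEnergy {α β : ℝ} (hβ0 : 0 ≤ β) (hβ1 : β ≤ 1) {θ : ℝ} (hθ0 : 0 ≤ θ) (hθ : θ ≤ 8) (K ℓ : ℕ) {s' : ℕ} (hs' : 3 ≤ s')
    (ζ : CState) :
    outEnergyAt α β θ K ℓ s' (phasePieces α β θ K ζ) PType.H ≤ (θ ^ 2 + 2) * (16000 * (Real.pi + 1)) * cEnergy α β ℓ K ζ := by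
  simp only [outEnergyAt, phasePieces]
  refine (cEnergy_vTransport_le α β θ ℓ K _).trans ?_
  rw [mul_assoc]
  exact mul_le_mul_of_nonneg_left (cEnergy_hPairState_fresh_le hβ0 hβ1 hθ0 hθ ℓ K hs' ζ) (by positivity)

/-- **THE DEBRIS LINEAGE INTO H TARGETS, every age, every level, every windowed content** (`β ∈ [0,1)`, `θ ∈ [0,8]`, `s′ ≥ 3`):
`debrisOut θ K H s′ k ℓ α β ζ ≤ ((θ²+2)²)^k·(θ²+2)·16000(π+1)·cEnergy α β ℓ K ζ` — induction on the age: re-framing `sum_cEnergy_child_le`, debris `cEnergy_debris_le`,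
last phase `outEnergyAt_H_le_cEnergy`. -/
theorem debrisOut_H_le {θ : ℝ} (hθ0 : 0 ≤ θ) (hθ : θ ≤ 8) {s' : ℕ} (hs' : 3 ≤ s') (K : ℕ) :
    ∀ (k ℓ : ℕ) (α β : ℝ) (ζ : CState), 0 ≤ β → β < 1 → (∀ m n : ℤ, (m ∉ win K ∨ n ∉ win K) → ζ m n = 0) →
      debrisOut θ K PType.H s' k ℓ α β ζ ≤ ((θ ^ 2 + 2) ^ 2) ^ k * ((θ ^ 2 + 2) * (16000 * (Real.pi + 1))) * cEnergy α β ℓ K ζ := by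
  intro k
  induction k with
  | zero =>
    intro ℓ α β ζ hβ0 hβ1 hζ
    simp only [debrisOut, pow_zero, one_mul]
    have hchild : ∀ pm ∈ parities, ∀ pn ∈ parities,
        outEnergyAt ((α + pm) / 2) ((β + pn) / 2) θ K (ℓ + 1) s' (phasePieces ((α + pm) / 2) ((β + pn) / 2) θ K (child pm pn ζ)) PType.H ≤
          (θ ^ 2 + 2) * (16000 * (Real.pi + 1)) * cEnergy ((α + pm) / 2) ((β + pn) / 2) (ℓ + 1) K (child pm pn ζ) := by
      intro pm _ pn hpn
      have hpn' : (pn : ℝ) = 0 ∨ (pn : ℝ) = 1 := by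
        have : pn = 0 ∨ pn = 1 := by simpa [parities] using hpn
        rcases this with h | h <;> simp [h]
      have hb0 : 0 ≤ (β + pn) / 2 := by rcases hpn' with h | h <;> rw [h] <;> linarith
      have hb1 : (β + pn) / 2 ≤ 1 := by rcases hpn' with h | h <;> rw [h] <;> linarith
      exact outEnergyAt_H_le_cEnergy hb0 hb1 hθ0 hθ K (ℓ + 1) hs' _
    calc (∑ pm ∈ parities, ∑ pn ∈ parities,
            outEnergyAt ((α + pm) / 2) ((β + pn) / 2) θ K (ℓ + 1) s' (phasePieces ((α + pm) / 2) ((β + pn) / 2) θ K (child pm pn ζ)) PType.H)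
        ≤ ∑ pm ∈ parities, ∑ pn ∈ parities, (θ ^ 2 + 2) * (16000 * (Real.pi + 1)) * cEnergy ((α + pm) / 2) ((β + pn) / 2) (ℓ + 1) K (child pm pn ζ) :=
          Finset.sum_le_sum fun pm hpm => Finset.sum_le_sum fun pn hpn => hchild pm hpm pn hpn
      _ = (θ ^ 2 + 2) * (16000 * (Real.pi + 1)) * ∑ pm ∈ parities, ∑ pn ∈ parities, cEnergy ((α + pm) / 2) ((β + pn) / 2) (ℓ + 1) K (child pm pn ζ) := by
          rw [Finset.mul_sum]; refine Finset.sum_congr rfl fun pm _ => ?_; rw [Finset.mul_sum]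
      _ ≤ (θ ^ 2 + 2) * (16000 * (Real.pi + 1)) * cEnergy α β ℓ K ζ :=
          mul_le_mul_of_nonneg_left (sum_cEnergy_child_le α β ℓ K ζ hζ) (by positivity)
  | succ k ih =>
    intro ℓ α β ζ hβ0 hβ1 hζ
    simp only [debrisOut]
    have hchild : ∀ pm ∈ parities, ∀ pn ∈ parities,
        debrisOut θ K PType.H s' k (ℓ + 1) ((α + pm) / 2) ((β + pn) / 2) (phasePieces ((α + pm) / 2) ((β + pn) / 2) θ K (child pm pn ζ)).debris ≤
          ((θ ^ 2 + 2) ^ 2) ^ k * ((θ ^ 2 + 2) * (16000 * (Real.pi + 1))) * ((θ ^ 2 + 2) ^ 2 * cEnergy ((α + pm) / 2) ((β + pn) / 2) (ℓ + 1) K (child pm pn ζ)) := by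
      intro pm _ pn hpn
      have hpn' : (pn : ℝ) = 0 ∨ (pn : ℝ) = 1 := by
        have : pn = 0 ∨ pn = 1 := by simpa [parities] using hpn
        rcases this with h | h <;> simp [h]
      have hb0 : 0 ≤ (β + pn) / 2 := by rcases hpn' with h | h <;> rw [h] <;> linarith
      have hb1 : (β + pn) / 2 < 1 := by rcases hpn' with h | h <;> rw [h] <;> linarith
      refine (ih (ℓ + 1) _ _ _ hb0 hb1 fun m n h => phasePieces_debris_apply_eq_zero _ _ θ K _ m n h).trans ?_
      exact mul_le_mul_of_nonneg_left (cEnergy_debris_le _ _ θ (ℓ + 1) K _) (by positivity)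
    calc (∑ pm ∈ parities, ∑ pn ∈ parities,
            debrisOut θ K PType.H s' k (ℓ + 1) ((α + pm) / 2) ((β + pn) / 2) (phasePieces ((α + pm) / 2) ((β + pn) / 2) θ K (child pm pn ζ)).debris)
        ≤ ∑ pm ∈ parities, ∑ pn ∈ parities,
            ((θ ^ 2 + 2) ^ 2) ^ k * ((θ ^ 2 + 2) * (16000 * (Real.pi + 1))) * ((θ ^ 2 + 2) ^ 2 * cEnergy ((α + pm) / 2) ((β + pn) / 2) (ℓ + 1) K (child pm pn ζ)) :=
          Finset.sum_le_sum fun pm hpm => Finset.sum_le_sum fun pn hpn => hchild pm hpm pn hpn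
      _ = ((θ ^ 2 + 2) ^ 2) ^ k * ((θ ^ 2 + 2) * (16000 * (Real.pi + 1))) * (θ ^ 2 + 2) ^ 2 *
            ∑ pm ∈ parities, ∑ pn ∈ parities, cEnergy ((α + pm) / 2) ((β + pn) / 2) (ℓ + 1) K (child pm pn ζ) := by
          rw [Finset.mul_sum]; refine Finset.sum_congr rfl fun pm _ => ?_; rw [Finset.mul_sum]
          exact Finset.sum_congr rfl fun pn _ => by ring
      _ ≤ ((θ ^ 2 + 2) ^ 2) ^ k * ((θ ^ 2 + 2) * (16000 * (Real.pi + 1))) * (θ ^ 2 + 2) ^ 2 * cEnergy α β ℓ K ζ :=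
          mul_le_mul_of_nonneg_left (sum_cEnergy_child_le α β ℓ K ζ hζ) (by positivity)
      _ = ((θ ^ 2 + 2) ^ 2) ^ (k + 1) * ((θ ^ 2 + 2) * (16000 * (Real.pi + 1))) * cEnergy α β ℓ K ζ := by rw [pow_succ]; ring

/-- **DEBRIS-TRANSFER ENTRIES INTO H TARGETS, BY NAME, EVERY AGE** (memo §22′ (a); `EntryBoundsW`'s `DebrisTransfer` clause for every cell `(·,·) → (H, s′ ≥ 3)`):
for every class with `β ∈ [0,1)` (any `α`), strain `θ ∈ [0,8]`, truncation `K`, age `k`, input type/shell: `DebrisTransfer α β θ K k t s H s′ (2100·66^k)`.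
A TRUE bound at every age (the renewal cone's numbers are the engine's: conjecture C-D4; `66^k` is not summable against `ρ = 53.6`). -/
theorem debrisTransfer_to_H (α : ℝ) {β : ℝ} (hβ0 : 0 ≤ β) (hβ1 : β < 1) {θ : ℝ} (hθ0 : 0 ≤ θ) (hθ : θ ≤ 8) (K k : ℕ)
    (t : PType) (s : ℕ) {s' : ℕ} (hs' : 3 ≤ s') :
    DebrisTransfer α β θ K k t s PType.H s' (2100 * 66 ^ k) := by
  intro d _
  set Z := inputState α β θ K t d with hZ
  have hZw : ∀ m n : ℤ, (m ∉ win K ∨ n ∉ win K) → Z m n = 0 := fun m n h => inputState_apply_eq_zero α β θ K t d m n h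
  have hE0 : 0 ≤ cEnergy α β 0 K Z := Finset.sum_nonneg fun _ _ => Finset.sum_nonneg fun _ _ => by positivity
  refine (debrisOut_H_le hθ0 hθ hs' K k 0 α β Z hβ0 hβ1 hZw).trans (mul_le_mul_of_nonneg_right ?_ hE0)
  have hθ2 : (θ ^ 2 + 2) * (16000 * (Real.pi + 1)) ≤ (2100 : ℝ) ^ 2 := by
    have hπ : Real.pi < 3.1416 := Real.pi_lt_d4
    nlinarith
  have h66 : (θ ^ 2 + 2) ^ 2 ≤ (66 : ℝ) ^ 2 := pow_le_pow_left₀ (by positivity) (by nlinarith) 2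
  have hk : ((θ ^ 2 + 2) ^ 2) ^ k ≤ ((66 : ℝ) ^ 2) ^ k := pow_le_pow_left₀ (by positivity) h66 k
  calc ((θ ^ 2 + 2) ^ 2) ^ k * ((θ ^ 2 + 2) * (16000 * (Real.pi + 1))) ≤ ((66 : ℝ) ^ 2) ^ k * (2100 : ℝ) ^ 2 :=
        mul_le_mul hk hθ2 (by positivity) (by positivity)
    _ = (2100 * 66 ^ k) ^ 2 := by rw [← pow_mul, mul_pow, ← pow_mul, mul_comm 2 k]; ring


/-! ## §26 (p2 g12) THE LINES `|a| ≥ 1`: the energy-form creation law down to the proved stability threshold (tree `…KHModePairedCreationOne`, p718303: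
near weight `8.6/a` from the PAIRED factor, far `176a/ξ²`, square sum `≤ 640000a`; structure only) -/

/-- The per-mode creation weight at `a ≥ 1`: `≤ 8.6/a` (`|ξ| < 16a`, paired factor) and `≤ 176a/ξ²` beyond. -/
theorem norm_sheetAmps_singleMode_best_one {a : ℝ} (ha : 1 ≤ a) (β : ℝ) (n : ℤ) {θ : ℝ} (hθ0 : 0 ≤ θ) (hθ : θ ≤ 8) (i : Fin 2) :
    ‖sheetAmps a β θ (singleMode (β + n)) i‖ ≤ if |β + (n : ℝ)| < 16 * a then 8.6 / a else 176 * a / (β + n) ^ 2 := by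
  have ha0 : 0 < a := by linarith
  have hp := norm_sheetAmps_singleMode_paired ha β n hθ0 i
  split_ifs with h
  · exact hp.trans (paired_mode_factor_le_one ha β (β + n) hθ0 hθ)
  · have hfar : 16 * a ≤ |β + (n : ℝ)| := not_lt.mp h
    refine hp.trans ((paired_mode_factor_far_le_one ha β (β + n) hθ0 hθ hfar).trans ?_)
    have hu : 16 ≤ |(β + n) / a| := by rw [abs_div, abs_of_pos ha0, le_div_iff₀ ha0]; linarith
    have hξ2 : (β + (n : ℝ)) ^ 2 = a ^ 2 * |(β + n) / a| ^ 2 := by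
      rw [abs_div, abs_of_pos ha0, div_pow, sq_abs]; field_simp
    have hpos : 0 < (β + (n : ℝ)) ^ 2 := by rw [hξ2]; positivity
    rw [div_le_div_iff₀ (by positivity) hpos, hξ2]
    nlinarith [sq_nonneg (|(β + ↑n) / a| - 16), ha0, mul_pos ha0 ha0, sq_nonneg a]

/-- **THE ENERGY-FORM CREATION LAW, positive lines** (`a ≥ 1`, `|β| ≤ 1`, `0 ≤ θ ≤ 8`, any window `K`, ANY profile `c`):
`‖sheetAmps a β θ ⟨modeProfile β K c, []⟩ i‖² ≤ 640000·a·Σ_{|n|≤K} ‖c n‖²/(a²+(β+n)²)` — linearity over modes, the best per-mode weight, Cauchy–Schwarz and the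
square sum of the weights (`sum_sq_creationWeight_le_one`, tree p718303). Uniform in the window ONLY through the `1/ξ²` far law. -/
theorem norm_sq_sheetAmps_modeProfile_le_one {a : ℝ} (ha : 1 ≤ a) {β : ℝ} (hβ : |β| ≤ 1) {θ : ℝ} (hθ0 : 0 ≤ θ) (hθ : θ ≤ 8) (K : ℕ)
    (c : ℤ → ℂ) (i : Fin 2) :
    ‖sheetAmps a β θ ⟨modeProfile β K c, []⟩ i‖ ^ 2 ≤ 640000 * a * ∑ n ∈ win K, ‖c n‖ ^ 2 / (a ^ 2 + (β + n) ^ 2) := by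
  have ha0 : 0 < a := by linarith
  have ha1 : 1 ≤ a := by linarith
  -- linearity over the modes and the per-mode weights
  have hlin : ‖sheetAmps a β θ ⟨modeProfile β K c, []⟩ i‖ ≤
      ∑ n ∈ win K, ‖c n‖ * (if |β + (n : ℝ)| < 16 * a then 8.6 / a else 176 * a / (β + n) ^ 2) := by
    rw [sheetAmps_modeProfile ha1 β θ K c, Finset.sum_apply]
    refine (norm_sum_le _ _).trans (Finset.sum_le_sum fun n _ => ?_)
    rw [Pi.smul_apply, norm_smul]
    exact mul_le_mul_of_nonneg_left (norm_sheetAmps_singleMode_best_one ha β n hθ0 hθ i) (norm_nonneg _)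
  have hsum0 : 0 ≤ ∑ n ∈ win K, ‖c n‖ * (if |β + (n : ℝ)| < 16 * a then 8.6 / a else 176 * a / (β + n) ^ 2) :=
    Finset.sum_nonneg fun n _ => mul_nonneg (norm_nonneg _) (by split_ifs <;> positivity)
  -- Cauchy–Schwarz with `f = ‖c‖²/(a²+ξ²)`, `g = W²(a²+ξ²)`
  have hCS := Finset.sum_sq_le_sum_mul_sum_of_sq_le_mul (win K)
    (r := fun n : ℤ => ‖c n‖ * (if |β + (n : ℝ)| < 16 * a then 8.6 / a else 176 * a / (β + n) ^ 2))
    (f := fun n : ℤ => ‖c n‖ ^ 2 / (a ^ 2 + (β + n) ^ 2))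
    (g := fun n : ℤ => if |β + (n : ℝ)| < 16 * a then (8.6 / a) ^ 2 * (a ^ 2 + (β + n) ^ 2) else (176 * a / (β + n) ^ 2) ^ 2 * (a ^ 2 + (β + n) ^ 2))
    (fun n _ => by positivity) (fun n _ => by split_ifs <;> positivity) (fun n _ => le_of_eq ?_)
  · have hW := sum_sq_creationWeight_le_one ha hβ K
    have hwin : win K = Finset.Icc (-(K : ℤ)) K := rfl
    rw [← hwin] at hW
    have hf0 : 0 ≤ ∑ n ∈ win K, ‖c n‖ ^ 2 / (a ^ 2 + (β + n) ^ 2) := Finset.sum_nonneg fun n _ => by positivity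
    calc ‖sheetAmps a β θ ⟨modeProfile β K c, []⟩ i‖ ^ 2
        ≤ (∑ n ∈ win K, ‖c n‖ * (if |β + (n : ℝ)| < 16 * a then 8.6 / a else 176 * a / (β + n) ^ 2)) ^ 2 :=
          pow_le_pow_left₀ (norm_nonneg _) hlin 2
      _ ≤ (∑ n ∈ win K, ‖c n‖ ^ 2 / (a ^ 2 + (β + n) ^ 2)) *
            ∑ n ∈ win K, (if |β + (n : ℝ)| < 16 * a then (8.6 / a) ^ 2 * (a ^ 2 + (β + n) ^ 2)
              else (176 * a / (β + n) ^ 2) ^ 2 * (a ^ 2 + (β + n) ^ 2)) := hCS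
      _ ≤ (∑ n ∈ win K, ‖c n‖ ^ 2 / (a ^ 2 + (β + n) ^ 2)) * (640000 * a) := mul_le_mul_of_nonneg_left hW hf0
      _ = 640000 * a * ∑ n ∈ win K, ‖c n‖ ^ 2 / (a ^ 2 + (β + n) ^ 2) := by ring
  · -- `r² = f·g`
    have hpos : 0 < a ^ 2 + (β + (n : ℝ)) ^ 2 := by positivity
    split_ifs <;> field_simp

/-- **THE ENERGY-FORM CREATION LAW, negative lines** (`a ≤ −1`; by the conjugation symmetry `(a,β,ξ) ↦ (−a,−β,−ξ)` of §17). -/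
theorem norm_sq_sheetAmps_modeProfile_le_of_neg_one {a : ℝ} (ha : a ≤ -1) {β : ℝ} (hβ : |β| ≤ 1) {θ : ℝ} (hθ0 : 0 ≤ θ) (hθ : θ ≤ 8) (K : ℕ)
    (c : ℤ → ℂ) (i : Fin 2) :
    ‖sheetAmps a β θ ⟨modeProfile β K c, []⟩ i‖ ^ 2 ≤ 640000 * |a| * ∑ n ∈ win K, ‖c n‖ ^ 2 / (a ^ 2 + (β + n) ^ 2) := by
  have ha' : 1 ≤ -a := by linarith
  have ha1 : 1 ≤ -a := by linarith
  have hc : (fun n : ℤ => starRingEnd ℂ ((fun n : ℤ => starRingEnd ℂ (c (-n))) (-n))) = c := by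
    funext n; simp
  have h := sheetAmps_neg_neg_modeProfile ha1 (-β) θ K (fun n => starRingEnd ℂ (c (-n))) i
  rw [neg_neg, neg_neg, hc] at h
  rw [h, Complex.norm_conj, abs_of_neg (by linarith)]
  have hβ' : |-β| ≤ 1 := by rwa [abs_neg]
  refine (norm_sq_sheetAmps_modeProfile_le_one ha' hβ' hθ0 hθ K (fun n => starRingEnd ℂ (c (-n))) i).trans (le_of_eq ?_)
  congr 1
  refine Finset.sum_nbij' (fun n => -n) (fun n => -n) (fun n hn => by simp only [win, Finset.mem_Icc] at hn ⊢; omega)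
    (fun n hn => by simp only [win, Finset.mem_Icc] at hn ⊢; omega) (fun n _ => neg_neg n) (fun n _ => neg_neg n) (fun n _ => ?_)
  rw [Complex.norm_conj]
  push_cast
  ring

/-- **The energy-form law on every far line** (`|a| ≥ 1`): `‖q_i‖² ≤ 640000·|a|·Σ_n ‖c n‖²/(a²+(β+n)²)`. -/
theorem norm_sq_sheetAmps_modeProfile_le_abs_one {a : ℝ} (ha : 1 ≤ |a|) {β : ℝ} (hβ : |β| ≤ 1) {θ : ℝ} (hθ0 : 0 ≤ θ) (hθ : θ ≤ 8) (K : ℕ)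
    (c : ℤ → ℂ) (i : Fin 2) :
    ‖sheetAmps a β θ ⟨modeProfile β K c, []⟩ i‖ ^ 2 ≤ 640000 * |a| * ∑ n ∈ win K, ‖c n‖ ^ 2 / (a ^ 2 + (β + n) ^ 2) := by
  rcases le_or_gt 0 a with h | h
  · rw [abs_of_nonneg h] at ha ⊢
    exact norm_sq_sheetAmps_modeProfile_le_one ha hβ hθ0 hθ K c i
  · have : a ≤ -1 := by rw [abs_of_neg h] at ha; linarith
    exact norm_sq_sheetAmps_modeProfile_le_of_neg_one this hβ hθ0 hθ K c i



/-! ## §27 (p2 g12) THE ENTRY CLAUSE MODULO ONE NAMED LAW ON THE UNIT STRIP: `EntryBoundsW θ 0 M D` — every cell, class, truncation and age — from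
`CoreLineLaw C` = the creation law on the lines `|a| < 1` in EXACT LINE-ENERGY form (v2: the created straight pair is measured by its own lattice line energy
`lineEnergyOut`, not by the lossy weight `π/|a| + 4/a²`, which over-penalises `a → 0⁺`).  All lines `|a| ≥ 1` are PROVED (§26).  Numbers remain the engines'. -/

/-! ### copies (verbatim, K2AssemblyS4 §2/§3): `Idx`, `EntryBoundsW` -/

/-- The bookkeeping index: (piece type, shell). -/
abbrev Idx : Type := PType × ℕ

/-- **`EntryBoundsW θ K₀ M D`** — the ENTRY CLAUSE of `RenewalConeInvariant` over the v1.3 (window-corrected, F1) predicates: `M i j` bounds the fresh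
shell-transfer entry `j ↦ i` and `D k i j` the age-`k` debris-transfer entry, uniformly in the truncation `K ≥ K₀` and the class `(α, β) ∈ [0,1)²`.
This is the `Adm` the assembly is instantiated with. -/
def EntryBoundsW (θ : ℝ) (K₀ : ℕ) (M : Idx → Idx → ℝ) (D : ℕ → Idx → Idx → ℝ) : Prop :=
  ∀ K : ℕ, K₀ ≤ K → ∀ α β : ℝ, α ∈ Set.Ico (0 : ℝ) 1 → β ∈ Set.Ico (0 : ℝ) 1 →
    ∀ i j : Idx, Transfer α β θ K j.1 j.2 i.1 i.2 (M i j) ∧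
      ∀ k : ℕ, 1 ≤ k → DebrisTransfer α β θ K k j.1 j.2 i.1 i.2 (D k i j)


/-- **The zero line creates nothing** (the forcing carries the factor `2πa`). -/
theorem sheetAmps_zero_line (b θ : ℝ) (st : LamState) : sheetAmps 0 b θ st = 0 := by
  have hf : ∀ s : ℝ, forcing 0 b st s = 0 := by
    intro s; funext i
    simp only [forcing, mul_zero, Complex.ofReal_zero, zero_mul, Pi.zero_apply]
    fin_cases i <;> simp
  unfold sheetAmps
  simp only [hf, Matrix.mulVec_zero, intervalIntegral.integral_zero]

/-- The (level-stripped) LATTICE LINE ENERGY of a straight sheet pair with amplitudes `q` on the line `a`, Bloch offset `b`, window `K`: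
`Σ_{|n| ≤ K} ‖q₀e^{−iπ(b+n)/2} + q₁e^{iπ(b+n)/2}‖²/(a² + (b+n)²)` — one row of `cEnergy (hPairState …)`, one column of `cEnergy (vPairState …)`, times `4π²4^ℓ`. -/
def lineEnergyOut (a b : ℝ) (K : ℕ) (q : Fin 2 → ℂ) : ℝ :=
  ∑ n ∈ win K, ‖q 0 * Complex.exp (-(Real.pi * (b + n) / 2 : ℝ) * Complex.I) + q 1 * Complex.exp ((Real.pi * (b + n) / 2 : ℝ) * Complex.I)‖ ^ 2 /
    (a ^ 2 + (b + n) ^ 2)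

/-- **B1 AS ONE PROP — the CORE-LINE CREATION LAW on the unit strip, exact energy form, constant `C`:** on every line `|a| < 1`, for every Bloch offset
`b ∈ [0,1]`, strain `θ ∈ [0,8]`, window `K` and profile `c`, the lattice line energy of the created straight pair is at most `C ×` the line's input energy
`Σ_{|n| ≤ K} ‖c n‖²/(a² + (b+n)²)` (uniformity in `K`, in `b`, and in `a → 0⁺` is the content; the zero line itself creates nothing). -/
def CoreLineLaw (C : ℝ) : Prop :=
  ∀ (a b θ : ℝ) (K : ℕ) (c : ℤ → ℂ), |a| < 1 → 0 ≤ b → b ≤ 1 → 0 ≤ θ → θ ≤ 8 →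
    lineEnergyOut a b K (sheetAmps a b θ ⟨modeProfile b K c, []⟩) ≤ C * ∑ n ∈ win K, ‖c n‖ ^ 2 / (a ^ 2 + (b + n) ^ 2)

/-- The same law on EVERY line. -/
def LineLaw (C : ℝ) : Prop :=
  ∀ (a b θ : ℝ) (K : ℕ) (c : ℤ → ℂ), 0 ≤ b → b ≤ 1 → 0 ≤ θ → θ ≤ 8 →
    lineEnergyOut a b K (sheetAmps a b θ ⟨modeProfile b K c, []⟩) ≤ C * ∑ n ∈ win K, ‖c n‖ ^ 2 / (a ^ 2 + (b + n) ^ 2)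

/-- The line energy against the lossy weight (`vPair_column_energy_upper`): `≤ (‖q₀‖² + ‖q₁‖²)(π/|a| + 4/a²)` off the zero line. -/
theorem lineEnergyOut_le_weight {a : ℝ} (ha : a ≠ 0) {b : ℝ} (hb0 : 0 ≤ b) (hb1 : b ≤ 1) (K : ℕ) (q : Fin 2 → ℂ) :
    lineEnergyOut a b K q ≤ (‖q 0‖ ^ 2 + ‖q 1‖ ^ 2) * (Real.pi / |a| + 4 / a ^ 2) := by
  have h := vPair_column_energy_upper hb0 hb1 ha K (q 0) (q 1)
  refine le_of_eq_of_le ?_ h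
  unfold lineEnergyOut
  exact Finset.sum_congr rfl fun n _ => by rw [add_comm (a ^ 2)]

/-- **The lines `|a| ≥ 1` are PROVED** (§26): `LineLaw`-inequality with constant `1280000(π+4)`. -/
theorem lineLaw_one {a b θ : ℝ} (ha : 1 ≤ |a|) (hb0 : 0 ≤ b) (hb1 : b ≤ 1) (hθ0 : 0 ≤ θ) (hθ : θ ≤ 8) (K : ℕ) (c : ℤ → ℂ) :
    lineEnergyOut a b K (sheetAmps a b θ ⟨modeProfile b K c, []⟩) ≤ 1280000 * (Real.pi + 4) * ∑ n ∈ win K, ‖c n‖ ^ 2 / (a ^ 2 + (b + n) ^ 2) := by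
  have hb : |b| ≤ 1 := abs_le.2 ⟨by linarith, hb1⟩
  have hq := fun i => norm_sq_sheetAmps_modeProfile_le_abs_one ha hb hθ0 hθ K c i
  have ha0 : 0 < |a| := by linarith
  have hane : a ≠ 0 := abs_pos.mp ha0
  have hS0 : 0 ≤ ∑ n ∈ win K, ‖c n‖ ^ 2 / (a ^ 2 + (b + n) ^ 2) := Finset.sum_nonneg fun _ _ => by positivity
  have hw : Real.pi / |a| + 4 / a ^ 2 ≤ (Real.pi + 4) / |a| := by
    have h1 : 4 / a ^ 2 ≤ 4 / |a| := by
      rw [← sq_abs a, div_le_div_iff₀ (by positivity) ha0]; nlinarith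
    have e : (Real.pi + 4) / |a| = Real.pi / |a| + 4 / |a| := by ring
    linarith
  calc lineEnergyOut a b K (sheetAmps a b θ ⟨modeProfile b K c, []⟩)
      ≤ (‖sheetAmps a b θ ⟨modeProfile b K c, []⟩ 0‖ ^ 2 + ‖sheetAmps a b θ ⟨modeProfile b K c, []⟩ 1‖ ^ 2) * (Real.pi / |a| + 4 / a ^ 2) :=
        lineEnergyOut_le_weight hane hb0 hb1 K _
    _ ≤ (2 * (640000 * |a| * ∑ n ∈ win K, ‖c n‖ ^ 2 / (a ^ 2 + (b + n) ^ 2))) * ((Real.pi + 4) / |a|) :=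
        mul_le_mul (by linarith [hq 0, hq 1]) hw (by positivity) (by positivity)
    _ = 1280000 * (Real.pi + 4) * ∑ n ∈ win K, ‖c n‖ ^ 2 / (a ^ 2 + (b + n) ^ 2) := by field_simp; ring

/-- `CoreLineLaw C → LineLaw (max C (1280000(π+4)))`. -/
theorem lineLaw_of_core {C : ℝ} (hC : CoreLineLaw C) : LineLaw (max C (1280000 * (Real.pi + 4))) := by
  intro a b θ K c hb0 hb1 hθ0 hθ
  have hS0 : 0 ≤ ∑ n ∈ win K, ‖c n‖ ^ 2 / (a ^ 2 + (b + n) ^ 2) := Finset.sum_nonneg fun _ _ => by positivity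
  rcases le_or_gt 1 |a| with ha | ha
  · exact (lineLaw_one ha hb0 hb1 hθ0 hθ K c).trans (mul_le_mul_of_nonneg_right (le_max_right _ _) hS0)
  · exact (hC a b θ K c ha hb0 hb1 hθ0 hθ).trans (mul_le_mul_of_nonneg_right (le_max_left _ _) hS0)

/-- `cEnergy` of an H pair, row by row, IS the sum of the line energies. -/
theorem cEnergy_hPairState_eq (α β : ℝ) (ℓ K : ℕ) (Q : ℤ → Fin 2 → ℂ) :
    cEnergy α β ℓ K (hPairState β Q) = (1 / (4 * Real.pi ^ 2 * (4 : ℝ) ^ ℓ)) * ∑ m ∈ win K, lineEnergyOut (α + m) β K (Q m) := by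
  unfold cEnergy lineEnergyOut
  simp only [hPairState]
  rw [Finset.mul_sum]
  refine Finset.sum_congr rfl fun m _ => ?_
  rw [Finset.mul_sum]
  refine Finset.sum_congr rfl fun n _ => ?_
  rw [mul_comm (4 * Real.pi ^ 2 * (4 : ℝ) ^ ℓ) ((α + (m : ℝ)) ^ 2 + (β + n) ^ 2), ← div_div, div_eq_mul_one_div, mul_comm]

/-- `cEnergy` of a V pair, column by column, IS the sum of the line energies. -/
theorem cEnergy_vPairState_eq (α β : ℝ) (ℓ K : ℕ) (P : ℤ → Fin 2 → ℂ) :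
    cEnergy α β ℓ K (vPairState α P) = (1 / (4 * Real.pi ^ 2 * (4 : ℝ) ^ ℓ)) * ∑ n ∈ win K, lineEnergyOut (β + n) α K (P n) := by
  unfold cEnergy lineEnergyOut
  rw [Finset.sum_comm]
  simp only [vPairState]
  rw [Finset.mul_sum]
  refine Finset.sum_congr rfl fun n _ => ?_
  rw [Finset.mul_sum]
  refine Finset.sum_congr rfl fun m _ => ?_
  rw [add_comm ((β + (n : ℝ)) ^ 2), mul_comm (4 * Real.pi ^ 2 * (4 : ℝ) ^ ℓ) ((α + (m : ℝ)) ^ 2 + (β + n) ^ 2), ← div_div,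
    div_eq_mul_one_div, mul_comm]

/-- The empty pair has no line energy. -/
theorem lineEnergyOut_zero (a b : ℝ) (K : ℕ) : lineEnergyOut a b K 0 = 0 := by
  unfold lineEnergyOut; simp

/-- **Rows:** an H pair whose densities are, row by row, either zero or the fresh densities of `ζ`, has energy `≤ C·E(ζ)`. -/
theorem cEnergy_hPairState_le_of_rows {C : ℝ} (hL : LineLaw C) (hC : 0 ≤ C) {α β : ℝ} (hβ0 : 0 ≤ β) (hβ1 : β ≤ 1) {θ : ℝ} (hθ0 : 0 ≤ θ)
    (hθ : θ ≤ 8) (ℓ K : ℕ) (ζ : CState) (Q : ℤ → Fin 2 → ℂ) (hQ : ∀ m : ℤ, Q m = 0 ∨ (m ∈ win K ∧ Q m = hFresh α β θ K ζ m)) :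
    cEnergy α β ℓ K (hPairState β Q) ≤ C * cEnergy α β ℓ K ζ := by
  rw [cEnergy_hPairState_eq]
  have hper : ∀ m ∈ win K, lineEnergyOut (α + m) β K (Q m) ≤ C * ∑ n ∈ win K, ‖ζ m n‖ ^ 2 / ((α + m) ^ 2 + (β + n) ^ 2) := by
    intro m hm
    rcases hQ m with h | ⟨_, h⟩
    · rw [h, lineEnergyOut_zero]
      exact mul_nonneg hC (Finset.sum_nonneg fun _ _ => by positivity)
    · rw [h]; simp only [hFresh, if_pos hm]
      exact hL (α + m) β θ K (ζ m) hβ0 hβ1 hθ0 hθ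
  calc 1 / (4 * Real.pi ^ 2 * (4 : ℝ) ^ ℓ) * ∑ m ∈ win K, lineEnergyOut (α + m) β K (Q m)
      ≤ 1 / (4 * Real.pi ^ 2 * (4 : ℝ) ^ ℓ) * ∑ m ∈ win K, C * ∑ n ∈ win K, ‖ζ m n‖ ^ 2 / ((α + m) ^ 2 + (β + n) ^ 2) :=
        mul_le_mul_of_nonneg_left (Finset.sum_le_sum hper) (by positivity)
    _ = C * cEnergy α β ℓ K ζ := by
        unfold cEnergy
        simp only [Finset.mul_sum]
        refine Finset.sum_congr rfl fun m _ => Finset.sum_congr rfl fun n _ => ?_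
        field_simp

/-- **Columns:** a V pair whose densities are, column by column, either zero or the fresh V densities of `S`, has energy `≤ C·E(S)` (`α ∈ [0,1]`). -/
theorem cEnergy_vPairState_le_of_cols {C : ℝ} (hL : LineLaw C) (hC : 0 ≤ C) {α β : ℝ} (hα0 : 0 ≤ α) (hα1 : α ≤ 1) {θ : ℝ} (hθ0 : 0 ≤ θ)
    (hθ : θ ≤ 8) (ℓ K : ℕ) (S : CState) (P : ℤ → Fin 2 → ℂ) (hP : ∀ n : ℤ, P n = 0 ∨ (n ∈ win K ∧ P n = vFresh α β θ K S n)) :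
    cEnergy α β ℓ K (vPairState α P) ≤ C * cEnergy α β ℓ K S := by
  rw [cEnergy_vPairState_eq]
  have hper : ∀ n ∈ win K, lineEnergyOut (β + n) α K (P n) ≤ C * ∑ m ∈ win K, ‖S m n‖ ^ 2 / ((β + n) ^ 2 + (α + m) ^ 2) := by
    intro n hn
    rcases hP n with h | ⟨_, h⟩
    · rw [h, lineEnergyOut_zero]
      exact mul_nonneg hC (Finset.sum_nonneg fun _ _ => by positivity)
    · rw [h]; simp only [vFresh, if_pos hn]
      exact hL (β + n) α θ K (fun m => S m n) hα0 hα1 hθ0 hθ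
  calc 1 / (4 * Real.pi ^ 2 * (4 : ℝ) ^ ℓ) * ∑ n ∈ win K, lineEnergyOut (β + n) α K (P n)
      ≤ 1 / (4 * Real.pi ^ 2 * (4 : ℝ) ^ ℓ) * ∑ n ∈ win K, C * ∑ m ∈ win K, ‖S m n‖ ^ 2 / ((β + n) ^ 2 + (α + m) ^ 2) :=
        mul_le_mul_of_nonneg_left (Finset.sum_le_sum hper) (by positivity)
    _ = ∑ n ∈ win K, ∑ m ∈ win K, C * (‖S m n‖ ^ 2 / (4 * Real.pi ^ 2 * (4 : ℝ) ^ ℓ * ((α + m) ^ 2 + (β + n) ^ 2))) := by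
        rw [Finset.mul_sum]
        refine Finset.sum_congr rfl fun n _ => ?_
        rw [Finset.mul_sum, Finset.mul_sum]
        refine Finset.sum_congr rfl fun m _ => ?_
        rw [add_comm ((β + (n : ℝ)) ^ 2) ((α + (m : ℝ)) ^ 2)]
        field_simp
    _ = C * cEnergy α β ℓ K S := by
        unfold cEnergy
        rw [Finset.sum_comm, Finset.mul_sum]
        refine Finset.sum_congr rfl fun m _ => ?_
        rw [Finset.mul_sum]

/-- The shell-restricted fresh H densities are row-wise zero or fresh. -/
theorem restrictShell_hFresh_rows (s' : ℕ) (α β θ : ℝ) (K : ℕ) (ζ : CState) (m : ℤ) :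
    restrictShell s' α (hFresh α β θ K ζ) m = 0 ∨ (m ∈ win K ∧ restrictShell s' α (hFresh α β θ K ζ) m = hFresh α β θ K ζ m) := by
  by_cases hsh : shellLo s' ≤ |α + (m : ℝ)| ∧ |α + (m : ℝ)| < shellHi s'
  · by_cases hm : m ∈ win K
    · right; exact ⟨hm, by funext i; simp [restrictShell, hsh]⟩
    · left; funext i; simp [restrictShell, hFresh, hm]
  · left; funext i; simp only [restrictShell, if_neg hsh, Pi.zero_apply]

/-- The shell-restricted fresh V densities are column-wise zero or fresh. -/
theorem restrictShell_vFresh_cols (s' : ℕ) (α β θ : ℝ) (K : ℕ) (S : CState) (n : ℤ) :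
    restrictShell s' β (vFresh α β θ K S) n = 0 ∨ (n ∈ win K ∧ restrictShell s' β (vFresh α β θ K S) n = vFresh α β θ K S n) := by
  by_cases hsh : shellLo s' ≤ |β + (n : ℝ)| ∧ |β + (n : ℝ)| < shellHi s'
  · by_cases hn : n ∈ win K
    · right; exact ⟨hn, by funext i; simp [restrictShell, hsh]⟩
    · left; funext i; simp [restrictShell, vFresh, hn]
  · left; funext i; simp only [restrictShell, if_neg hsh, Pi.zero_apply]

/-- **Every output piece of one phase, GIVEN the line law:** `outEnergyAt … ℓ s′ (phasePieces … ζ) t′ ≤ C(2C + 3(θ²+2))·E_ℓ(ζ)` (both types, every target shell). -/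
theorem outEnergyAt_le_of_lineLaw {C : ℝ} (hL : LineLaw C) (hC : 0 ≤ C) {α β : ℝ} (hα0 : 0 ≤ α) (hα1 : α ≤ 1) (hβ0 : 0 ≤ β) (hβ1 : β ≤ 1)
    {θ : ℝ} (hθ0 : 0 ≤ θ) (hθ : θ ≤ 8) (K ℓ s' : ℕ) (ζ : CState) (t' : PType) :
    outEnergyAt α β θ K ℓ s' (phasePieces α β θ K ζ) t' ≤ C * (2 * C + 3 * (θ ^ 2 + 2)) * cEnergy α β ℓ K ζ := by
  have hE0 : 0 ≤ cEnergy α β ℓ K ζ := Finset.sum_nonneg fun _ _ => Finset.sum_nonneg fun _ _ => by positivity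
  cases t' with
  | H =>
    simp only [outEnergyAt, phasePieces]
    refine (cEnergy_vTransport_le α β θ ℓ K _).trans ?_
    have h := cEnergy_hPairState_le_of_rows hL hC hβ0 hβ1 hθ0 hθ ℓ K ζ _ (restrictShell_hFresh_rows s' α β θ K ζ)
    calc (θ ^ 2 + 2) * cEnergy α β ℓ K (hPairState β (restrictShell s' α (hFresh α β θ K ζ))) ≤ (θ ^ 2 + 2) * (C * cEnergy α β ℓ K ζ) :=
          mul_le_mul_of_nonneg_left h (by positivity)
      _ ≤ C * (2 * C + 3 * (θ ^ 2 + 2)) * cEnergy α β ℓ K ζ := by nlinarith [mul_nonneg hC hE0, mul_nonneg (mul_nonneg hC hC) hE0, sq_nonneg θ]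
  | V =>
    simp only [outEnergyAt, phasePieces]
    set S : CState := fun m n => hTransport α β θ K ζ m n + hPairState β (hFresh α β θ K ζ) m n with hS
    have h1 := cEnergy_vPairState_le_of_cols hL hC hα0 hα1 hθ0 hθ ℓ K S _ (restrictShell_vFresh_cols s' α β θ K S)
    have h2 : cEnergy α β ℓ K S ≤ (1 + 1 / 1) * cEnergy α β ℓ K (hTransport α β θ K ζ) + (1 + 1) * cEnergy α β ℓ K (hPairState β (hFresh α β θ K ζ)) :=
      cEnergy_add_le_young α β ℓ K _ _ one_pos
    have h3 := cEnergy_hTransport_le α β θ ℓ K ζ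
    have h4 := cEnergy_hPairState_le_of_rows hL hC hβ0 hβ1 hθ0 hθ ℓ K ζ (hFresh α β θ K ζ) fun m => by
      by_cases hm : m ∈ win K
      · exact Or.inr ⟨hm, rfl⟩
      · exact Or.inl (by funext i; simp [hFresh, hm])
    have hS4 : cEnergy α β ℓ K S ≤ (2 * (θ ^ 2 + 2) + 2 * C) * cEnergy α β ℓ K ζ := by norm_num at h2; nlinarith
    calc cEnergy α β ℓ K (vPairState α (restrictShell s' β (vFresh α β θ K S))) ≤ C * cEnergy α β ℓ K S := h1
      _ ≤ C * ((2 * (θ ^ 2 + 2) + 2 * C) * cEnergy α β ℓ K ζ) := mul_le_mul_of_nonneg_left hS4 hC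
      _ ≤ C * (2 * C + 3 * (θ ^ 2 + 2)) * cEnergy α β ℓ K ζ := by nlinarith [mul_nonneg hC hE0, mul_nonneg (mul_nonneg hC hC) hE0, sq_nonneg θ]

/-- **THE TRANSFER CLAUSE, every cell, GIVEN the line law.** -/
theorem transfer_of_lineLaw {C : ℝ} (hL : LineLaw C) (hC : 0 ≤ C) {α β : ℝ} (hα0 : 0 ≤ α) (hα1 : α < 1) (hβ0 : 0 ≤ β) (hβ1 : β < 1)
    {θ : ℝ} (hθ0 : 0 ≤ θ) (hθ : θ ≤ 8) (K : ℕ) (t : PType) (s : ℕ) (t' : PType) (s' : ℕ) :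
    Transfer α β θ K t s t' s' (Real.sqrt (C * (2 * C + 3 * (θ ^ 2 + 2)))) := by
  intro d _
  set Z := inputState α β θ K t d with hZ
  have hZw : ∀ m n : ℤ, (m ∉ win K ∨ n ∉ win K) → Z m n = 0 := fun m n h => inputState_apply_eq_zero α β θ K t d m n h
  rw [Real.sq_sqrt (by positivity)]
  have hchild : ∀ pm ∈ parities, ∀ pn ∈ parities,
      outEnergy ((α + pm) / 2) ((β + pn) / 2) θ K s' (phasePieces ((α + pm) / 2) ((β + pn) / 2) θ K (child pm pn Z)) t' ≤
        C * (2 * C + 3 * (θ ^ 2 + 2)) * cEnergy ((α + pm) / 2) ((β + pn) / 2) (0 + 1) K (child pm pn Z) := by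
    intro pm hpm pn hpn
    have hpm' : (pm : ℝ) = 0 ∨ (pm : ℝ) = 1 := by
      have : pm = 0 ∨ pm = 1 := by simpa [parities] using hpm
      rcases this with h | h <;> simp [h]
    have hpn' : (pn : ℝ) = 0 ∨ (pn : ℝ) = 1 := by
      have : pn = 0 ∨ pn = 1 := by simpa [parities] using hpn
      rcases this with h | h <;> simp [h]
    have ha0 : 0 ≤ (α + pm) / 2 := by rcases hpm' with h | h <;> rw [h] <;> linarith
    have ha1 : (α + pm) / 2 ≤ 1 := by rcases hpm' with h | h <;> rw [h] <;> linarith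
    have hb0 : 0 ≤ (β + pn) / 2 := by rcases hpn' with h | h <;> rw [h] <;> linarith
    have hb1 : (β + pn) / 2 ≤ 1 := by rcases hpn' with h | h <;> rw [h] <;> linarith
    exact outEnergyAt_le_of_lineLaw hL hC ha0 ha1 hb0 hb1 hθ0 hθ K (0 + 1) s' _ t'
  calc (∑ pm ∈ parities, ∑ pn ∈ parities,
          outEnergy ((α + pm) / 2) ((β + pn) / 2) θ K s' (phasePieces ((α + pm) / 2) ((β + pn) / 2) θ K (child pm pn Z)) t')
      ≤ ∑ pm ∈ parities, ∑ pn ∈ parities, C * (2 * C + 3 * (θ ^ 2 + 2)) * cEnergy ((α + pm) / 2) ((β + pn) / 2) (0 + 1) K (child pm pn Z) :=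
        Finset.sum_le_sum fun pm hpm => Finset.sum_le_sum fun pn hpn => hchild pm hpm pn hpn
    _ = C * (2 * C + 3 * (θ ^ 2 + 2)) * ∑ pm ∈ parities, ∑ pn ∈ parities, cEnergy ((α + pm) / 2) ((β + pn) / 2) (0 + 1) K (child pm pn Z) := by
        rw [Finset.mul_sum]; refine Finset.sum_congr rfl fun pm _ => ?_; rw [Finset.mul_sum]
    _ ≤ C * (2 * C + 3 * (θ ^ 2 + 2)) * cEnergy α β 0 K Z :=
        mul_le_mul_of_nonneg_left (sum_cEnergy_child_le α β 0 K Z hZw) (by positivity)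

/-- **The debris lineage into ANY target, GIVEN the line law** (induction on the age as in §25). -/
theorem debrisOut_le_of_lineLaw {C : ℝ} (hL : LineLaw C) (hC : 0 ≤ C) {θ : ℝ} (hθ0 : 0 ≤ θ) (hθ : θ ≤ 8) (K : ℕ) (t' : PType) (s' : ℕ) :
    ∀ (k ℓ : ℕ) (α β : ℝ) (ζ : CState), 0 ≤ α → α < 1 → 0 ≤ β → β < 1 → (∀ m n : ℤ, (m ∉ win K ∨ n ∉ win K) → ζ m n = 0) →
      debrisOut θ K t' s' k ℓ α β ζ ≤ ((θ ^ 2 + 2) ^ 2) ^ k * (C * (2 * C + 3 * (θ ^ 2 + 2))) * cEnergy α β ℓ K ζ := by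
  intro k
  induction k with
  | zero =>
    intro ℓ α β ζ hα0 hα1 hβ0 hβ1 hζ
    simp only [debrisOut, pow_zero, one_mul]
    have hchild : ∀ pm ∈ parities, ∀ pn ∈ parities,
        outEnergyAt ((α + pm) / 2) ((β + pn) / 2) θ K (ℓ + 1) s' (phasePieces ((α + pm) / 2) ((β + pn) / 2) θ K (child pm pn ζ)) t' ≤
          C * (2 * C + 3 * (θ ^ 2 + 2)) * cEnergy ((α + pm) / 2) ((β + pn) / 2) (ℓ + 1) K (child pm pn ζ) := by
      intro pm hpm pn hpn
      have hpm' : (pm : ℝ) = 0 ∨ (pm : ℝ) = 1 := by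
        have : pm = 0 ∨ pm = 1 := by simpa [parities] using hpm
        rcases this with h | h <;> simp [h]
      have hpn' : (pn : ℝ) = 0 ∨ (pn : ℝ) = 1 := by
        have : pn = 0 ∨ pn = 1 := by simpa [parities] using hpn
        rcases this with h | h <;> simp [h]
      have ha0 : 0 ≤ (α + pm) / 2 := by rcases hpm' with h | h <;> rw [h] <;> linarith
      have ha1 : (α + pm) / 2 ≤ 1 := by rcases hpm' with h | h <;> rw [h] <;> linarith
      have hb0 : 0 ≤ (β + pn) / 2 := by rcases hpn' with h | h <;> rw [h] <;> linarith
      have hb1 : (β + pn) / 2 ≤ 1 := by rcases hpn' with h | h <;> rw [h] <;> linarith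
      exact outEnergyAt_le_of_lineLaw hL hC ha0 ha1 hb0 hb1 hθ0 hθ K (ℓ + 1) s' _ t'
    calc (∑ pm ∈ parities, ∑ pn ∈ parities,
            outEnergyAt ((α + pm) / 2) ((β + pn) / 2) θ K (ℓ + 1) s' (phasePieces ((α + pm) / 2) ((β + pn) / 2) θ K (child pm pn ζ)) t')
        ≤ ∑ pm ∈ parities, ∑ pn ∈ parities, C * (2 * C + 3 * (θ ^ 2 + 2)) * cEnergy ((α + pm) / 2) ((β + pn) / 2) (ℓ + 1) K (child pm pn ζ) :=
          Finset.sum_le_sum fun pm hpm => Finset.sum_le_sum fun pn hpn => hchild pm hpm pn hpn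
      _ = C * (2 * C + 3 * (θ ^ 2 + 2)) * ∑ pm ∈ parities, ∑ pn ∈ parities, cEnergy ((α + pm) / 2) ((β + pn) / 2) (ℓ + 1) K (child pm pn ζ) := by
          rw [Finset.mul_sum]; refine Finset.sum_congr rfl fun pm _ => ?_; rw [Finset.mul_sum]
      _ ≤ C * (2 * C + 3 * (θ ^ 2 + 2)) * cEnergy α β ℓ K ζ :=
          mul_le_mul_of_nonneg_left (sum_cEnergy_child_le α β ℓ K ζ hζ) (by positivity)
  | succ k ih =>
    intro ℓ α β ζ hα0 hα1 hβ0 hβ1 hζ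
    simp only [debrisOut]
    have hchild : ∀ pm ∈ parities, ∀ pn ∈ parities,
        debrisOut θ K t' s' k (ℓ + 1) ((α + pm) / 2) ((β + pn) / 2) (phasePieces ((α + pm) / 2) ((β + pn) / 2) θ K (child pm pn ζ)).debris ≤
          ((θ ^ 2 + 2) ^ 2) ^ k * (C * (2 * C + 3 * (θ ^ 2 + 2))) *
            ((θ ^ 2 + 2) ^ 2 * cEnergy ((α + pm) / 2) ((β + pn) / 2) (ℓ + 1) K (child pm pn ζ)) := by
      intro pm hpm pn hpn
      have hpm' : (pm : ℝ) = 0 ∨ (pm : ℝ) = 1 := by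
        have : pm = 0 ∨ pm = 1 := by simpa [parities] using hpm
        rcases this with h | h <;> simp [h]
      have hpn' : (pn : ℝ) = 0 ∨ (pn : ℝ) = 1 := by
        have : pn = 0 ∨ pn = 1 := by simpa [parities] using hpn
        rcases this with h | h <;> simp [h]
      have ha0 : 0 ≤ (α + pm) / 2 := by rcases hpm' with h | h <;> rw [h] <;> linarith
      have ha1 : (α + pm) / 2 < 1 := by rcases hpm' with h | h <;> rw [h] <;> linarith
      have hb0 : 0 ≤ (β + pn) / 2 := by rcases hpn' with h | h <;> rw [h] <;> linarith
      have hb1 : (β + pn) / 2 < 1 := by rcases hpn' with h | h <;> rw [h] <;> linarith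
      refine (ih (ℓ + 1) _ _ _ ha0 ha1 hb0 hb1 fun m n h => phasePieces_debris_apply_eq_zero _ _ θ K _ m n h).trans ?_
      exact mul_le_mul_of_nonneg_left (cEnergy_debris_le _ _ θ (ℓ + 1) K _) (by positivity)
    calc (∑ pm ∈ parities, ∑ pn ∈ parities,
            debrisOut θ K t' s' k (ℓ + 1) ((α + pm) / 2) ((β + pn) / 2) (phasePieces ((α + pm) / 2) ((β + pn) / 2) θ K (child pm pn ζ)).debris)
        ≤ ∑ pm ∈ parities, ∑ pn ∈ parities, ((θ ^ 2 + 2) ^ 2) ^ k * (C * (2 * C + 3 * (θ ^ 2 + 2))) *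
            ((θ ^ 2 + 2) ^ 2 * cEnergy ((α + pm) / 2) ((β + pn) / 2) (ℓ + 1) K (child pm pn ζ)) :=
          Finset.sum_le_sum fun pm hpm => Finset.sum_le_sum fun pn hpn => hchild pm hpm pn hpn
      _ = ((θ ^ 2 + 2) ^ 2) ^ k * (C * (2 * C + 3 * (θ ^ 2 + 2))) * (θ ^ 2 + 2) ^ 2 *
            ∑ pm ∈ parities, ∑ pn ∈ parities, cEnergy ((α + pm) / 2) ((β + pn) / 2) (ℓ + 1) K (child pm pn ζ) := by
          rw [Finset.mul_sum]; refine Finset.sum_congr rfl fun pm _ => ?_; rw [Finset.mul_sum]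
          exact Finset.sum_congr rfl fun pn _ => by ring
      _ ≤ ((θ ^ 2 + 2) ^ 2) ^ k * (C * (2 * C + 3 * (θ ^ 2 + 2))) * (θ ^ 2 + 2) ^ 2 * cEnergy α β ℓ K ζ :=
          mul_le_mul_of_nonneg_left (sum_cEnergy_child_le α β ℓ K ζ hζ) (by positivity)
      _ = ((θ ^ 2 + 2) ^ 2) ^ (k + 1) * (C * (2 * C + 3 * (θ ^ 2 + 2))) * cEnergy α β ℓ K ζ := by rw [pow_succ]; ring

/-- **THE DEBRIS-TRANSFER CLAUSE, every cell and age, GIVEN the line law.** -/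
theorem debrisTransfer_of_lineLaw {C : ℝ} (hL : LineLaw C) (hC : 0 ≤ C) {α β : ℝ} (hα0 : 0 ≤ α) (hα1 : α < 1) (hβ0 : 0 ≤ β) (hβ1 : β < 1)
    {θ : ℝ} (hθ0 : 0 ≤ θ) (hθ : θ ≤ 8) (K k : ℕ) (t : PType) (s : ℕ) (t' : PType) (s' : ℕ) :
    DebrisTransfer α β θ K k t s t' s' (Real.sqrt (C * (2 * C + 3 * (θ ^ 2 + 2))) * ((θ ^ 2 + 2) ^ k)) := by
  intro d _
  set Z := inputState α β θ K t d with hZ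
  have hZw : ∀ m n : ℤ, (m ∉ win K ∨ n ∉ win K) → Z m n = 0 := fun m n h => inputState_apply_eq_zero α β θ K t d m n h
  refine (debrisOut_le_of_lineLaw hL hC hθ0 hθ K t' s' k 0 α β Z hα0 hα1 hβ0 hβ1 hZw).trans (le_of_eq ?_)
  rw [mul_pow, Real.sq_sqrt (by positivity), ← pow_mul, pow_mul', ← pow_mul]
  ring_nf

/-- **`EntryBoundsW` FROM THE LINE LAW** — every cell, class, truncation, age; `M = √(C(2C+3(θ²+2)))`, `D_k = M(θ²+2)^k`. -/
theorem entryBoundsW_of_lineLaw {C : ℝ} (hL : LineLaw C) (hC : 0 ≤ C) {θ : ℝ} (hθ0 : 0 ≤ θ) (hθ : θ ≤ 8) :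
    EntryBoundsW θ 0 (fun _ _ => Real.sqrt (C * (2 * C + 3 * (θ ^ 2 + 2))))
      (fun k _ _ => Real.sqrt (C * (2 * C + 3 * (θ ^ 2 + 2))) * (θ ^ 2 + 2) ^ k) := by
  intro K _ α β hα hβ i j
  exact ⟨transfer_of_lineLaw hL hC hα.1 hα.2 hβ.1 hβ.2 hθ0 hθ K j.1 j.2 i.1 i.2,
    fun k _ => debrisTransfer_of_lineLaw hL hC hα.1 hα.2 hβ.1 hβ.2 hθ0 hθ K k j.1 j.2 i.1 i.2⟩

/-- **`EntryBoundsW` MODULO B1 (the unit strip):** the core-line creation law `CoreLineLaw C` (lines `|a| < 1`, exact line-energy form) with ANY `C ≥ 0` gives the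
whole entry clause — fresh transfer AND debris of every age, every cell `(t,s) → (t′,s′)`, every class `(α,β) ∈ [0,1)²`, every truncation — with
`C′ = max C (1280000(π+4))`, `M = √(C′(2C′+3(θ²+2)))`, `D_k = M·(θ²+2)^k`.  PROVED unconditionally: the law on all lines `|a| ≥ 1` (§26) and everything
downstream (§23–§25); NAMED: `CoreLineLaw C` — the KH band `|a| < 0.64` and `[0.64, 1)`, where stability of the typed block is not in the tree. -/
theorem entryBoundsW_of_coreLineLaw {C : ℝ} (hCL : CoreLineLaw C) (hC : 0 ≤ C) {θ : ℝ} (hθ0 : 0 ≤ θ) (hθ : θ ≤ 8) :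
    EntryBoundsW θ 0
      (fun _ _ => Real.sqrt (max C (1280000 * (Real.pi + 4)) * (2 * max C (1280000 * (Real.pi + 4)) + 3 * (θ ^ 2 + 2))))
      (fun k _ _ => Real.sqrt (max C (1280000 * (Real.pi + 4)) * (2 * max C (1280000 * (Real.pi + 4)) + 3 * (θ ^ 2 + 2))) * (θ ^ 2 + 2) ^ k) :=
  entryBoundsW_of_lineLaw (lineLaw_of_core hCL) (le_trans hC (le_max_left _ _)) hθ0 hθ


end

end Summit.AnomalousDissipation.AnomalousDissipation.Cruxes.K1LocalisedCascade.K2CreationLaws
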